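import Summits.QuantumFields.YangMills.Theorems.BalabanUVNodesN06Thm312313AtPinsPairMBCZP
import Literature.MathematicalPhysics.QuantumFieldTheory.Balaban1983to89.B9RWSumsDefinitePinsPairMDir
import Literature.MathematicalPhysics.QuantumFieldTheory.Balaban1983to89.B9LettersHZAtOne
import Summits.QuantumFields.YangMills.Theorems.BalabanUVNodesN06G0LayerFromThm310AtPinsE
import Summits.QuantumFields.YangMills.Theorems.BalabanUVNodesN06StepDirLayerAtPinsBCZX
import Summits.QuantumFields.YangMills.Theorems.BalabanUVNodesN06ProbeZeroAtPinsPhys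
import Summits.QuantumFields.YangMills.Theorems.BalabanUVNodesN06MixedLegAtPinsPhys
import Summits.QuantumFields.YangMills.Theorems.BalabanUVNodesN06SplitMajorantsAtPinsPhys
import Summits.QuantumFields.YangMills.Theorems.BalabanUVNodesN06Proj349AtPinsPhys
import Summits.QuantumFields.YangMills.Theorems.BalabanUVNodesN06StepL2AtPinsPhys
import Literature.MathematicalPhysics.QuantumFieldTheory.Balaban1983to89.B9Ineq349SiteThresholdRate
import Literature.MathematicalPhysics.QuantumFieldTheory.Balaban1983to89.B9Eq346GradGpDivAtPinsL2Closed
import Literature.MathematicalPhysics.QuantumFieldTheory.Balaban1983to89.B9CoReadingCoordsInputLoc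
import Literature.MathematicalPhysics.QuantumFieldTheory.Balaban1983to89.B9Thm31GpMajFromPinsPairM
import Summits.QuantumFields.YangMills.Theorems.BalabanUVNodesN06SectBOfFrameV7
import Summits.QuantumFields.YangMills.Theorems.BalabanUVNodesN06SectDUnitsAtPinsPhys
import Literature.MathematicalPhysics.QuantumFieldTheory.Balaban1983to89.B9Eq3132FacesAtLetters
import Literature.MathematicalPhysics.QuantumFieldTheory.Balaban1983to89.Node00.OpsYRecordV4P
import Literature.MathematicalPhysics.QuantumFieldTheory.Balaban1983to89.B9Thm39OneCubeReadingAtLettersY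
import Literature.MathematicalPhysics.QuantumFieldTheory.Balaban1983to89.B9CoReadingCoordsHolderAdmReadings
import Literature.MathematicalPhysics.QuantumFieldTheory.Balaban1983to89.B9CoReadingCoordsHolderSAdmReadings
import Summits.QuantumFields.YangMills.Theorems.BalabanUVNodesN06DirKinematicsAtPins
import Literature.MathematicalPhysics.QuantumFieldTheory.Balaban1983to89.B9PerturbationSplitAtLetters
import Literature.MathematicalPhysics.QuantumFieldTheory.Balaban1983to89.B9Ineq349SiteFacesAtLetters

/-!
# BalabanUVNodes ∕ N06 ([B9], `Dag.B9_main`) — THE STAGE-11 CERTIFICATE, EDITION 33: ROWS 18's MIXED `L²` LEG (print's (3.46) line for `∇_{U,ν} M_{h_□} G′_□ M_{h_□} ∇*_{U,μ}`)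
# DERIVED from dag-n06-w1's □-uniform Agmon estimates through dag-n06-w7's reading — the walk's cube index PINNED (`ι := cubes`, `S_□ := SblkY`), the partition function `h_□` and the
# cube Green's functions `G′_□` PINNED to def-Y's `hWalkY ∕ gsqcoS`, the overlap count derived; everything else as in edition 32

Track A of `YM-PLAN.md` (cell `pub-ymgap`, D-0062), node **N06** = [Balaban1985BackgroundPropagators] Thms 3.1–3.15; seat `pub-ymgap-dag-n06-d` (gen 11); successor of editions 32∕31∕30. (p. 398 (3.46), Cor. 3.6 p. 408, (3.87)–(3.90) pp. 409–410: the mixed second-order entry of the walk factors,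
`|∇_U h_□ G′_□ h_□ ∇*_U|` in block-L², uniformly over the cubes □): editions ≤ 32 display it inside `h36H` as the schema `L2MixedLegs37 (𝔬 x) (𝔡 x) 1 (H x) (SM x) pM.BM p.δ₀ U` over a FREE cube index `ι x` and a free site family `SM`. dag-n06-w1 PROVED the □- and member-uniform decaying estimate
(`B9Thm31SiteGsq…` files 19–25), dag-n06-w7 READ it into the schema's exact shape at the coordinate pins (`B9Eq346MixedLegAtCubesTorusL2`, `B9Eq346MixedLegAtPinsL2.l2MixedLegs37_memberY`, p617225; constants NAMED `MMix aMix BMix δMix` in `…Closed`, `l2MixedLegs37_memberY_at`) for the cube-indexed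
letters `ι := ↥(cubes x.toKIdx.D.toDomains)`, `S_□ := SblkY x (bI x) □` (the sites of `□̃`), `h_□ := hWalkY x □`, `G′_□ := gsqcoS x (trBasis N) (bg9Y …) (fun U => U) (parSymY x.toKIdx) □ U` (this seat's W-a letters `B9WalkLettersCoordsS`, p606221). THIS EDITION consumes it: BINDER DIFF vs ed. 32:
the implicit index `ι` of the G′ walk letters LEAVES (`𝔬 ∕ rd ∕ SH S3 SI` now over the cubes), the family `SM` and its count `hcntM` LEAVE, the shape pin `hGsqS` LEAVES (it follows from the full pin); ADDED pins `hhS : ∀ x □, (𝔬 x).h □ = hWalkY x □`, `hGsqF : ∀ x U □, (𝔬 x).Gsq U □ = gsqcoS … □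
U`, the member floor `hMw : ∀ x, walkCntM₀Y … ≤ (geo9Y x).M` with `hNMw : walkCntY … ≤ pM.NM` (the overlap count `hcntM` of `S_□` is then this seat's `sum_indicator_SblkY_le` via `N06MixedLegAtPinsPhys.hcntM_of_walkCnt`), and four numerics pinning the displayed constants to dag-n06-w7's named
ones: `hM1mix : MMix … ≤ p.M₁`, `ha1mix : p.a₁ ≤ aMix …`, `hBMmix : BMix … ≤ pM.BM`, `hδmix : p.δ₀ ≤ δMix …`; in `h36H` the conjunct `L2MixedLegs37 …` is REMOVED (derived inside by `N06MixedLegAtPinsPhys.l2MixedLegs37_of_pins` — dag-n06-w7's theorem at the named constants, weakened to `pM.BM ∕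
p.δ₀` by kernel domination — and re-inserted by `h36H_of_mixed` before `h36H_of_dir_pins`). Numerics: four new side conditions on free displayed numerics against positive named constants (guard to be refreshed as `numerics_inhabited_ed33`, ∀ positive `MMix aMix BMix δMix`); conclusion identical.
Still displayed (the node's content): rows 18–19 `hst hκ hrd hloc h36 h36H hhS hGsqF` + A twins; rows 20–21 `hXd hdiv hlettersH12 hLHH hLH3 hLL2 hLIM hletters13 hlettersD13 hBJ hta₂ htb₂ hta₂R htb₂R hL3131H hD2sup hIds3124 hΔ2`; `hΔA hPD hB h348`; `E14 … hexp14`, `hE`. HONEST FRAMING. Kernel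
bookkeeping; the analytic content of the derived leg is dag-n06-w1's ∕ dag-n06-w7's kernel-checked theorems consumed by name; COUNT-NEUTRAL; NOT a discharge claim (inhabitation at `U ≠ 1` not on record); N06 NOT discharged NOR refuted; NOT continuum ∕ OS ∕ mass gap ∕ Clay. 0 `def`, 0 `sorry`.
-/

noncomputable section

namespace Summit.QuantumFields.YangMills.BalabanUVNodes.N06AtOpsYNuOfRecordV6EPairNN

open Literature.MathematicalPhysics.QuantumFieldTheory.Balaban1983to89 open Literature.MathematicalPhysics.QuantumFieldTheory.Balaban1983to89.T4Continuum (T4Family) open Literature.MathematicalPhysics.QuantumFieldTheory.Balaban1983to89.DagBinding (WorldP leavesP) open Literature.MathematicalPhysics.QuantumFieldTheory.Balaban1983to89.Node00 open Literature.MathematicalPhysics.QuantumFieldTheory.Balaban1983to89.B9PinMembersKLevelV1 (MemberY geo9Y bg9Y) open Literature.MathematicalPhysics.QuantumFieldTheory.Balaban1983to89.B9PinGeometryKLevelV1 (dOmegaY OmKY inΛY unitDistY InCubeY c35Y c35Y_pos) open Literature.MathematicalPhysics.QuantumFieldTheory.Balaban1983to89.B7Prop2SpecialUnitary (specialUnitaryUnits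 specialUnitaryUnits_le_unitaryUnits) open Literature.MathematicalPhysics.QuantumFieldTheory.Balaban1983to89.B9Ineq347GAAtLetters (hGA_opsYOfLetters) open Literature.MathematicalPhysics.QuantumFieldTheory.Balaban1983to89.B9Ineq344LocalPairHolds (hGp_opsYOfLetters_holds) open Literature.MathematicalPhysics.QuantumFieldTheory.Balaban1983to89.B9Cor35ComparisonsGAAtLetters
  (hGA_e_opsYOfLetters hGA_h1_opsYOfLetters hGA_e4_opsYOfLetters hGA_h2_opsYOfLetters hGA_l2_opsYOfLetters) open Literature.MathematicalPhysics.QuantumFieldTheory.Balaban1983to89.B9CoReadingCoordsHolderAdm (holderProbesKA bond_h1ReadsNbr_of_pinsA) open Literature.MathematicalPhysics.QuantumFieldTheory.Balaban1983to89.B9CoReadingCoordsHolderAdmReadings (bond_coReadsHHolderNbr_of_pinsA bond_inputReadsFam_of_pinsA) open Literature.MathematicalPhysics.QuantumFieldTheory.Balaban1983to89.B9CoReadingCoordsHolderSAdm (holderProbesSA site_h1ReadsNbr_of_pinsSA) open Literature.MathematicalPhysics.QuantumFieldTheory.Balaban1983to89.B9CoReadingCoordsHolderSAdmReadings (site_inputReadsFam_of_pinsSA)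 open Summit.QuantumFields.YangMills.BalabanUVNodes.N06DirKinematicsAtPins (h36H_of_dir_pins h36HA_of_dir_pins h36_of_dirSq_pins)
open Literature.MathematicalPhysics.QuantumFieldTheory.Balaban1983to89.B9Cor35ComparisonsGpCAtLetters (hGp_e_opsYOfLetters hGp_h1_opsYOfLetters hC_opsYOfLetters) open Literature.MathematicalPhysics.QuantumFieldTheory.Balaban1983to89.B9Cor35ComparisonsEH (hE4_of_hGA_e4 hH2_of_hGA_h2) open Literature.MathematicalPhysics.QuantumFieldTheory.Balaban1983to89.B9Thm314Thm315RecordVacuity (thm315FullPrinted_of_ker_zero) open Literature.MathematicalPhysics.QuantumFieldTheory.Balaban1983to89.B9RecordDELettersVacuity (siteKernelOfOp_zero_ker fineKernelOfOp_zero_ker stmt349Printed_of_ker_zero) open Literature.MathematicalPhysics.QuantumFieldTheory.Balaban1983to89.B9GeoLemma21KLevelV1 (geo9Y_len_pos) open Literature.MathematicalPhysics.QuantumFieldTheory.Balaban1983to89.B9Thm311Whole (PosDefOfOps) open Literature.MathematicalPhysics.QuantumFieldTheory.Balaban1983to89.B9Thm39Whole (WalkReading39) open Literature.MathematicalPhysics.QuantumFieldTheory.Balaban1983to89.B9Thm39WholeBlk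 (Ops39Blk Conv348Blk)
open Literature.MathematicalPhysics.QuantumFieldTheory.Balaban1983to89.B9Thm39WholeBlkViaDatum (EK39OfOpsBlkVia) open Literature.MathematicalPhysics.QuantumFieldTheory.Balaban1983to89.B9Thm39ReadingFaithful (repSite39F) open Literature.MathematicalPhysics.QuantumFieldTheory.Balaban1983to89.B9Thm39OneCubeReadingAtLettersY (oneCubeOps39YF oneCubeReading39 t39_hksum_oneCube_opsYOfLetters_F) open Literature.MathematicalPhysics.QuantumFieldTheory.Balaban1983to89.B9RowSum261DefiniteFaces (rowConst261) open Summit.QuantumFields.YangMills.BalabanUVNodes.N06AtRecord11ObligationsPins (t311_of_pin) open Summit.QuantumFields.YangMills.BalabanUVNodes.N06AtRecord11ObligationsHg (hg_obligation_vacuous) open Summit.QuantumFields.YangMills.BalabanUVNodes.N06AtRecord11CB10YZW (b9_main_of_up_view₁₁B10YZW_of_obligations) open Literature.MathematicalPhysics.QuantumFieldTheory.Balaban1983to89.B9Thm312Whole (GeoOK Thm33G0 FormSmall HasRWExpOfOps HasRWExpHOfOps PosDefKOfOps cNorm PosDefEnd) open Literature.MathematicalPhysics.QuantumFieldTheory.Balaban1983to89.B11SectG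 (RowSum BlockNorm HasMaj) open Literature.MathematicalPhysics.QuantumFieldTheory.Balaban1983to89.B9FromB6 (L2Block) open Literature.MathematicalPhysics.QuantumFieldTheory.Balaban1983to89.B9Thm312WholeH (LettersH) open Literature.MathematicalPhysics.QuantumFieldTheory.Balaban1983to89.B9Thm312WholeLeft (LeftStep)
open Literature.MathematicalPhysics.QuantumFieldTheory.Balaban1983to89.B9Thm313WholeLeft (Letters313D) open Literature.MathematicalPhysics.QuantumFieldTheory.Balaban1983to89.B9Thm313Whole (Letters313) open Literature.MathematicalPhysics.QuantumFieldTheory.Balaban1983to89.B9Ineq347CoReading (CoReadsGlob) open Literature.MathematicalPhysics.QuantumFieldTheory.Balaban1983to89.B9Thm312WholeFacesY (lemma21AboveG_geo9Y) open Literature.MathematicalPhysics.QuantumFieldTheory.Balaban1983to89.B9GeoNormsKLevelV1 (geo9K_dist_nonneg) open Literature.MathematicalPhysics.QuantumFieldTheory.Balaban1983to89.B9GeoLemma21KLevelV1 (distOK_geo9Y rowSum261_geo9Y geo9Y_dist_triangle geo9Y_dist_comm) open Literature.MathematicalPhysics.QuantumFieldTheory.Balaban1983to89.B9GeoNormsKLevelModelSignsV1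 (modelSignsOn_geo9K) open Literature.MathematicalPhysics.QuantumFieldTheory.Balaban1983to89.B9Thm34Ext (toB6) open Literature.MathematicalPhysics.QuantumFieldTheory.Balaban1983to89.B9CoRealizesRel (CoRealizesRel) open Literature.MathematicalPhysics.QuantumFieldTheory.Balaban1983to89.B9CoRealizesRelAtLetters (RelB maj342_relB_left maj342_relB_right dist_eq_of_relB len_eq_of_relB relB_refl)
open Literature.MathematicalPhysics.QuantumFieldTheory.Balaban1983to89.B9CoRealizesHRel (CoRealizesHRel) open Literature.MathematicalPhysics.QuantumFieldTheory.Balaban1983to89.B9SectCDiffDict (maj342) open Literature.MathematicalPhysics.QuantumFieldTheory.Balaban1983to89.B6Ineq2142KLevelV1 (β) open Literature.MathematicalPhysics.QuantumFieldTheory.Balaban1983to89.B9CarrierBlockMultiplicity (card_sameCarrier_le_kIdx) open Literature.MathematicalPhysics.QuantumFieldTheory.Balaban1983to89.B9Thm312WholeLeafRelH (thm312Printed_of_stepRelH) open Literature.MathematicalPhysics.QuantumFieldTheory.Balaban1983to89.B9Thm313WholeLeafRel (thm313Printed_of_stepRel) open Literature.MathematicalPhysics.QuantumFieldTheory.Balaban1983to89.B9Eq3132SectDLetters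 (QGQY) open Literature.MathematicalPhysics.QuantumFieldTheory.Balaban1983to89.B9Eq3132CTInputs (CoerciveUnder DecayUnder) open Literature.MathematicalPhysics.QuantumFieldTheory.Balaban1983to89.B9Eq3132ScalarIndex (geoComap) open Literature.MathematicalPhysics.QuantumFieldTheory.Balaban1983to89.B9Eq3132RingInverseReading (normMatY) open Literature.MathematicalPhysics.QuantumFieldTheory.Balaban1983to89.B9Ineq349SiteReading (opsYS349OfRecordDE) open Literature.MathematicalPhysics.QuantumFieldTheory.Balaban1983to89.B9Eq3132AtRecordDE (s3132_opsYOfRecordDE)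
open Literature.MathematicalPhysics.QuantumFieldTheory.Balaban1983to89.B9Thm314Thm315RecordDE (thm314_pair_opsYOfRecordDE t315_opsYOfRecordDE_of_slots) open Literature.MathematicalPhysics.QuantumFieldTheory.Balaban1983to89.B9Thm311ReadingAtLetters (ops311Y) open Literature.MathematicalPhysics.QuantumFieldTheory.Balaban1983to89.B9Thm311ReadingCoords (PosDefTr) open Literature.MathematicalPhysics.QuantumFieldTheory.Balaban1983to89.B9Thm311SymmAtRecordV4 (proofLettersOneV4) open Literature.MathematicalPhysics.QuantumFieldTheory.Balaban1983to89.B9Thm311PosAtRecordV4 (t311_of_pins_opsYOfLettersV4₁) open Literature.MathematicalPhysics.QuantumFieldTheory.Balaban1983to89.B9PinGeometryKLevelV1 (kLab) open Literature.MathematicalPhysics.QuantumFieldTheory.Balaban1983to89.B9Thm314GpFlatTorusGeometry (tdistK OmegaC) open Literature.MathematicalPhysics.QuantumFieldTheory.Balaban1983to89.B9Thm314WholePinGeometry (locDataY) open Literature.MathematicalPhysics.QuantumFieldTheory.Balaban1983to89.B9Thm314WholePair (locData₂) open Literature.MathematicalPhysics.QuantumFieldTheory.Balaban1983to89.B9Thm314WholePairWalks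 (pairWalkSets) open Literature.MathematicalPhysics.QuantumFieldTheory.Balaban1983to89.B9Thm314WholeSummation (WalkSetsSpec WalkWeightsSummable) open Literature.MathematicalPhysics.QuantumFieldTheory.Balaban1983to89.B9SectCWalkTermsAllNorms (Thm310AllNormsPrinted) open Literature.MathematicalPhysics.QuantumFieldTheory.Balaban1983to89.B9Thm314WholeExpansionReads (ExpansionReads) open Literature.MathematicalPhysics.QuantumFieldTheory.Balaban1983to89.B9Thm314WholeCancellationLayer (pairOp) open Literature.MathematicalPhysics.QuantumFieldTheory.Balaban1983to89.B9Thm37Whole (Ops Sizes StaticOK Local342 Identities)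
open Literature.MathematicalPhysics.QuantumFieldTheory.Balaban1983to89.B9Cor38Whole (WalkReading Locality) open Literature.MathematicalPhysics.QuantumFieldTheory.Balaban1983to89.B9Thm310Whole (Ops310 WalkReading310 Sizes310 StaticOK310 Locality310 Local342G Identities310) open Literature.MathematicalPhysics.QuantumFieldTheory.Balaban1983to89.B9RWSumsDefinitePins (PinPrims) open Literature.MathematicalPhysics.QuantumFieldTheory.Balaban1983to89.B9RWSumsDefinitePinsPair (PairPrims) open Literature.MathematicalPhysics.QuantumFieldTheory.Balaban1983to89.B9RWSumsDefinitePinsPairM (MixedPrims E37YPairM E310YPairM) open Literature.MathematicalPhysics.QuantumFieldTheory.Balaban1983to89.B9RWSumsDefinitePinsPairMDir (E37YPairMDir rows131819_definite_geo9Y_pairM_dir) open Literature.MathematicalPhysics.QuantumFieldTheory.Balaban1983to89.B9Thm37WholeDir (DirLetters37 Identities₂ DirSupSq37) open Literature.MathematicalPhysics.QuantumFieldTheory.Balaban1983to89.B9Cor38WholeDir (LocalityDir) open Literature.MathematicalPhysics.QuantumFieldTheory.Balaban1983to89.B9Thm37KLetterDir (HolderV37Dir FactorsL2Second37Dir FactorsInputPair37Dir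 FactorsL2Mixed37Dir) open Literature.MathematicalPhysics.QuantumFieldTheory.Balaban1983to89.B9RWSums344InputFam (InputReadsFam sliceProbe) open Literature.MathematicalPhysics.QuantumFieldTheory.Balaban1983to89.B9RWSums344InputPair (InputLegsPair37 FactorsInputPair37 DirSupHolder37 InputLegsPair310 FactorsInputPair310 DirSupHolder310) open Literature.MathematicalPhysics.QuantumFieldTheory.Balaban1983to89.B9RWSums346MixedPair (L2MixedLegs37 FactorsL2Mixed37 DirSup37 L2MixedLegs310 FactorsL2Mixed310 DirSup310) open Literature.MathematicalPhysics.QuantumFieldTheory.Balaban1983to89.B9CoReadingCoordsTranspose (TrIdx trBasis isTransposePair_GcoK_trBasis isTransposePair_DcoK_GcoK_trBasis isTransposePair_GcoS_trBasis isTransposePair_DcoS_GcoS_trBasis) open Literature.MathematicalPhysics.QuantumFieldTheory.Balaban1983to89.B9Thm311SymmAtRecordV4 (symm0_parSymY symmG_parSymY) open Literature.MathematicalPhysics.QuantumFieldTheory.Balaban1983to89.B9Thm311AdjointPairs (GpY_isSymmTr) open Literature.MathematicalPhysics.QuantumFieldTheory.Balaban1983to89.B9RWSums346SecondDiff (familyOp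 DirOps310 DirTranspose310 L2SecondLegs310 FactorsL2Second310) open Literature.MathematicalPhysics.QuantumFieldTheory.Balaban1983to89.B9RWSums346SecondDiffGp (DirOps37 DirTranspose37 L2SecondLegs37 FactorsL2Second37) open Literature.MathematicalPhysics.QuantumFieldTheory.Balaban1983to89.B9Thm37Glue (IsTransposePair) open Literature.MathematicalPhysics.QuantumFieldTheory.Balaban1983to89.B9RWSums343to347Whole (GlobReads) open Literature.MathematicalPhysics.QuantumFieldTheory.Balaban1983to89.B9RWSumsReadsNbr (nbr L2ReadsNbr H1ReadsNbr InputReadsNbr) open Literature.MathematicalPhysics.QuantumFieldTheory.Balaban1983to89.B9RWSums346Two (L2TwoLegs310 FactorsL2_310) open Literature.MathematicalPhysics.QuantumFieldTheory.Balaban1983to89.B9RWSums346TwoGp (L2TwoLegs37 FactorsL2_37) open Literature.MathematicalPhysics.QuantumFieldTheory.Balaban1983to89.B9RWSums344Input (InputLegs310 FactorsInput310)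
open Literature.MathematicalPhysics.QuantumFieldTheory.Balaban1983to89.B9RWSums344InputGp (InputLegs37 FactorsInput37) open Literature.MathematicalPhysics.QuantumFieldTheory.Balaban1983to89.B9RWSums343Holder (HolderProbes HolderLegs310 FactorsHolder310) open Literature.MathematicalPhysics.QuantumFieldTheory.Balaban1983to89.B9RWSums343HolderGp (HolderLegs37 HolderV37) open Literature.MathematicalPhysics.QuantumFieldTheory.Balaban1983to89.B9SectBStepFrameV7 (SectBFrame₇) open Literature.MathematicalPhysics.QuantumFieldTheory.Balaban1983to89.B9Thm39ReadingCoords (cR39) open Summit.QuantumFields.YangMills.BalabanUVNodes.N06SectBOfFrameV7 (hB_obligation_of_sectBFrame₇)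
open Literature.MathematicalPhysics.QuantumFieldTheory.Balaban1983to89.B9CoReadingCoords (XBK evBK blkBK GcoK DcoK DscoK LcoK coordOpK cdBₗ cdsBₗ) open Literature.MathematicalPhysics.QuantumFieldTheory.Balaban1983to89.B9CoReadingCoordsS (XSK evSK blkSK sIK sIK_faithful GcoS DcoS DscoS LcoS) open Literature.MathematicalPhysics.QuantumFieldTheory.Balaban1983to89.B9CoReadingCoordsL2S (sIK_dist_le_one site_l2ReadsNbr012_of_pins site_l2ReadsNbr345_of_pins) open Literature.MathematicalPhysics.QuantumFieldTheory.Balaban1983to89.B9CoReadingCoordsL2Pair (bond_l2ReadsNbr345_of_pins) open Literature.MathematicalPhysics.QuantumFieldTheory.Balaban1983to89.B9Ineq349SiteComposite (cdSL cdsSL) open Literature.MathematicalPhysics.QuantumFieldTheory.Balaban1983to89.B9Thm312WholeLeafCompletePairM (thm312Printed_completePairM) open Literature.MathematicalPhysics.QuantumFieldTheory.Balaban1983to89.B9RWSumsCompleteGeo9YNbr (len_le_of_dist_le_two_geo9Y one_le_L_nat) open Literature.MathematicalPhysics.QuantumFieldTheory.Balaban1983to89.B9Thm312WholeDir (Thm33G0Dir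 Thm33G0L2M StepDir) open Literature.MathematicalPhysics.QuantumFieldTheory.Balaban1983to89.B9Thm312WholeL2 (StepL2) open Literature.MathematicalPhysics.QuantumFieldTheory.Balaban1983to89.B9Thm312WholeHHolder (LettersHH) open Literature.MathematicalPhysics.QuantumFieldTheory.Balaban1983to89.B9Thm312WholeHHolderNbr (CoReadsHHolderNbr) open Literature.MathematicalPhysics.QuantumFieldTheory.Balaban1983to89.B9Thm311ReadingCoords (IsSymmTr) open Summit.QuantumFields.YangMills.BalabanUVNodes.N06CoReadingsOfPins (bond_coReadings3_of_pins bond_coReadingsLap_of_pins site_coReadings4_of_pins bond_l2ReadsNbr3_of_pins) open Literature.MathematicalPhysics.QuantumFieldTheory.Balaban1983to89.B6Geom246MultiLevelTorus (geomT)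
open Literature.MathematicalPhysics.QuantumFieldTheory.Balaban1983to89.B9Eq3132NuReading (opsYS349NuOfLetters lamInvY) open Literature.MathematicalPhysics.QuantumFieldTheory.Balaban1983to89.B9GeoNbrCountKLevelV1 (nbrM₀Y nbrCountY hnbr_two_of_le) open Literature.MathematicalPhysics.QuantumFieldTheory.Balaban1983to89.B9CoReadingCoordsH (XHK blkHK HcoK coRealizesHRel_of_pins)
open Literature.MathematicalPhysics.QuantumFieldTheory.Balaban1983to89.B9Ineq349SiteFromBlocks (Thm31SiteSchemas Thm32BlkSchema stmt349Printed_site_of_blockSchemas) open Literature.MathematicalPhysics.QuantumFieldTheory.Balaban1983to89.B6GlobalChartV1 (blkV1) open Literature.MathematicalPhysics.QuantumFieldTheory.Balaban1983to89.B6Ineq2142KLevelV1 (lvl) open Literature.MathematicalPhysics.QuantumFieldTheory.Balaban1983to89.B9Thm315WholeSectERep (LocalOuterY) open Literature.MathematicalPhysics.QuantumFieldTheory.Balaban1983to89.B9Thm315WholeSectERepOn (DecayMidOnY t315_opsYSectE_of_3185_on) open Literature.MathematicalPhysics.QuantumFieldTheory.Balaban1983to89.B9Thm314WholeCancellationLayer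 (thm314_pair_layerOfLetters) open Literature.MathematicalPhysics.QuantumFieldTheory.Balaban1983to89.B9Thm314WholePinGeometry (locDataY_laws) open Literature.MathematicalPhysics.QuantumFieldTheory.Balaban1983to89.B9PinGeometryKLevelV1 (dOmegaY_nonneg) open scoped Matrix.Norms.L2Operator
open Summit.QuantumFields.YangMills.BalabanUVNodes.N06Proj349AtPinsPhys (proj349Maj_of_t37_display348_rate) open Summit.QuantumFields.YangMills.BalabanUVNodes.N06StepL2AtPinsPhys (stepL2_of_letter_schemas_residual) open B9Eq346GradGpDivAtPinsL2Closed (M46 a46 B46 δ46 M46_pos a46_pos B46_pos blockBd_DvGcoSDvs_memberY_at) open B9PerturbationL2Delta2 (D2coK constL2Pi constL2Pi_nonneg) open Literature.MathematicalPhysics.QuantumFieldTheory.Balaban1983to89.B9PerturbationL2Letters (constL2 constL2_nonneg) open Summit.QuantumFields.YangMills.BalabanUVNodes.N06SectDUnitsAtPinsPhys (isUnit_deltaPiAY_of_formSmall_phys isUnit_deltaOneY_of_formSmall_phys posDefEnd_S0coK_of_posDefTr_phys posDefTr_deltaOneY_of_formSmall_pins_phys identitiesDef_of_pins_phys isUnit_deltaAY_phys_of_posDefTr)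 open Summit.QuantumFields.YangMills.BalabanUVNodes.N06Thm312313AtPinsPairMBCZP (t312_t313_of_pins_pairMBCZ_phys) open Literature.MathematicalPhysics.QuantumFieldTheory.Balaban1983to89.B9Thm312WholeHZ (LettersHZ LettersHHZ) open Literature.MathematicalPhysics.QuantumFieldTheory.Balaban1983to89.B9SectDSup (weightNorm) open Literature.MathematicalPhysics.QuantumFieldTheory.Balaban1983to89.B9Thm313WholeZ (Letters313Z) open Literature.MathematicalPhysics.QuantumFieldTheory.Balaban1983to89.B9Thm313WholeLeftZ (Letters313DZ) open Literature.MathematicalPhysics.QuantumFieldTheory.Balaban1983to89.B9Thm313WholeDirZ (Letters313DMZ) open Literature.MathematicalPhysics.QuantumFieldTheory.Balaban1983to89.B9Thm313WholeHolderZ (Letters313HZ) open Literature.MathematicalPhysics.QuantumFieldTheory.Balaban1983to89.B9Thm313WholeL2GPZ (Letters313L2PZ) open Literature.MathematicalPhysics.QuantumFieldTheory.Balaban1983to89.B9Thm313WholeDirL2Z (Letters313L2MZ) open Literature.MathematicalPhysics.QuantumFieldTheory.Balaban1983to89.B9LettersHZAtOne (plateau_pos) open Literature.MathematicalPhysics.QuantumFieldTheory.Balaban1983to89.B9Eq3132FacesAtLetters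 (s3132Nu_opsYSectE_of_step12) open Literature.MathematicalPhysics.QuantumFieldTheory.Balaban1983to89.B9Thm313WholeDir (Thm33G0DirR Letters313DM Letters313L2M) open Literature.MathematicalPhysics.QuantumFieldTheory.Balaban1983to89.B9Thm313WholeDirInputBC (Letters313IMBC Letters313IML letters313IMBC_of_IML) open Literature.MathematicalPhysics.QuantumFieldTheory.Balaban1983to89.B9CoReadingCoordsInputLoc (vanishX_bHK_pins leX_bHK_pins) open Literature.MathematicalPhysics.QuantumFieldTheory.Balaban1983to89.B9Thm312WholeClasses (cNormR) open Literature.MathematicalPhysics.QuantumFieldTheory.Balaban1983to89.B9PerturbationSplitAtLetters (TaLcoK TbLcoKH Ta2LcoK Tb2LcoKH TaRcoK TbRcoKH Ta2RcoK Tb2RcoKH letters3131_of_pins_of_maj letters3131R_of_pins_of_maj) open Literature.MathematicalPhysics.QuantumFieldTheory.Balaban1983to89.B9Thm313WholeHolder (Letters313H) open Literature.MathematicalPhysics.QuantumFieldTheory.Balaban1983to89.B9Thm313WholeL2GP (Letters313L2P) open Literature.MathematicalPhysics.QuantumFieldTheory.Balaban1983to89.B9CoReadingCoordsHolder (PK holderProbesK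 bond_h1ReadsNbr_of_pins) open Literature.MathematicalPhysics.QuantumFieldTheory.Balaban1983to89.B9CoReadingCoordsHolderS (holderProbesS site_h1ReadsNbr_of_pins) open Literature.MathematicalPhysics.QuantumFieldTheory.Balaban1983to89.B9CoReadingCoordsHHolder (bond_coReadsHHolderNbr_of_pins) open Literature.MathematicalPhysics.QuantumFieldTheory.Balaban1983to89.B9CoReadingCoordsInput (bHK bond_inputReadsFam_of_pins) open Literature.MathematicalPhysics.QuantumFieldTheory.Balaban1983to89.B9CoReadingCoordsInputS (bHS site_inputReadsFam_of_pins) open Summit.QuantumFields.YangMills.BalabanUVNodes.N06G0LayerFromThm310E (g0_layer_of_thm310_coreB) open Summit.QuantumFields.YangMills.BalabanUVNodes.N06StepDirLayerAtPinsBCZX (stepDirB_layer_of_lettersCZX) open Summit.QuantumFields.YangMills.BalabanUVNodes.N06ProbeZeroAtPinsPhys (hX0_of_pins cX0_nonneg) open Summit.QuantumFields.YangMills.BalabanUVNodes.N06MixedLegAtPinsPhys (l2MixedLegs37_of_pins h36H_of_mixed hcntM_of_walkCnt) open Literature.MathematicalPhysics.QuantumFieldTheory.Balaban1983to89.B9WalkLettersCoordsS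 (SblkY hWalkY gsqcoS walkCntM₀Y walkCntY) open Literature.MathematicalPhysics.QuantumFieldTheory.Balaban1983to89.B6Cover236MultiLevelBlocks (cubes) open Literature.MathematicalPhysics.QuantumFieldTheory.Balaban1983to89.B9Eq346MixedLegAtPinsL2Closed (MMix aMix BMix δMix) open Literature.MathematicalPhysics.QuantumFieldTheory.Balaban1983to89.B9Thm39ReadingCoords (coordBound39 basisBound39) open Summit.QuantumFields.YangMills.BalabanUVNodes.N06SplitMajorantsAtPinsPhys (split_majorants_of_letter_schemas) open Literature.MathematicalPhysics.QuantumFieldTheory.Balaban1983to89.B9Thm31GpMajFromPinsPairM (thm31GpMaj_of_t37_pairM) open Literature.MathematicalPhysics.QuantumFieldTheory.Balaban1983to89.B9PerturbationMajorantAlgebra (Proj349Maj CurrentMaj) open Literature.MathematicalPhysics.QuantumFieldTheory.Balaban1983to89.B9PerturbationMajorantsAtLetters (BcoKH BdcoKH PcoK) open Literature.MathematicalPhysics.QuantumFieldTheory.Balaban1983to89.B9PerturbationMajorantLetters (const3131) open Literature.MathematicalPhysics.QuantumFieldTheory.Balaban1983to89.B9RowSum261DefiniteFaces (rowConst261) open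 Literature.MathematicalPhysics.QuantumFieldTheory.Balaban1983to89.B9Thm312WholeStepDirFrom3131 (Thm33G0DirX) open Literature.MathematicalPhysics.QuantumFieldTheory.Balaban1983to89.B9Thm312WholeRightStepFrom3131 (Letters3131R Thm33G0DivR) open Literature.MathematicalPhysics.QuantumFieldTheory.Balaban1983to89.B9Thm312WholeStepFrom3131 (Letters3131) open Literature.MathematicalPhysics.QuantumFieldTheory.Balaban1983to89.B9Thm312WholeLeftStepFrom3131 (Letters3131H) open Literature.MathematicalPhysics.QuantumFieldTheory.Balaban1983to89.B9Thm312WholeIdentitiesSplit (Ids3124 identities_of_def_3124) open Literature.MathematicalPhysics.QuantumFieldTheory.Balaban1983to89.B9Thm312WholeIdentitiesDefAtPins (identitiesDef_of_pins) open Literature.MathematicalPhysics.QuantumFieldTheory.Balaban1983to89.Node00.OpsYSectDCoords (S0coK TpicoK T2coK QcoKH QscoKH CcoK C1coK DvcoKH DvscoKH RcoK GcoK_GAY_mul_S0coK cR39_trBasis_pos) open Literature.MathematicalPhysics.QuantumFieldTheory.Balaban1983to89.B9Eq3132SectDLetters (deltaPiAY) open Literature.MathematicalPhysics.QuantumFieldTheory.Balaban1983to89.B9Thm311ReadingCoords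 (isUnit_of_posDefTr) open Summit.QuantumFields.YangMills.BalabanUVNodes.N06SectDUnitsAtPins (isUnit_deltaPiAY_of_formSmall isUnit_deltaOneY_of_formSmall posDefEnd_S0coK_of_posDefTr posDefTr_deltaOneY_of_formSmall_pins)

variable {N : ℕ}

section Pointed

variable [NeZero N] {F : T4Family}

set_option maxHeartbeats 600000 in set_option synthInstance.maxSize 2048 in
/-- **THE STAGE-11 CERTIFICATE AT `opsYNuOfRecordV4PE N θ M⋆ 𝔯 (sectEYOfRecordV6 N θ M⋆ 𝔢₀) 𝔴 𝔈`, EDITION 33** (module docstring): edition 32 with rows 18's mixed `L²` leg `L2MixedLegs37` DERIVED (dag-n06-w7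
`l2MixedLegs37_memberY_at` p617225 via `N06MixedLegAtPinsPhys`): the walk's cube index pinned (`ι := cubes`, `S_□ := SblkY`), new pins `hhS ∕ hGsqF` (h_□, G′_□), member floor `hMw ∕ hNMw`
(overlap count derived), numerics `hM1mix ha1mix hBMmix hδmix`; REMOVED `SM hcntM hGsqS` and the `L2MixedLegs37` conjunct of `h36H`; nothing else. [cite: Balaban1985BackgroundPropagators, Thms 3.1–3.15 pp.397–432, (3.24)–(3.27) pp.394–395, (3.39)–(3.42) p.397,
(3.46)–(3.47) p.398, (3.49) p.399, (3.117)–(3.126) pp.419–421, (3.130)–(3.133) pp.421–422, (3.36) p.396, (3.152)–(3.153) p.426, (3.138) p.423, (3.185)–(3.187) p.432; Balaban1984PropagatorsII,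
(2.45) p.231, (2.51)–(2.54) pp.232–233, Lemma 2.1 (2.60)–(2.61) pp.233–234, (2.142) p.248, Prop. 2.7 (2.149)–(2.150) p.249; Balaban1984PropagatorsI, (1.18) p.20] -/
theorem b9_main_of_up_view₁₁B10YZW_opsYNuOfRecordV6E_pairNN
    (θ : Stage11Params F N) (hθ : θ.Admissible) (Mstar : ℕ) (𝔯 : ResY N θ.toStage3Params Mstar) (𝔢₀ : SectEY N θ.toStage3Params Mstar) (𝔴 : RWEY N θ.toStage3Params Mstar) (𝔈 : ExpsY N θ.toStage3Params Mstar) (ζ : ResidZ F N) (lamW : ResidW F N) (w : WorldP)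
    (hup : ∀ P, w.up P = upOfRecord₅C F N (θ.view₁₁B10YZW F N Mstar (opsYNuOfRecordV4PE N θ.toStage3Params Mstar 𝔯 (sectEYOfRecordV6 N θ.toStage3Params Mstar 𝔢₀) 𝔴 𝔈) ζ lamW) P) [∀ x : MemberY θ.d₆ θ.ℓ₆ θ.hd' θ.hL' θ.b₀ θ.b₁ Mstar, Fintype (geo9Y x).Site] [∀ x : MemberY θ.d₆ θ.ℓ₆ θ.hd' θ.hL' θ.b₀ θ.b₁ Mstar, DecidableEq (geo9Y x).Site]
    [∀ x : MemberY θ.d₆ θ.ℓ₆ θ.hd' θ.hL' θ.b₀ θ.b₁ Mstar, DecidableRel (RelB x.toKIdx)]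
    -- the κ-fold coordinate data of the instance (n06-d `B9CoReadingCoords`): a real basis of M_N(ℂ) and a block map on the fine bonds, carrier- and level-faithful
    -- and 1-faithful (ONE such map exists at every member JOINTLY with the direction-blindness `hbI0` below: `B9IndexBondFaithful.exists_faithful_dirBlind_kIdx` = hlev ∧ hβI ∧ hβ1 ∧ hbI0, referee WATCH-A3-PINS-DIRBLIND; displayed because the walk letters are pinned to it)
    (bI : ∀ x : MemberY θ.d₆ θ.ℓ₆ θ.hd' θ.hL' θ.b₀ θ.b₁ Mstar, FBondY x.toKIdx → IBondY x.toKIdx)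
    (hβI : ∀ (x : MemberY θ.d₆ θ.ℓ₆ θ.hd' θ.hL' θ.b₀ θ.b₁ Mstar) (f : FBondY x.toKIdx) (c : IBondY x.toKIdx), blkV1 x.hN x.D f = β x.hN x.D x.hk c → β x.hN x.D x.hk (bI x f) = blkV1 x.hN x.D f) (hlev : ∀ (x : MemberY θ.d₆ θ.ℓ₆ θ.hd' θ.hL' θ.b₀ θ.b₁ Mstar) (f : FBondY x.toKIdx), lvl x.hN x.D x.hk (bI x f) = (blkV1 x.hN x.D f).1.1)
    (hβ1 : ∀ (x : MemberY θ.d₆ θ.ℓ₆ θ.hd' θ.hL' θ.b₀ θ.b₁ Mstar) (f : FBondY x.toKIdx), (geomT x.D).dist (β x.hN x.D x.hk (bI x f)) (blkV1 x.hN x.D f) ≤ 1)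
    (hbI0 : ∀ (x : MemberY θ.d₆ θ.ℓ₆ θ.hd' θ.hL' θ.b₀ θ.b₁ Mstar) (f : FBondY x.toKIdx), bI x f = bI x ⟨f.src, 0⟩)
    -- row 13 (the Sect.-B step for G′(U′U), G(U′U), C⁻¹(U′U), analyticity: [B9] (3.56)–(3.70) pp.401–404) DISPLAYED AS THE OBLIGATION ITSELF (edition 20): the frame binder `F : SectBFrame₇ … (bg9Y …) …` of editions 16–19
    -- has NO instance with NODE 00's genuine letters for N ≥ 2 (dag-n06-c g7 LOCATED-6, ref-E g11 ACK «VACUOUS-AS-TYPED at bg9Y»); the inhabitable road is n06-c's coded-carrier frame + transfers + `sectBStepPrinted_of_coded` once its Summits adapter exists (O4∕O5)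
    (hB : B9.SectBStepPrinted (θ.d₆ + 1) c35Y geo9Y (bg9Y (Matrix (Fin N) (Fin N) ℂ) (specialUnitaryUnits (Fin N))) (fun x => ((opsYNuOfRecordV4PE N θ.toStage3Params Mstar 𝔯 (sectEYOfRecordV6 N θ.toStage3Params Mstar 𝔢₀) 𝔴 𝔈) x).Gp) (fun x => ((opsYNuOfRecordV4PE N θ.toStage3Params Mstar 𝔯 (sectEYOfRecordV6 N θ.toStage3Params Mstar 𝔢₀) 𝔴 𝔈) x).GA) (fun x => ((opsYNuOfRecordV4PE N θ.toStage3Params Mstar 𝔯 (sectEYOfRecordV6 N θ.toStage3Params Mstar 𝔢₀) 𝔴 𝔈) x).Cinv) (fun x => ((opsYNuOfRecordV4PE N θ.toStage3Params Mstar 𝔯 (sectEYOfRecordV6 N θ.toStage3Params Mstar 𝔢₀) 𝔴 𝔈) x).IsAnalyticExt))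
    (α' r39 δ39 B39 a39 M39 : ℝ) (hα'0 : 0 < α') (hα'1 : α' < 1) (hr39 : 0 < r39) (hrδ39 : r39 ≤ δ39) (hB39 : 0 < B39) (ha39 : 0 < a39) (hM39 : 0 < M39)
    (h348 : ∀ x : MemberY θ.d₆ θ.ℓ₆ θ.hd' θ.hL' θ.b₀ θ.b₁ Mstar, M39 ≤ (geo9Y x).M → ∀ α₀ : ℝ, 0 < α₀ → c35Y * (geo9Y x).M * α₀ ≤ a39 → ∀ U : (bg9Y (Matrix (Fin N) (Fin N) ℂ) (specialUnitaryUnits (Fin N)) x).Cfg, (bg9Y (Matrix (Fin N) (Fin N) ℂ) (specialUnitaryUnits (Fin N)) x).Reg335 c35Y α₀ U → Conv348Blk (oneCubeOps39YF θ.toStage3Params Mstar (lettersYOfRecordV4P N θ.toStage3Params Mstar 𝔯) bI x) B39 δ39 U)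
    (hEK39 : ∀ x : MemberY θ.d₆ θ.ℓ₆ θ.hd' θ.hL' θ.b₀ θ.b₁ Mstar, ((opsYNuOfRecordV4PE N θ.toStage3Params Mstar 𝔯 (sectEYOfRecordV6 N θ.toStage3Params Mstar 𝔢₀) 𝔴 𝔈) x).EK39 = EK39OfOpsBlkVia (oneCubeOps39YF θ.toStage3Params Mstar (lettersYOfRecordV4P N θ.toStage3Params Mstar 𝔯) bI x) (oneCubeReading39 _) (θ.d₆ + 1) (2 * (1 * B39) * rowConst261 (geo9Y (d := θ.d₆) (ℓ := θ.ℓ₆) (hd := θ.hd') (hL := θ.hL') (b₀ := θ.b₀) (b₁ := θ.b₁) (Mstar :=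
      Mstar)) (α' * r39)) ((1 - α') * r39) (repSite39F x.toKIdx (bI x))) (a311 M311 : ℝ) (ha311 : 0 < a311) (hM311 : 0 < M311)
    (hΔA : ∀ x : MemberY θ.d₆ θ.ℓ₆ θ.hd' θ.hL' θ.b₀ θ.b₁ Mstar, M311 ≤ (geo9Y x).M → ∀ α₀ : ℝ, 0 < α₀ → (geo9Y x).M * α₀ ≤ a311 → ∀ U : (bg9Y (Matrix (Fin N) (Fin N) ℂ) (specialUnitaryUnits (Fin N)) x).Cfg, (bg9Y (Matrix (Fin N) (Fin N) ℂ) (specialUnitaryUnits (Fin N)) x).Reg335 c35Y α₀ U →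
      PosDefTr (fun _ => (1 : ℝ)) (deltaAY x.toKIdx (parSymY x.toKIdx) (parBY x.toKIdx) (GpY x.toKIdx (parSymY x.toKIdx)) U))
    (hPD : ∀ x : MemberY θ.d₆ θ.ℓ₆ θ.hd' θ.hL' θ.b₀ θ.b₁ Mstar, ((opsYNuOfRecordV4PE N θ.toStage3Params Mstar 𝔯 (sectEYOfRecordV6 N θ.toStage3Params Mstar 𝔢₀) 𝔴 𝔈) x).PosDef = PosDefOfOps (ops311Y x (lettersYOfRecordV4P N θ.toStage3Params Mstar 𝔯 x) (B9Thm311PosAtRecordV4.proofLettersGA (lettersYOfRecordV4P N θ.toStage3Params Mstar 𝔯 x))))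
    {ιA AA : MemberY θ.d₆ θ.ℓ₆ θ.hd' θ.hL' θ.b₀ θ.b₁ Mstar → Type} [∀ x, Fintype (ιA x)] [∀ x, Fintype (AA x)] (p q : PinPrims) (hp : p.OK) (hq : q.OK)
    (p3 q3 : PairPrims) (hp3 : p3.OK) (hq3 : q3.OK) (pM qM : MixedPrims) (hpM : pM.OK) (hqM : qM.OK) (H : MemberY θ.d₆ θ.ℓ₆ θ.hd' θ.hL' θ.b₀ θ.b₁ Mstar → Prop)
    (hM₀ : nbrM₀Y θ.d₆ θ.ℓ₆ θ.hd' θ.hL' θ.b₀ θ.b₁ 2 ≤ Mstar) (hM₀' : nbrM₀Y θ.d₆ θ.ℓ₆ θ.hd' θ.hL' θ.b₀ θ.b₁ ((θ.ℓ₆ : ℝ) + 4) ≤ Mstar)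
    (𝔬 : ∀ x : MemberY θ.d₆ θ.ℓ₆ θ.hd' θ.hL' θ.b₀ θ.b₁ Mstar, Ops (geo9Y x) (bg9Y (Matrix (Fin N) (Fin N) ℂ) (specialUnitaryUnits (Fin N)) x) (XSK (TrIdx N) x.toKIdx) (XSK (TrIdx N) x.toKIdx) ↥(cubes x.toKIdx.D.toDomains))
    (rd : ∀ x : MemberY θ.d₆ θ.ℓ₆ θ.hd' θ.hL' θ.b₀ θ.b₁ Mstar, WalkReading (geo9Y x) (bg9Y (Matrix (Fin N) (Fin N) ℂ) (specialUnitaryUnits (Fin N)) x) (XSK (TrIdx N) x.toKIdx) ↥(cubes x.toKIdx.D.toDomains))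
    (𝔭 : ∀ x : MemberY θ.d₆ θ.ℓ₆ θ.hd' θ.hL' θ.b₀ θ.b₁ Mstar, HolderProbes (geo9Y x) (bg9Y (Matrix (Fin N) (Fin N) ℂ) (specialUnitaryUnits (Fin N)) x) (XSK (TrIdx N) x.toKIdx) (XSK (TrIdx N) x.toKIdx) (PK (SiteY x.toKIdx) (Fin (θ.d₆ + 1)) (TrIdx N)) (PK (SiteY x.toKIdx) (Fin (θ.d₆ + 1)) (TrIdx N)))
    (h𝔭 : ∀ x : MemberY θ.d₆ θ.ℓ₆ θ.hd' θ.hL' θ.b₀ θ.b₁ Mstar, 𝔭 x = holderProbesSA x.toKIdx (trBasis N) (bg9Y (Matrix (Fin N) (Fin N) ℂ) (specialUnitaryUnits (Fin N)) x) (fun U => U) (lettersYOfRecordV4P N θ.toStage3Params Mstar 𝔯 x).parS (bI x)) (𝔡 : ∀ x : MemberY θ.d₆ θ.ℓ₆ θ.hd' θ.hL' θ.b₀ θ.b₁ Mstar, DirOps37 (𝔬 x) (Fin (θ.d₆ + 1))) (𝔩 : ∀ x : MemberY θ.d₆ θ.ℓ₆ θ.hd' θ.hL' θ.b₀ θ.b₁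 Mstar, DirLetters37 (𝔬 x) (Fin (θ.d₆ + 1)))
    (hhS : ∀ (x : MemberY θ.d₆ θ.ℓ₆ θ.hd' θ.hL' θ.b₀ θ.b₁ Mstar) (c : ↥(cubes x.toKIdx.D.toDomains)), (𝔬 x).h c = hWalkY x c)
    (hGsqF : ∀ (x : MemberY θ.d₆ θ.ℓ₆ θ.hd' θ.hL' θ.b₀ θ.b₁ Mstar) (U : (bg9Y (Matrix (Fin N) (Fin N) ℂ) (specialUnitaryUnits (Fin N)) x).Cfg) (c : ↥(cubes x.toKIdx.D.toDomains)), (𝔬 x).Gsq U c = gsqcoS x (trBasis N) (bg9Y (Matrix (Fin N) (Fin N) ℂ) (specialUnitaryUnits (Fin N)) x) (fun U => U) (parSymY x.toKIdx) c U)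
    (bHX : ∀ x : MemberY θ.d₆ θ.ℓ₆ θ.hd' θ.hL' θ.b₀ θ.b₁ Mstar, ℝ → BlockNorm (toB6 (geo9Y x) 1 (H x)) ((XSK (TrIdx N) x.toKIdx) → ℝ)) (κ : MemberY θ.d₆ θ.ℓ₆ θ.hd' θ.hL' θ.b₀ θ.b₁ Mstar → Sizes)
    (hbHX : ∀ x : MemberY θ.d₆ θ.ℓ₆ θ.hd' θ.hL' θ.b₀ θ.b₁ Mstar, bHX x = fun ε => letI : Fintype (B9GeoNormsKLevelV1.geo9K x.toKIdx).Site := (inferInstance : Fintype (geo9Y x).Site); bHS x.toKIdx (sIK x.toKIdx (bI x)) ε)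
    (SH S3 SI : ∀ x : MemberY θ.d₆ θ.ℓ₆ θ.hd' θ.hL' θ.b₀ θ.b₁ Mstar, ↥(cubes x.toKIdx.D.toDomains) → Finset (geo9Y x).Site) (hst : ∀ x, StaticOK (𝔬 x) p.ρ p.Nc p.N' p.Cℓ (κ x)) (hκ : ∀ x, (κ x).Bounded p.Kc p.θ₀ p.Cℓ (geo9Y x).M) (hrd : ∀ x, (rd x).OK (𝔬 x).blk) (hloc : ∀ x, LocalityDir (𝔬 x) (𝔡 x) (𝔩 x) (rd x))
    (h36 : ∀ x, p.M₁ ≤ (geo9Y x).M → ∀ α₀ : ℝ, 0 < α₀ → c35Y * (geo9Y x).M * α₀ ≤ p.a₁ → ∀ U : (bg9Y (Matrix (Fin N) (Fin N) ℂ) (specialUnitaryUnits (Fin N)) x).Cfg, (bg9Y (Matrix (Fin N) (Fin N) ℂ) (specialUnitaryUnits (Fin N)) x).Reg335 c35Y α₀ U → Local342 (𝔬 x) 1 (H x) p.B₀ p.δ₀ U ∧ Identities₂ (𝔬 x) (𝔡 x) (𝔩 x) 1 (H x) U)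
    (h36H : ∀ x, p.M₁ ≤ (geo9Y x).M → ∀ α₀ : ℝ, 0 < α₀ → c35Y * (geo9Y x).M * α₀ ≤ p.a₁ → ∀ U : (bg9Y (Matrix (Fin N) (Fin N) ℂ) (specialUnitaryUnits (Fin N)) x).Cfg, (bg9Y (Matrix (Fin N) (Fin N) ℂ) (specialUnitaryUnits (Fin N)) x).Reg335 c35Y α₀ U →
      HolderLegs37 (𝔬 x) (𝔭 x) 1 (H x) (SH x) p.Bl p.δ₀ U ∧ HolderV37Dir (𝔬 x) (𝔡 x) (𝔩 x) (𝔭 x) 1 (H x) p.Bt p.δ₀ U ∧ (L2SecondLegs37 (𝔬 x) (𝔡 x) 1 (H x) (S3 x) p3.B3 p.δ₀ U ∧ FactorsL2Second37Dir (𝔬 x) (𝔡 x) (𝔩 x) 1 (H x) p3.θ3 p.δ₀ U) ∧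
        (InputLegsPair37 (𝔬 x) (𝔡 x) (𝔭 x) 1 (H x) (bHX x) (SI x) p.BI p.BI2 p.δ₀ U ∧ FactorsInputPair37Dir (𝔬 x) (𝔡 x) (𝔩 x) 1 (H x) (bHX x) p.θI p.δ₀ U) ∧
        FactorsL2Mixed37Dir (𝔬 x) (𝔡 x) (𝔩 x) 1 (H x) pM.θM p.δ₀ U)
    -- rows 18's mixed L² leg (print's (3.46) for ∇_ν M_h G′_□ M_h ∇*_μ) is DERIVED (edition 33: dag-n06-w7 `l2MixedLegs37_memberY_at`, p617225 + `…Closed`) at the displayed numerics, pinned to the NAMED constants by: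
    (hM1mix : MMix θ.d₆ θ.ℓ₆ θ.hd' θ.hL' θ.b₀ θ.b₁ Mstar N c35Y c35Y_pos ≤ p.M₁) (ha1mix : p.a₁ ≤ aMix θ.d₆ θ.ℓ₆ θ.hd' θ.hL' θ.b₀ θ.b₁ Mstar N c35Y c35Y_pos) (hBMmix : BMix θ.d₆ θ.ℓ₆ θ.hd' θ.hL' θ.b₀ θ.b₁ Mstar N c35Y c35Y_pos ≤ pM.BM) (hδmix : p.δ₀ ≤ δMix θ.d₆ θ.ℓ₆ θ.hd' θ.hL' θ.b₀ θ.b₁ Mstar N c35Y c35Y_pos)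
    (hcntH : ∀ x (a : (geo9Y x).Site), (∑ c, if a ∈ SH x c then (1 : ℝ) else 0) ≤ p.NH) (hcnt3 : ∀ x (a : (geo9Y x).Site), (∑ c, if a ∈ S3 x c then (1 : ℝ) else 0) ≤ p3.N3)
    (hcntI : ∀ x (a : (geo9Y x).Site), (∑ c, if a ∈ SI x c then (1 : ℝ) else 0) ≤ p.NI) (hMw : ∀ x : MemberY θ.d₆ θ.ℓ₆ θ.hd' θ.hL' θ.b₀ θ.b₁ Mstar, walkCntM₀Y θ.d₆ θ.ℓ₆ θ.hd' θ.hL' θ.b₀ θ.b₁ Mstar ≤ (geo9Y x).M) (hNMw : walkCntY θ.d₆ θ.ℓ₆ θ.hd' θ.hL' θ.b₀ θ.b₁ Mstar ≤ pM.NM)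
    (𝔬A : ∀ x : MemberY θ.d₆ θ.ℓ₆ θ.hd' θ.hL' θ.b₀ θ.b₁ Mstar, Ops310 (geo9Y x) (bg9Y (Matrix (Fin N) (Fin N) ℂ) (specialUnitaryUnits (Fin N)) x) (XBK (TrIdx N) x.toKIdx) (XBK (TrIdx N) x.toKIdx) (ιA x) (AA x))
    (rdA : ∀ x : MemberY θ.d₆ θ.ℓ₆ θ.hd' θ.hL' θ.b₀ θ.b₁ Mstar, WalkReading310 (geo9Y x) (bg9Y (Matrix (Fin N) (Fin N) ℂ) (specialUnitaryUnits (Fin N)) x) (XBK (TrIdx N) x.toKIdx) (ιA x) (AA x))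
    (𝔭A : ∀ x : MemberY θ.d₆ θ.ℓ₆ θ.hd' θ.hL' θ.b₀ θ.b₁ Mstar, HolderProbes (geo9Y x) (bg9Y (Matrix (Fin N) (Fin N) ℂ) (specialUnitaryUnits (Fin N)) x) (XBK (TrIdx N) x.toKIdx) (XBK (TrIdx N) x.toKIdx) (PK (FBondY x.toKIdx) (Fin (θ.d₆ + 1)) (TrIdx N)) (PK (FBondY x.toKIdx) (Fin (θ.d₆ + 1)) (TrIdx N)))
    (h𝔭A : ∀ x : MemberY θ.d₆ θ.ℓ₆ θ.hd' θ.hL' θ.b₀ θ.b₁ Mstar, 𝔭A x = holderProbesKA x.toKIdx (trBasis N) (bg9Y (Matrix (Fin N) (Fin N) ℂ) (specialUnitaryUnits (Fin N)) x) (fun U => U) (lettersYOfRecordV4P N θ.toStage3Params Mstar 𝔯 x).parB (bI x)) (𝔡A : ∀ x : MemberY θ.d₆ θ.ℓ₆ θ.hd' θ.hL' θ.b₀ θ.b₁ Mstar, DirOps310 (𝔬A x) (Fin (θ.d₆ + 1)))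
    (bHXA : ∀ x : MemberY θ.d₆ θ.ℓ₆ θ.hd' θ.hL' θ.b₀ θ.b₁ Mstar, ℝ → BlockNorm (toB6 (geo9Y x) 1 (H x)) ((XBK (TrIdx N) x.toKIdx) → ℝ)) (κA : MemberY θ.d₆ θ.ℓ₆ θ.hd' θ.hL' θ.b₀ θ.b₁ Mstar → Sizes310) (SHA S3A SIA SMA S2A : ∀ x : MemberY θ.d₆ θ.ℓ₆ θ.hd' θ.hL' θ.b₀ θ.b₁ Mstar, ιA x → Finset (geo9Y x).Site)
    (hbHXA : ∀ x : MemberY θ.d₆ θ.ℓ₆ θ.hd' θ.hL' θ.b₀ θ.b₁ Mstar, bHXA x = fun ε => letI : Fintype (B9GeoNormsKLevelV1.geo9K x.toKIdx).Site := (inferInstance : Fintype (geo9Y x).Site); bHK x.toKIdx (bI x) ε)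
    (hstA : ∀ x, StaticOK310 (𝔬A x) q.ρ q.Nc q.N' q.NF q.Cℓ (κA x)) (hκA : ∀ x, (κA x).Bounded q.Kc) (hrdA : ∀ x, (rdA x).OK (𝔬A x).blk) (hlocA : ∀ x, Locality310 (𝔬A x) (rdA x))
    (h36A : ∀ x, q.M₁ ≤ (geo9Y x).M → ∀ α₀ : ℝ, 0 < α₀ → c35Y * (geo9Y x).M * α₀ ≤ q.a₁ → ∀ U : (bg9Y (Matrix (Fin N) (Fin N) ℂ) (specialUnitaryUnits (Fin N)) x).Cfg, (bg9Y (Matrix (Fin N) (Fin N) ℂ) (specialUnitaryUnits (Fin N)) x).Reg335 c35Y α₀ U → Local342G (𝔬A x) 1 (H x) q.B₀ q.δ₀ U ∧ B9Thm310Whole.Factors389 (𝔬A x) 1 (H x) q.θ₀ q.δ₀ U ∧ Identities310 (𝔬A x) 1 (H x) U)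
    (h36HA : ∀ x, q.M₁ ≤ (geo9Y x).M → ∀ α₀ : ℝ, 0 < α₀ → c35Y * (geo9Y x).M * α₀ ≤ q.a₁ → ∀ U : (bg9Y (Matrix (Fin N) (Fin N) ℂ) (specialUnitaryUnits (Fin N)) x).Cfg, (bg9Y (Matrix (Fin N) (Fin N) ℂ) (specialUnitaryUnits (Fin N)) x).Reg335 c35Y α₀ U →
      HolderLegs310 (𝔬A x) (𝔭A x) 1 (H x) (SHA x) q.Bl q.δ₀ U ∧ FactorsHolder310 (𝔬A x) (𝔭A x) 1 (H x) q.Bt q.δ₀ U ∧ (L2SecondLegs310 (𝔬A x) (𝔡A x) 1 (H x) (S3A x) q3.B3 q.δ₀ U ∧ FactorsL2Second310 (𝔬A x) (𝔡A x) 1 (H x) q3.θ3 q.δ₀ U) ∧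
        (InputLegsPair310 (𝔬A x) (𝔡A x) (𝔭A x) 1 (H x) (bHXA x) (SIA x) q.BI q.BI2 q.δ₀ U ∧ FactorsInputPair310 (𝔬A x) (𝔡A x) 1 (H x) (bHXA x) q.θI q.δ₀ U) ∧
        (L2MixedLegs310 (𝔬A x) (𝔡A x) 1 (H x) (SMA x) qM.BM q.δ₀ U ∧ FactorsL2Mixed310 (𝔬A x) (𝔡A x) 1 (H x) qM.θM q.δ₀ U))
    -- the two-sided L² legs of Theorem 3.10 (the (3.46)₄ line of ∇_UG∇*_U; n06-k's one-slot schema species, displayed again: it feeds rows 20–21's DERIVED `Thm33G0L2M`)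
    (h36A2 : ∀ x, q.M₁ ≤ (geo9Y x).M → ∀ α₀ : ℝ, 0 < α₀ → c35Y * (geo9Y x).M * α₀ ≤ q.a₁ → ∀ U : (bg9Y (Matrix (Fin N) (Fin N) ℂ) (specialUnitaryUnits (Fin N)) x).Cfg, (bg9Y (Matrix (Fin N) (Fin N) ℂ) (specialUnitaryUnits (Fin N)) x).Reg335 c35Y α₀ U → L2TwoLegs310 (𝔬A x) 1 (H x) (S2A x) q.B2 q.δ₀ U ∧ FactorsL2_310 (𝔬A x) 1 (H x) q.θ2 q.δ₀ U)
    (hcntHA : ∀ x (a : (geo9Y x).Site), (∑ c, if a ∈ SHA x c then (1 : ℝ) else 0) ≤ q.NH) (hcnt3A : ∀ x (a : (geo9Y x).Site), (∑ c, if a ∈ S3A x c then (1 : ℝ) else 0) ≤ q3.N3)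
    (hcntIA : ∀ x (a : (geo9Y x).Site), (∑ c, if a ∈ SIA x c then (1 : ℝ) else 0) ≤ q.NI) (hcntMA : ∀ x (a : (geo9Y x).Site), (∑ c, if a ∈ SMA x c then (1 : ℝ) else 0) ≤ qM.NM) (hcnt2A : ∀ x (a : (geo9Y x).Site), (∑ c, if a ∈ S2A x c then (1 : ℝ) else 0) ≤ q.N2)
    (hE37 : ∀ x : MemberY θ.d₆ θ.ℓ₆ θ.hd' θ.hL' θ.b₀ θ.b₁ Mstar, ((opsYNuOfRecordV4PE N θ.toStage3Params Mstar 𝔯 (sectEYOfRecordV6 N θ.toStage3Params Mstar 𝔢₀) 𝔴 𝔈) x).E37 = E37YPairMDir (bg := (bg9Y (Matrix (Fin N) (Fin N) ℂ) (specialUnitaryUnits (Fin N)))) (2 * (θ.d₆ + 1)) (nbrCountY θ.d₆ θ.ℓ₆ θ.hd' θ.hL' θ.b₀ θ.b₁ 2) (Real.sqrt ((θ.d₆ + 1) * Fintype.card (TrIdx N))) ((θ.d₆ + 1 : ℕ) : ℝ) p q p3 q3 pM qM (𝔬 x) (𝔡 x) (𝔩 x) (rd x) (H x) ((opsYNuOfRecordV4PE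 N θ.toStage3Params Mstar 𝔯 (sectEYOfRecordV6 N θ.toStage3Params Mstar 𝔢₀) 𝔴 𝔈) x).Gp)
    (hE310 : ∀ x : MemberY θ.d₆ θ.ℓ₆ θ.hd' θ.hL' θ.b₀ θ.b₁ Mstar, ((opsYNuOfRecordV4PE N θ.toStage3Params Mstar 𝔯 (sectEYOfRecordV6 N θ.toStage3Params Mstar 𝔢₀) 𝔴 𝔈) x).E310 = E310YPairM (bg := (bg9Y (Matrix (Fin N) (Fin N) ℂ) (specialUnitaryUnits (Fin N)))) (2 * (θ.d₆ + 1)) (nbrCountY θ.d₆ θ.ℓ₆ θ.hd' θ.hL' θ.b₀ θ.b₁ 2) (Real.sqrt ((θ.d₆ + 1) * Fintype.card (TrIdx N))) ((θ.d₆ + 1 : ℕ) : ℝ) p q p3 q3 pM qM (𝔬A x) (rdA x) (H x) ((opsYNuOfRecordV4PE N θ.toStage3Params Mstar 𝔯 (sectEYOfRecordV6 N θ.toStage3Params Mstar 𝔢₀) 𝔴 𝔈) x).GA)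
    (hblkA : ∀ x : MemberY θ.d₆ θ.ℓ₆ θ.hd' θ.hL' θ.b₀ θ.b₁ Mstar, (𝔬A x).blk = blkBK x.toKIdx (bI x)) (hblkYA : ∀ x : MemberY θ.d₆ θ.ℓ₆ θ.hd' θ.hL' θ.b₀ θ.b₁ Mstar, (𝔬A x).blkY = blkBK x.toKIdx (bI x))
    (hGcoA : ∀ (x : MemberY θ.d₆ θ.ℓ₆ θ.hd' θ.hL' θ.b₀ θ.b₁ Mstar) (U : (bg9Y (Matrix (Fin N) (Fin N) ℂ) (specialUnitaryUnits (Fin N)) x).Cfg), (𝔬A x).G U = GcoK x.toKIdx (trBasis N) (bg9Y (Matrix (Fin N) (Fin N) ℂ) (specialUnitaryUnits (Fin N)) x) (fun U => U) (lettersYOfRecordV4P N θ.toStage3Params Mstar 𝔯 x).GA U)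
    (hDcoA : ∀ (x : MemberY θ.d₆ θ.ℓ₆ θ.hd' θ.hL' θ.b₀ θ.b₁ Mstar) (U : (bg9Y (Matrix (Fin N) (Fin N) ℂ) (specialUnitaryUnits (Fin N)) x).Cfg), (𝔬A x).D U = DcoK x.toKIdx (trBasis N) (bg9Y (Matrix (Fin N) (Fin N) ℂ) (specialUnitaryUnits (Fin N)) x) (fun U => U) U)
    (hDscoA : ∀ (x : MemberY θ.d₆ θ.ℓ₆ θ.hd' θ.hL' θ.b₀ θ.b₁ Mstar) (U : (bg9Y (Matrix (Fin N) (Fin N) ℂ) (specialUnitaryUnits (Fin N)) x).Cfg), (𝔬A x).Dstar U = DscoK x.toKIdx (trBasis N) (bg9Y (Matrix (Fin N) (Fin N) ℂ) (specialUnitaryUnits (Fin N)) x) (fun U => U) U)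
    (hLcoA : ∀ (x : MemberY θ.d₆ θ.ℓ₆ θ.hd' θ.hL' θ.b₀ θ.b₁ Mstar) (U : (bg9Y (Matrix (Fin N) (Fin N) ℂ) (specialUnitaryUnits (Fin N)) x).Cfg), (𝔬A x).Lap U = LcoK x.toKIdx (trBasis N) (bg9Y (Matrix (Fin N) (Fin N) ℂ) (specialUnitaryUnits (Fin N)) x) (fun U => U) U)
    (h𝔡Ad : ∀ (x : MemberY θ.d₆ θ.ℓ₆ θ.hd' θ.hL' θ.b₀ θ.b₁ Mstar) (U : (bg9Y (Matrix (Fin N) (Fin N) ℂ) (specialUnitaryUnits (Fin N)) x).Cfg), (𝔡A x).Dd U = fun μ => coordOpK (trBasis N) (fun _ : Fin (θ.d₆ + 1) => cdBₗ x.toKIdx U μ)) (h𝔡As : ∀ (x : MemberY θ.d₆ θ.ℓ₆ θ.hd' θ.hL' θ.b₀ θ.b₁ Mstar) (U : (bg9Y (Matrix (Fin N) (Fin N) ℂ) (specialUnitaryUnits (Fin N)) x).Cfg), (𝔡A x).Dsd U = fun μ => coordOpK (trBasis N) (fun _ : Fin (θ.d₆ + 1) => cdsBₗ x.toKIdx U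 μ))
    (hblkS : ∀ x : MemberY θ.d₆ θ.ℓ₆ θ.hd' θ.hL' θ.b₀ θ.b₁ Mstar, (𝔬 x).blk = blkSK x.toKIdx (sIK x.toKIdx (bI x))) (hblkYS : ∀ x : MemberY θ.d₆ θ.ℓ₆ θ.hd' θ.hL' θ.b₀ θ.b₁ Mstar, (𝔬 x).blkY = blkSK x.toKIdx (sIK x.toKIdx (bI x)))
    (hGpS : ∀ (x : MemberY θ.d₆ θ.ℓ₆ θ.hd' θ.hL' θ.b₀ θ.b₁ Mstar) U, (𝔬 x).Gp U = GcoS x.toKIdx (trBasis N) (bg9Y (Matrix (Fin N) (Fin N) ℂ) (specialUnitaryUnits (Fin N)) x) (fun U => U) (lettersYOfRecordV4P N θ.toStage3Params Mstar 𝔯 x).Gp U) (hDS : ∀ (x : MemberY θ.d₆ θ.ℓ₆ θ.hd' θ.hL' θ.b₀ θ.b₁ Mstar) U, (𝔬 x).D U = DcoS x.toKIdx (trBasis N) (bg9Y (Matrix (Fin N) (Fin N) ℂ) (specialUnitaryUnits (Fin N)) x) (fun U => U) U)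
    (hDsS : ∀ (x : MemberY θ.d₆ θ.ℓ₆ θ.hd' θ.hL' θ.b₀ θ.b₁ Mstar) U, (𝔬 x).Dstar U = DscoS x.toKIdx (trBasis N) (bg9Y (Matrix (Fin N) (Fin N) ℂ) (specialUnitaryUnits (Fin N)) x) (fun U => U) U) (hLapS : ∀ (x : MemberY θ.d₆ θ.ℓ₆ θ.hd' θ.hL' θ.b₀ θ.b₁ Mstar) U, (𝔬 x).Lap U = LcoS x.toKIdx (trBasis N) (bg9Y (Matrix (Fin N) (Fin N) ℂ) (specialUnitaryUnits (Fin N)) x) (fun U => U) U)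
    (h𝔡d : ∀ (x : MemberY θ.d₆ θ.ℓ₆ θ.hd' θ.hL' θ.b₀ θ.b₁ Mstar) (U : (bg9Y (Matrix (Fin N) (Fin N) ℂ) (specialUnitaryUnits (Fin N)) x).Cfg), (𝔡 x).Dd U = fun μ => (etaS x.toKIdx)⁻¹ • coordOpK (trBasis N) (fun _ : Fin (θ.d₆ + 1) => (cdSL x.toKIdx U μ).restrictScalars ℝ))
    (h𝔡s : ∀ (x : MemberY θ.d₆ θ.ℓ₆ θ.hd' θ.hL' θ.b₀ θ.b₁ Mstar) (U : (bg9Y (Matrix (Fin N) (Fin N) ℂ) (specialUnitaryUnits (Fin N)) x).Cfg), (𝔡 x).Dsd U = fun μ => (etaS x.toKIdx)⁻¹ • coordOpK (trBasis N) (fun _ : Fin (θ.d₆ + 1) => (cdsSL x.toKIdx U μ).restrictScalars ℝ))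
    (𝔬12 : ∀ x : MemberY θ.d₆ θ.ℓ₆ θ.hd' θ.hL' θ.b₀ θ.b₁ Mstar, B9Thm312Whole.Ops (geo9Y x) (bg9Y (Matrix (Fin N) (Fin N) ℂ) (specialUnitaryUnits (Fin N)) x) (XBK (TrIdx N) x.toKIdx) (XBK (TrIdx N) x.toKIdx) (XHK (TrIdx N) x.toKIdx) (XSK (TrIdx N) x.toKIdx))
    (bH13 : ∀ x : MemberY θ.d₆ θ.ℓ₆ θ.hd' θ.hL' θ.b₀ θ.b₁ Mstar, BlockNorm (toB6 (geo9Y x) 1 (H x)) (XSK (TrIdx N) x.toKIdx → ℝ)) (δ12₀ δK12 σ12 ρ12 a12 M12 B12₃ δ12₃ ρ13 α12 κ13 : ℝ)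
    -- row 20's Theorem-3.12 leaf in n06-l's PAIR-MB species (`thm312Printed_completePairMB`): NO displayed residual; extra numerics θ₂ ρ_f and the H-Hölder majorant letter Bq (θ_D, θ_H(β), θ_I(ε) are DERIVED)
    (ρf12 : ℝ) (Bq12 : ℝ → ℝ) (hρf12 : 0 < ρf12) (hρf1 : ρf12 + σ12 ≤ (1 - α12) * ρ12) (hρf2 : ρf12 + 2 * σ12 + α12 * ρ12 ≤ ρ12) (hBq12 : ∀ β, 0 ≤ Bq12 β)
    (hB12₃ : 0 ≤ B12₃) (hσ12 : 0 < σ12) (hρ12 : 0 < ρ12) (hρS12 : ρ12 ≤ δ12₀) (hρδ12 : ρ12 + σ12 ≤ δK12) (hρ₃12 : ρ12 + σ12 ≤ δ12₃) (ha12 : 0 < a12) (hM12 : 0 < M12) (hα12 : 0 < α12) (hα12' : α12 ≤ 1 / 2) (hδ12₀ : δ12₀ ≤ (1 - 3 * q.αF) * ((1 - 2 * q.α) * q.δ₀))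
    -- the (3.131)∕(3.137) letter constant t (O(1)·Mα₀ in print) and rate δ_T, the derived steps' working rate ρ_S and row-sum rate σ_S ([4] (2.61)); θ₁₂ is DERIVED (edition 13)
    (t12 δT12 ρS σS : ℝ) (ht12 : 0 ≤ t12) (hσS : 0 < σS) (hρST : ρS ≤ δT12) (hρS₀ : ρS + σS ≤ δ12₀) (hρS₃ : ρS + σS ≤ δ12₃) (hδKS : δK12 + q.αF * ((1 - 2 * q.α) * q.δ₀) ≤ ρS) (hM311le : M311 ≤ M12) (ha12le : a12 ≤ a311) (hσSK : σS ≤ δK12)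
    (hκ13 : ∀ x, (bH13 x).κ ≤ κ13) (hρ13 : 0 < ρ13) (hρ13ρ : ρ13 + 5 * σ12 ≤ ρ12) (hσρ13 : 3 * σ12 < (1 - α12) * ρ13)
    -- row 21's Theorem-3.13 leaf in n06-l's PAIR-MB species (`thm313Printed_completePairMB`): NO displayed residual; extra numerics B₄ and the ε-INDEXED θ_V(ε), B_r(ε) (print: B′₀(ε) p. 398), the input-member majorant letters of (3.152)–(3.153), the W-side input norm is the rows-18 site norm `bHX` (edition 27); rate (1 − α)ρ′ − 3σ
    (B13₄ : ℝ) (θV13 Br13 BhD13 Bx13 Bd13 : ℝ → ℝ) (Bd2₁₃ : ℝ → ℝ → ℝ) (hθV13 : ∀ ε, 0 < ε → 0 ≤ θV13 ε) (hB13₄ : 0 ≤ B13₄) (hBr13 : ∀ ε, 0 < ε → 0 ≤ Br13 ε) (hBhD13 : ∀ β, 0 ≤ β → β < 1 → 0 ≤ BhD13 β) (hBx13 : ∀ β, 0 ≤ β → β < 1 → 0 ≤ Bx13 β)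
    (hBd13 : ∀ ε, 0 < ε → ε ≤ 1 → 0 ≤ Bd13 ε) (hBd2₁₃ : ∀ ε β, 0 < ε → ε ≤ 1 → 0 ≤ β → β < 1 → 0 ≤ Bd2₁₃ ε β)
    -- rows 20–21: the «Theorem 3.3 for G₀» conjunct, the four undirected STEPS, the FORM SMALLNESS (3.120) and the ten definitional identities are all DERIVED (editions 13–15); displayed: letters, numerics, pins,
    -- the directed ∕ probe ∕ L² steps, the (3.131)∕(3.137) letters, the H-letters, (3.124) (O5) and the unit QG₁Q*
    -- print's (3.131)∕(3.137) splits Δ′_π = T_a + D·T_b = T_a′ + T_b′·D*, Δ⁽²⁾_π = T_a₂ + D·T_b₂ = T_a₂′ + T_b₂′·D* with the letters PINNED to n06-l g13's coordinate models `TaLcoK … Tb2RcoKH` of def-Y's operators (edition 19; the `split` fields are theorems); DISPLAYED: the eight small local majorants t·e^{−δ_T d} (t = O(1)·Mα₀; print's (3.117)∕(3.120), Theorem 3.1 + (3.49) + (3.36)) and the Hölder sizes of T_b, T_b₂ (`Letters3131H` at the pinned letters)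
    (hta₂ : ∀ x : MemberY θ.d₆ θ.ℓ₆ θ.hd' θ.hL' θ.b₀ θ.b₁ Mstar, M12 ≤ (geo9Y x).M → ∀ α₀ : ℝ, 0 < α₀ → (geo9Y x).M * α₀ ≤ a12 → ∀ U : (bg9Y (Matrix (Fin N) (Fin N) ℂ) (specialUnitaryUnits (Fin N)) x).Cfg, (bg9Y (Matrix (Fin N) (Fin N) ℂ) (specialUnitaryUnits (Fin N)) x).Reg335 c35Y α₀ U → (bg9Y (Matrix (Fin N) (Fin N) ℂ) (specialUnitaryUnits (Fin N)) x).Reg336 c35Y α₀ U → HasMaj (cNorm 1 (H x) (𝔬12 x).blk (fun y => (geo9Y_len_pos x y).le) 2) (cNorm 1 (H x) (𝔬12 x).blk (fun y => (geo9Y_len_pos x y).le) 0) (Ta2LcoK x.toKIdx (trBasis N) (bg9Y (Matrix (Fin N) (Fin N) ℂ) (specialUnitaryUnits (Fin N)) x) (fun U => U) (parSymY x.toKIdx) (GpPhysY x.toKIdx (parSymY x.toKIdx)) (𝔯 x).Δ2 U) (fun a a' => t12 * ((geo9Y x).M * α₀) * Real.exp (-(δT12 * (geo9Y x).dist a a'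))))
    (htb₂ : ∀ x : MemberY θ.d₆ θ.ℓ₆ θ.hd' θ.hL' θ.b₀ θ.b₁ Mstar, M12 ≤ (geo9Y x).M → ∀ α₀ : ℝ, 0 < α₀ → (geo9Y x).M * α₀ ≤ a12 → ∀ U : (bg9Y (Matrix (Fin N) (Fin N) ℂ) (specialUnitaryUnits (Fin N)) x).Cfg, (bg9Y (Matrix (Fin N) (Fin N) ℂ) (specialUnitaryUnits (Fin N)) x).Reg335 c35Y α₀ U → (bg9Y (Matrix (Fin N) (Fin N) ℂ) (specialUnitaryUnits (Fin N)) x).Reg336 c35Y α₀ U → HasMaj (cNorm 1 (H x) (𝔬12 x).blk (fun y => (geo9Y_len_pos x y).le) 2) (cNorm 1 (H x) (𝔬12 x).blkW (fun y => (geo9Y_len_pos x y).le) 1) (Tb2LcoKH x.toKIdx (trBasis N) (bg9Y (Matrix (Fin N) (Fin N) ℂ) (specialUnitaryUnits (Fin N)) x) (fun U => U) (parSymY x.toKIdx) (GpPhysY x.toKIdx (parSymY x.toKIdx)) (𝔯 x).Δ2 U) (fun a a' => t12 * ((geo9Y x).M * α₀) * Real.exp (-(δT12 * (geo9Y x).dist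 a a'))))
    -- the (3.131)∕(3.137) split letters' remaining PER-LETTER schema: the (3.117)+(3.36) current letters `hBJ` (Theorem 3.1 for G′ is row 18's; (3.49)₁₂₃ for P = I − R(U) is DERIVED, edition 25, at the CLOSED rate min((1−2α)δ₀, δ39)∕8 that heads the cascade r_T ≥ δ_T ≥ ρ_S ≥ δ_K); the numerics
    (tJ δB rT : ℝ) (htJ : 0 ≤ tJ) (hrTP : rT ≤ min ((1 - 2 * p.α) * p.δ₀) δ39 / 8) (hrTB : rT ≤ δB) (hδT12 : 0 ≤ δT12) (hδTr : δT12 + 3 * σS + 3 * (q.αF * ((1 - 2 * q.α) * q.δ₀)) ≤ rT)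
    (hBJ : ∀ x : MemberY θ.d₆ θ.ℓ₆ θ.hd' θ.hL' θ.b₀ θ.b₁ Mstar, M12 ≤ (geo9Y x).M → ∀ α₀ : ℝ, 0 < α₀ → (geo9Y x).M * α₀ ≤ a12 → ∀ U : (bg9Y (Matrix (Fin N) (Fin N) ℂ) (specialUnitaryUnits (Fin N)) x).Cfg, (bg9Y (Matrix (Fin N) (Fin N) ℂ) (specialUnitaryUnits (Fin N)) x).Reg335 c35Y α₀ U → (bg9Y (Matrix (Fin N) (Fin N) ℂ) (specialUnitaryUnits (Fin N)) x).Reg336 c35Y α₀ U → CurrentMaj (𝔬12 x).blkW (𝔬12 x).blk (BcoKH x.toKIdx (trBasis N) (bg9Y (Matrix (Fin N) (Fin N) ℂ) (specialUnitaryUnits (Fin N)) x) (fun U => U) U) (BdcoKH x.toKIdx (trBasis N) (bg9Y (Matrix (Fin N) (Fin N) ℂ) (specialUnitaryUnits (Fin N)) x) (fun U => U) U) 1 (H x) (tJ * ((geo9Y x).M * α₀)) δB)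
    (hL3131H : ∀ x : MemberY θ.d₆ θ.ℓ₆ θ.hd' θ.hL' θ.b₀ θ.b₁ Mstar, M12 ≤ (geo9Y x).M → ∀ α₀ : ℝ, 0 < α₀ → (geo9Y x).M * α₀ ≤ a12 → ∀ U : (bg9Y (Matrix (Fin N) (Fin N) ℂ) (specialUnitaryUnits (Fin N)) x).Cfg, (bg9Y (Matrix (Fin N) (Fin N) ℂ) (specialUnitaryUnits (Fin N)) x).Reg335 c35Y α₀ U →
      (bg9Y (Matrix (Fin N) (Fin N) ℂ) (specialUnitaryUnits (Fin N)) x).Reg336 c35Y α₀ U → Letters3131H (𝔬12 x) (TbLcoKH x.toKIdx (trBasis N) (bg9Y (Matrix (Fin N) (Fin N) ℂ) (specialUnitaryUnits (Fin N)) x) (fun U => U) (parSymY x.toKIdx) (GpPhysY x.toKIdx (parSymY x.toKIdx))) (Tb2LcoKH x.toKIdx (trBasis N) (bg9Y (Matrix (Fin N) (Fin N) ℂ) (specialUnitaryUnits (Fin N)) x) (fun U => U) (parSymY x.toKIdx) (GpPhysY x.toKIdx (parSymY x.toKIdx)) (𝔯 x).Δ2) 1 (H x) (fun y => (geo9Y_len_pos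 x y).le) (bH13 x) (t12 * ((geo9Y x).M * α₀)) δT12 U)
    (hta₂R : ∀ x : MemberY θ.d₆ θ.ℓ₆ θ.hd' θ.hL' θ.b₀ θ.b₁ Mstar, M12 ≤ (geo9Y x).M → ∀ α₀ : ℝ, 0 < α₀ → (geo9Y x).M * α₀ ≤ a12 → ∀ U : (bg9Y (Matrix (Fin N) (Fin N) ℂ) (specialUnitaryUnits (Fin N)) x).Cfg, (bg9Y (Matrix (Fin N) (Fin N) ℂ) (specialUnitaryUnits (Fin N)) x).Reg335 c35Y α₀ U → (bg9Y (Matrix (Fin N) (Fin N) ℂ) (specialUnitaryUnits (Fin N)) x).Reg336 c35Y α₀ U → HasMaj (cNorm 1 (H x) (𝔬12 x).blk (fun y => (geo9Y_len_pos x y).le) 2) (cNorm 1 (H x) (𝔬12 x).blk (fun y => (geo9Y_len_pos x y).le) 0) (Ta2RcoK x.toKIdx (trBasis N) (bg9Y (Matrix (Fin N) (Fin N) ℂ) (specialUnitaryUnits (Fin N)) x) (fun U => U) (parSymY x.toKIdx) (GpPhysY x.toKIdx (parSymY x.toKIdx)) (𝔯 x).Δ2 U) (fun a a' => t12 * ((geo9Y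 x).M * α₀) * Real.exp (-(δT12 * (geo9Y x).dist a a'))))
    (htb₂R : ∀ x : MemberY θ.d₆ θ.ℓ₆ θ.hd' θ.hL' θ.b₀ θ.b₁ Mstar, M12 ≤ (geo9Y x).M → ∀ α₀ : ℝ, 0 < α₀ → (geo9Y x).M * α₀ ≤ a12 → ∀ U : (bg9Y (Matrix (Fin N) (Fin N) ℂ) (specialUnitaryUnits (Fin N)) x).Cfg, (bg9Y (Matrix (Fin N) (Fin N) ℂ) (specialUnitaryUnits (Fin N)) x).Reg335 c35Y α₀ U → (bg9Y (Matrix (Fin N) (Fin N) ℂ) (specialUnitaryUnits (Fin N)) x).Reg336 c35Y α₀ U → HasMaj (cNormR 1 (H x) (𝔬12 x).blkW (fun y => (geo9Y_len_pos x y).le) 0) (cNormR 1 (H x) (𝔬12 x).blk (fun y => (geo9Y_len_pos x y).le) 1) (Tb2RcoKH x.toKIdx (trBasis N) (bg9Y (Matrix (Fin N) (Fin N) ℂ) (specialUnitaryUnits (Fin N)) x) (fun U => U) (parSymY x.toKIdx) (GpPhysY x.toKIdx (parSymY x.toKIdx)) (𝔯 x).Δ2 U) (fun a a' => t12 * ((geo9Y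 x).M * α₀) * Real.exp (-(δT12 * (geo9Y x).dist a a'))))
    (BdX BiD BdD : ℝ → ℝ) (hBdX : ∀ β, 0 ≤ β → β < 1 → 0 ≤ BdX β) (hBiD : ∀ ε, 0 < ε → 0 ≤ BiD ε)
    -- rows 20–21's probe schema: ONLY the `pXdDH` face (Φ_β∘∇_ν G₀∇*) stays displayed; the `pX0` face (Φ_β∘G₀) is DERIVED (edition 31) at the cut carrier from the G₀ layer's `Thm33G0.e0 ∕ Thm33G0Dir.e1d` (dag-n06-w6 `pX0_of_pins`)
    (hXd : ∀ x : MemberY θ.d₆ θ.ℓ₆ θ.hd' θ.hL' θ.b₀ θ.b₁ Mstar, M12 ≤ (geo9Y x).M → ∀ α₀ : ℝ, 0 < α₀ → (geo9Y x).M * α₀ ≤ a12 → ∀ U : (bg9Y (Matrix (Fin N) (Fin N) ℂ) (specialUnitaryUnits (Fin N)) x).Cfg, (bg9Y (Matrix (Fin N) (Fin N) ℂ) (specialUnitaryUnits (Fin N)) x).Reg335 c35Y α₀ U →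
      (bg9Y (Matrix (Fin N) (Fin N) ℂ) (specialUnitaryUnits (Fin N)) x).Reg336 c35Y α₀ U → ∀ (ν : Fin (θ.d₆ + 1)) (β : ℝ), 0 ≤ β → β < 1 → HasMaj (bH13 x) (cNormR 1 (H x) (𝔭A x).blkPX (fun y => (geo9Y_len_pos x y).le) (β - 1)) (((𝔭A x).ΦX U β ∘ₗ (𝔡A x).Dd U ν ∘ₗ (𝔬12 x).G0 U) ∘ₗ (𝔬12 x).Dv U) (fun a b => BdX β * Real.exp (-(δ12₃ * (geo9Y x).dist a b))))
    (hdiv : ∀ x : MemberY θ.d₆ θ.ℓ₆ θ.hd' θ.hL' θ.b₀ θ.b₁ Mstar, M12 ≤ (geo9Y x).M → ∀ α₀ : ℝ, 0 < α₀ → (geo9Y x).M * α₀ ≤ a12 → ∀ U : (bg9Y (Matrix (Fin N) (Fin N) ℂ) (specialUnitaryUnits (Fin N)) x).Cfg, (bg9Y (Matrix (Fin N) (Fin N) ℂ) (specialUnitaryUnits (Fin N)) x).Reg335 c35Y α₀ U →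
      (bg9Y (Matrix (Fin N) (Fin N) ℂ) (specialUnitaryUnits (Fin N)) x).Reg336 c35Y α₀ U → Thm33G0DivR (𝔬12 x) (𝔡A x).Dsd 1 (H x) (fun y => (geo9Y_len_pos x y).le) (bHXA x) (bHX x) BiD BdD δ12₀ δ12₃ U)
    (hlettersH12 : ∀ x : MemberY θ.d₆ θ.ℓ₆ θ.hd' θ.hL' θ.b₀ θ.b₁ Mstar, M12 ≤ (geo9Y x).M → ∀ α₀ : ℝ, 0 < α₀ → (geo9Y x).M * α₀ ≤ a12 → ∀ U : (bg9Y (Matrix (Fin N) (Fin N) ℂ) (specialUnitaryUnits (Fin N)) x).Cfg, (bg9Y (Matrix (Fin N) (Fin N) ℂ) (specialUnitaryUnits (Fin N)) x).Reg335 c35Y α₀ U →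
      (bg9Y (Matrix (Fin N) (Fin N) ℂ) (specialUnitaryUnits (Fin N)) x).Reg336 c35Y α₀ U → LettersHZ (𝔬12 x) 1 (H x) ⟨geo9Y_dist_triangle x, geo9Y_dist_comm x, geo9K_dist_nonneg x.toKIdx, geo9Y_len_pos x⟩ (weightNorm (BlockNorm.ofBlocks (toB6 (geo9Y x) 1 (H x)) (𝔬12 x).blkZ) (fun y => ((((θ.ℓ₆ + 1 : ℕ) : ℝ) ^ (θ.d₆ + 1)) ^ lvl x.hN x.D x.hk y)⁻¹) (fun y => (plateau_pos x.toKIdx y).le)) B12₃ δ12₃ U)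
    (hpinE : ∀ x : MemberY θ.d₆ θ.ℓ₆ θ.hd' θ.hL' θ.b₀ θ.b₁ Mstar, ((opsYNuOfRecordV4PE N θ.toStage3Params Mstar 𝔯 (sectEYOfRecordV6 N θ.toStage3Params Mstar 𝔢₀) 𝔴 𝔈) x).HasRWExp = HasRWExpOfOps (𝔬12 x))
    (hpinH : ∀ x : MemberY θ.d₆ θ.ℓ₆ θ.hd' θ.hL' θ.b₀ θ.b₁ Mstar, ((opsYNuOfRecordV4PE N θ.toStage3Params Mstar 𝔯 (sectEYOfRecordV6 N θ.toStage3Params Mstar 𝔢₀) 𝔴 𝔈) x).HasRWExpH = HasRWExpHOfOps (𝔬12 x))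
    (hpinK : ∀ x : MemberY θ.d₆ θ.ℓ₆ θ.hd' θ.hL' θ.b₀ θ.b₁ Mstar, ((opsYNuOfRecordV4PE N θ.toStage3Params Mstar 𝔯 (sectEYOfRecordV6 N θ.toStage3Params Mstar 𝔢₀) 𝔴 𝔈) x).PosDefK = PosDefKOfOps (𝔬12 x))
    (hblk12 : ∀ x : MemberY θ.d₆ θ.ℓ₆ θ.hd' θ.hL' θ.b₀ θ.b₁ Mstar, (𝔬12 x).blk = blkBK x.toKIdx (bI x)) (hblkW12 : ∀ x : MemberY θ.d₆ θ.ℓ₆ θ.hd' θ.hL' θ.b₀ θ.b₁ Mstar, (𝔬12 x).blkW = blkSK x.toKIdx (sIK x.toKIdx (bI x))) (hblkY12 : ∀ x : MemberY θ.d₆ θ.ℓ₆ θ.hd' θ.hL' θ.b₀ θ.b₁ Mstar, (𝔬12 x).blkY = blkBK x.toKIdx (bI x))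
    (hG0co12 : ∀ (x : MemberY θ.d₆ θ.ℓ₆ θ.hd' θ.hL' θ.b₀ θ.b₁ Mstar) (U : (bg9Y (Matrix (Fin N) (Fin N) ℂ) (specialUnitaryUnits (Fin N)) x).Cfg), (𝔬12 x).G0 U = GcoK x.toKIdx (trBasis N) (bg9Y (Matrix (Fin N) (Fin N) ℂ) (specialUnitaryUnits (Fin N)) x) (fun U => U) (lettersYOfRecordV4P N θ.toStage3Params Mstar 𝔯 x).GA U)
    (hGco12 : ∀ (x : MemberY θ.d₆ θ.ℓ₆ θ.hd' θ.hL' θ.b₀ θ.b₁ Mstar) (U : (bg9Y (Matrix (Fin N) (Fin N) ℂ) (specialUnitaryUnits (Fin N)) x).Cfg), (𝔬12 x).G U = GcoK x.toKIdx (trBasis N) (bg9Y (Matrix (Fin N) (Fin N) ℂ) (specialUnitaryUnits (Fin N)) x) (fun U => U) (lettersYOfRecordV4P N θ.toStage3Params Mstar 𝔯 x).GD U)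
    (hG1co12 : ∀ (x : MemberY θ.d₆ θ.ℓ₆ θ.hd' θ.hL' θ.b₀ θ.b₁ Mstar) (U : (bg9Y (Matrix (Fin N) (Fin N) ℂ) (specialUnitaryUnits (Fin N)) x).Cfg), (𝔬12 x).G1 U = GcoK x.toKIdx (trBasis N) (bg9Y (Matrix (Fin N) (Fin N) ℂ) (specialUnitaryUnits (Fin N)) x) (fun U => U) (lettersYOfRecordV4P N θ.toStage3Params Mstar 𝔯 x).G₁ U)
    (hGGco12 : ∀ (x : MemberY θ.d₆ θ.ℓ₆ θ.hd' θ.hL' θ.b₀ θ.b₁ Mstar) (U : (bg9Y (Matrix (Fin N) (Fin N) ℂ) (specialUnitaryUnits (Fin N)) x).Cfg), (𝔬12 x).GG U = GcoK x.toKIdx (trBasis N) (bg9Y (Matrix (Fin N) (Fin N) ℂ) (specialUnitaryUnits (Fin N)) x) (fun U => U) (lettersYOfRecordV4P N θ.toStage3Params Mstar 𝔯 x).GG U)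
    (hDco12 : ∀ (x : MemberY θ.d₆ θ.ℓ₆ θ.hd' θ.hL' θ.b₀ θ.b₁ Mstar) (U : (bg9Y (Matrix (Fin N) (Fin N) ℂ) (specialUnitaryUnits (Fin N)) x).Cfg), (𝔬12 x).D U = DcoK x.toKIdx (trBasis N) (bg9Y (Matrix (Fin N) (Fin N) ℂ) (specialUnitaryUnits (Fin N)) x) (fun U => U) U)
    (hDsco12 : ∀ (x : MemberY θ.d₆ θ.ℓ₆ θ.hd' θ.hL' θ.b₀ θ.b₁ Mstar) (U : (bg9Y (Matrix (Fin N) (Fin N) ℂ) (specialUnitaryUnits (Fin N)) x).Cfg), (𝔬12 x).Dstar U = DscoK x.toKIdx (trBasis N) (bg9Y (Matrix (Fin N) (Fin N) ℂ) (specialUnitaryUnits (Fin N)) x) (fun U => U) U) (hblkZ12 : ∀ x : MemberY θ.d₆ θ.ℓ₆ θ.hd' θ.hL' θ.b₀ θ.b₁ Mstar, (𝔬12 x).blkZ = blkHK x.toKIdx)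
    (hHm12 : ∀ (x : MemberY θ.d₆ θ.ℓ₆ θ.hd' θ.hL' θ.b₀ θ.b₁ Mstar) (U : (bg9Y (Matrix (Fin N) (Fin N) ℂ) (specialUnitaryUnits (Fin N)) x).Cfg), (𝔬12 x).Hm U = HcoK x.toKIdx (trBasis N) (bg9Y (Matrix (Fin N) (Fin N) ℂ) (specialUnitaryUnits (Fin N)) x) (fun U => U) (lettersYOfRecordV4P N θ.toStage3Params Mstar 𝔯 x).H U)
    (hH1m12 : ∀ (x : MemberY θ.d₆ θ.ℓ₆ θ.hd' θ.hL' θ.b₀ θ.b₁ Mstar) (U : (bg9Y (Matrix (Fin N) (Fin N) ℂ) (specialUnitaryUnits (Fin N)) x).Cfg), (𝔬12 x).H1m U = HcoK x.toKIdx (trBasis N) (bg9Y (Matrix (Fin N) (Fin N) ℂ) (specialUnitaryUnits (Fin N)) x) (fun U => U) (lettersYOfRecordV4P N θ.toStage3Params Mstar 𝔯 x).H₁ U)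
    -- PINS of the remaining ten Sect.-D letters of `𝔬12` — Δ_a, Δ′_π, Δ⁽²⁾_π, Q, Q*, C, C₁, D, D*, R — to node00-def-Y g10's coordinate models (`Node00.OpsYSectDCoords` §5; scalings c⁻¹ ∕ c ∕ 1 built in)
    (hS0co12 : ∀ (x : MemberY θ.d₆ θ.ℓ₆ θ.hd' θ.hL' θ.b₀ θ.b₁ Mstar) (U : (bg9Y (Matrix (Fin N) (Fin N) ℂ) (specialUnitaryUnits (Fin N)) x).Cfg), (𝔬12 x).S0 U = S0coK x.toKIdx (trBasis N) (bg9Y (Matrix (Fin N) (Fin N) ℂ) (specialUnitaryUnits (Fin N)) x) (fun U => U) (parSymY x.toKIdx) (parBY x.toKIdx) (GpPhysY x.toKIdx (parSymY x.toKIdx)) U) (hTpico12 : ∀ (x : MemberY θ.d₆ θ.ℓ₆ θ.hd' θ.hL' θ.b₀ θ.b₁ Mstar) (U : (bg9Y (Matrix (Fin N) (Fin N) ℂ) (specialUnitaryUnits (Fin N)) x).Cfg), (𝔬12 x).Tpi U = TpicoK x.toKIdx (trBasis N) (bg9Y (Matrix (Fin N) (Fin N) ℂ) (specialUnitaryUnits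 (Fin N)) x) (fun U => U) (parSymY x.toKIdx) (GpPhysY x.toKIdx (parSymY x.toKIdx)) U)
    (hT2co12 : ∀ (x : MemberY θ.d₆ θ.ℓ₆ θ.hd' θ.hL' θ.b₀ θ.b₁ Mstar) (U : (bg9Y (Matrix (Fin N) (Fin N) ℂ) (specialUnitaryUnits (Fin N)) x).Cfg), (𝔬12 x).T2 U = T2coK x.toKIdx (trBasis N) (bg9Y (Matrix (Fin N) (Fin N) ℂ) (specialUnitaryUnits (Fin N)) x) (fun U => U) (parSymY x.toKIdx) (GpPhysY x.toKIdx (parSymY x.toKIdx)) (𝔯 x).Δ2 U) (hQco12 : ∀ (x : MemberY θ.d₆ θ.ℓ₆ θ.hd' θ.hL' θ.b₀ θ.b₁ Mstar) (U : (bg9Y (Matrix (Fin N) (Fin N) ℂ) (specialUnitaryUnits (Fin N)) x).Cfg), (𝔬12 x).Q U = QcoKH x.toKIdx (trBasis N) (bg9Y (Matrix (Fin N) (Fin N) ℂ) (specialUnitaryUnits (Fin N)) x) (fun U => U) (parBY x.toKIdx) U)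
    (hQsco12 : ∀ (x : MemberY θ.d₆ θ.ℓ₆ θ.hd' θ.hL' θ.b₀ θ.b₁ Mstar) (U : (bg9Y (Matrix (Fin N) (Fin N) ℂ) (specialUnitaryUnits (Fin N)) x).Cfg), (𝔬12 x).Qstar U = QscoKH x.toKIdx (trBasis N) (bg9Y (Matrix (Fin N) (Fin N) ℂ) (specialUnitaryUnits (Fin N)) x) (fun U => U) (parBY x.toKIdx) U) (hCco12 : ∀ (x : MemberY θ.d₆ θ.ℓ₆ θ.hd' θ.hL' θ.b₀ θ.b₁ Mstar) (U : (bg9Y (Matrix (Fin N) (Fin N) ℂ) (specialUnitaryUnits (Fin N)) x).Cfg), (𝔬12 x).C U = CcoK x.toKIdx (trBasis N) (bg9Y (Matrix (Fin N) (Fin N) ℂ) (specialUnitaryUnits (Fin N)) x) (fun U => U) (parSymY x.toKIdx) (parBY x.toKIdx) (GpPhysY x.toKIdx (parSymY x.toKIdx)) U)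
    (hC1co12 : ∀ (x : MemberY θ.d₆ θ.ℓ₆ θ.hd' θ.hL' θ.b₀ θ.b₁ Mstar) (U : (bg9Y (Matrix (Fin N) (Fin N) ℂ) (specialUnitaryUnits (Fin N)) x).Cfg), (𝔬12 x).C1 U = C1coK x.toKIdx (trBasis N) (bg9Y (Matrix (Fin N) (Fin N) ℂ) (specialUnitaryUnits (Fin N)) x) (fun U => U) (parSymY x.toKIdx) (parBY x.toKIdx) (GpPhysY x.toKIdx (parSymY x.toKIdx)) (𝔯 x).Δ2 U) (hDvco12 : ∀ (x : MemberY θ.d₆ θ.ℓ₆ θ.hd' θ.hL' θ.b₀ θ.b₁ Mstar) (U : (bg9Y (Matrix (Fin N) (Fin N) ℂ) (specialUnitaryUnits (Fin N)) x).Cfg), (𝔬12 x).Dv U = DvcoKH x.toKIdx (trBasis N) (bg9Y (Matrix (Fin N) (Fin N) ℂ) (specialUnitaryUnits (Fin N)) x) (fun U => U) U)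
    (hDvsco12 : ∀ (x : MemberY θ.d₆ θ.ℓ₆ θ.hd' θ.hL' θ.b₀ θ.b₁ Mstar) (U : (bg9Y (Matrix (Fin N) (Fin N) ℂ) (specialUnitaryUnits (Fin N)) x).Cfg), (𝔬12 x).Dvstar U = DvscoKH x.toKIdx (trBasis N) (bg9Y (Matrix (Fin N) (Fin N) ℂ) (specialUnitaryUnits (Fin N)) x) (fun U => U) U) (hRco12 : ∀ (x : MemberY θ.d₆ θ.ℓ₆ θ.hd' θ.hL' θ.b₀ θ.b₁ Mstar) (U : (bg9Y (Matrix (Fin N) (Fin N) ℂ) (specialUnitaryUnits (Fin N)) x).Cfg), (𝔬12 x).R U = RcoK x.toKIdx (trBasis N) (bg9Y (Matrix (Fin N) (Fin N) ℂ) (specialUnitaryUnits (Fin N)) x) (fun U => U) (parSymY x.toKIdx) (GpPhysY x.toKIdx (parSymY x.toKIdx)) U)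
    -- row 20's perturbation-step ∕ H-letter schemas in n06-l's direction-indexed species at the pinned single-direction letters `(𝔡A x).Dd ∕ .Dsd` (printed-shape hypothesis schemas; nothing of print asserted);
    -- the trace-symmetries of G_D, G₁, 𝔊 at SU(N)-valued U follow from ONE property of the residual PARAMETER `𝔯`: Δ⁽²⁾(U) symmetric (def-Y `Node00.OpsYSectDESymm.lettersYOfRecordV4P_symmDG₁GG`)
    (hΔ2 : ∀ (x : MemberY θ.d₆ θ.ℓ₆ θ.hd' θ.hL' θ.b₀ θ.b₁ Mstar) (U : (bg9Y (Matrix (Fin N) (Fin N) ℂ) (specialUnitaryUnits (Fin N)) x).Cfg), (∀ μ z, U μ z ∈ specialUnitaryUnits (Fin N)) → IsSymmTr (fun _ => (1 : ℝ)) ((𝔯 x).Δ2 U))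
    -- (3.124) p.420 and its G₁-twins p.425 (QG₁DR = 0, RD*G₁Q* = 0, RD*G₁DR = R; n06-l g11 `Ids3124`): DISPLAYED, NOT dischargeable at the instance of record for the TYPED reading of Q(U) at curved U (node00-def-Y g10 LOCATED GAP O5, memo `IDENTITIES-AT-LETTERS.md`); holds at U = 1.  The ten definitional identities `IdentitiesDef` are DERIVED at the pins.
    (hIds3124 : ∀ x : MemberY θ.d₆ θ.ℓ₆ θ.hd' θ.hL' θ.b₀ θ.b₁ Mstar, M12 ≤ (geo9Y x).M → ∀ α₀ : ℝ, 0 < α₀ → (geo9Y x).M * α₀ ≤ a12 → ∀ U : (bg9Y (Matrix (Fin N) (Fin N) ℂ) (specialUnitaryUnits (Fin N)) x).Cfg, (bg9Y (Matrix (Fin N) (Fin N) ℂ) (specialUnitaryUnits (Fin N)) x).Reg335 c35Y α₀ U →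
      (bg9Y (Matrix (Fin N) (Fin N) ℂ) (specialUnitaryUnits (Fin N)) x).Reg336 c35Y α₀ U → Ids3124 (𝔬12 x) U)
    (θ₂ δ₂ : ℝ) (hθ₂ : 0 ≤ θ₂) (hrT4 : rT ≤ δ46 θ.d₆ θ.ℓ₆ θ.hd' θ.hL' θ.b₀ θ.b₁ Mstar N c35Y c35Y_pos) (hrT2 : rT ≤ δ₂)
    (hD2sup : ∀ x : MemberY θ.d₆ θ.ℓ₆ θ.hd' θ.hL' θ.b₀ θ.b₁ Mstar, M12 ≤ (geo9Y x).M → ∀ α₀ : ℝ, 0 < α₀ → (geo9Y x).M * α₀ ≤ a12 → ∀ U : (bg9Y (Matrix (Fin N) (Fin N) ℂ) (specialUnitaryUnits (Fin N)) x).Cfg, (bg9Y (Matrix (Fin N) (Fin N) ℂ) (specialUnitaryUnits (Fin N)) x).Reg335 c35Y α₀ U →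
      (bg9Y (Matrix (Fin N) (Fin N) ℂ) (specialUnitaryUnits (Fin N)) x).Reg336 c35Y α₀ U → B6RandomWalk.HasMajorant (g := toB6 (geo9Y x) 1 (H x)) (𝔬12 x).blk (D2coK x.toKIdx (trBasis N) (bg9Y (Matrix (Fin N) (Fin N) ℂ) (specialUnitaryUnits (Fin N)) x) (fun U => U) ((𝔯 x).Δ2) U) (fun (a b : (geo9Y x).Site) => θ₂ * ((geo9Y x).M * α₀) * ((geo9Y x).len a ^ 2)⁻¹ * Real.exp (-(δ₂ * (geo9Y x).dist a b))))
    (hLHH : ∀ x : MemberY θ.d₆ θ.ℓ₆ θ.hd' θ.hL' θ.b₀ θ.b₁ Mstar, M12 ≤ (geo9Y x).M → ∀ α₀ : ℝ, 0 < α₀ → (geo9Y x).M * α₀ ≤ a12 → ∀ U : (bg9Y (Matrix (Fin N) (Fin N) ℂ) (specialUnitaryUnits (Fin N)) x).Cfg, (bg9Y (Matrix (Fin N) (Fin N) ℂ) (specialUnitaryUnits (Fin N)) x).Reg335 c35Y α₀ U →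
      (bg9Y (Matrix (Fin N) (Fin N) ℂ) (specialUnitaryUnits (Fin N)) x).Reg336 c35Y α₀ U →  LettersHHZ (𝔬12 x) (𝔭A x) 1 (H x) (fun y => (geo9Y_len_pos x y).le) (weightNorm (BlockNorm.ofBlocks (toB6 (geo9Y x) 1 (H x)) (𝔬12 x).blkZ) (fun y => ((((θ.ℓ₆ + 1 : ℕ) : ℝ) ^ (θ.d₆ + 1)) ^ lvl x.hN x.D x.hk y)⁻¹) (fun y => (plateau_pos x.toKIdx y).le)) Bq12 δ12₃ U)
    (hLH3 : ∀ x : MemberY θ.d₆ θ.ℓ₆ θ.hd' θ.hL' θ.b₀ θ.b₁ Mstar, M12 ≤ (geo9Y x).M → ∀ α₀ : ℝ, 0 < α₀ → (geo9Y x).M * α₀ ≤ a12 → ∀ U : (bg9Y (Matrix (Fin N) (Fin N) ℂ) (specialUnitaryUnits (Fin N)) x).Cfg, (bg9Y (Matrix (Fin N) (Fin N) ℂ) (specialUnitaryUnits (Fin N)) x).Reg335 c35Y α₀ U →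
      (bg9Y (Matrix (Fin N) (Fin N) ℂ) (specialUnitaryUnits (Fin N)) x).Reg336 c35Y α₀ U → Letters313HZ (𝔬12 x) (𝔭A x) 1 (H x) ⟨geo9Y_dist_triangle x, geo9Y_dist_comm x, geo9K_dist_nonneg x.toKIdx, geo9Y_len_pos x⟩ (fun y => ((((θ.ℓ₆ + 1 : ℕ) : ℝ) ^ (θ.d₆ + 1)) ^ lvl x.hN x.D x.hk y)⁻¹) (fun y => plateau_pos x.toKIdx y) (bH13 x) BhD13 Bx13 δ12₃ U)
    (hLL2 : ∀ x : MemberY θ.d₆ θ.ℓ₆ θ.hd' θ.hL' θ.b₀ θ.b₁ Mstar, M12 ≤ (geo9Y x).M → ∀ α₀ : ℝ, 0 < α₀ → (geo9Y x).M * α₀ ≤ a12 → ∀ U : (bg9Y (Matrix (Fin N) (Fin N) ℂ) (specialUnitaryUnits (Fin N)) x).Cfg, (bg9Y (Matrix (Fin N) (Fin N) ℂ) (specialUnitaryUnits (Fin N)) x).Reg335 c35Y α₀ U →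
      (bg9Y (Matrix (Fin N) (Fin N) ℂ) (specialUnitaryUnits (Fin N)) x).Reg336 c35Y α₀ U → Letters313L2PZ (𝔬12 x) (𝔡A x).Dd (𝔡A x).Dsd 1 (H x) B13₄ δ12₃ (fun y => Real.sqrt ((((θ.ℓ₆ + 1 : ℕ) : ℝ) ^ (θ.d₆ + 1)) ^ lvl x.hN x.D x.hk y)⁻¹) (fun y => Real.sqrt_pos.2 (plateau_pos x.toKIdx y)) U ∧ Letters313L2MZ (𝔬12 x) (𝔡A x).Dd (𝔡A x).Dsd 1 (H x) B13₄ δ12₃ (fun y => Real.sqrt ((((θ.ℓ₆ + 1 : ℕ) : ℝ) ^ (θ.d₆ + 1)) ^ lvl x.hN x.D x.hk y)⁻¹) (fun y => Real.sqrt_pos.2 (plateau_pos x.toKIdx y)) U)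
    (hLIM : ∀ x : MemberY θ.d₆ θ.ℓ₆ θ.hd' θ.hL' θ.b₀ θ.b₁ Mstar, M12 ≤ (geo9Y x).M → ∀ α₀ : ℝ, 0 < α₀ → (geo9Y x).M * α₀ ≤ a12 → ∀ U : (bg9Y (Matrix (Fin N) (Fin N) ℂ) (specialUnitaryUnits (Fin N)) x).Cfg, (bg9Y (Matrix (Fin N) (Fin N) ℂ) (specialUnitaryUnits (Fin N)) x).Reg335 c35Y α₀ U →
      (bg9Y (Matrix (Fin N) (Fin N) ℂ) (specialUnitaryUnits (Fin N)) x).Reg336 c35Y α₀ U → Letters313IML (𝔬12 x) (𝔭A x) (𝔡A x).Dd (𝔡A x).Dsd 1 (H x) (fun y => (geo9Y_len_pos x y).le) (bHXA x) (bHX x) Br13 (fun ε => θV13 ε * ((geo9Y x).M * α₀)) Bd13 Bd2₁₃ δ12₃ δK12 U)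
    (hletters13 : ∀ x : MemberY θ.d₆ θ.ℓ₆ θ.hd' θ.hL' θ.b₀ θ.b₁ Mstar, M12 ≤ (geo9Y x).M → ∀ α₀ : ℝ, 0 < α₀ → (geo9Y x).M * α₀ ≤ a12 → ∀ U : (bg9Y (Matrix (Fin N) (Fin N) ℂ) (specialUnitaryUnits (Fin N)) x).Cfg, (bg9Y (Matrix (Fin N) (Fin N) ℂ) (specialUnitaryUnits (Fin N)) x).Reg335 c35Y α₀ U →
      (bg9Y (Matrix (Fin N) (Fin N) ℂ) (specialUnitaryUnits (Fin N)) x).Reg336 c35Y α₀ U → Letters313Z (𝔬12 x) 1 (H x) ⟨geo9Y_dist_triangle x, geo9Y_dist_comm x, geo9K_dist_nonneg x.toKIdx, geo9Y_len_pos x⟩ (fun y => ((((θ.ℓ₆ + 1 : ℕ) : ℝ) ^ (θ.d₆ + 1)) ^ lvl x.hN x.D x.hk y)⁻¹) (fun y => plateau_pos x.toKIdx y) B12₃ δ12₃ U)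
    (hlettersD13 : ∀ x : MemberY θ.d₆ θ.ℓ₆ θ.hd' θ.hL' θ.b₀ θ.b₁ Mstar, M12 ≤ (geo9Y x).M → ∀ α₀ : ℝ, 0 < α₀ → (geo9Y x).M * α₀ ≤ a12 → ∀ U : (bg9Y (Matrix (Fin N) (Fin N) ℂ) (specialUnitaryUnits (Fin N)) x).Cfg, (bg9Y (Matrix (Fin N) (Fin N) ℂ) (specialUnitaryUnits (Fin N)) x).Reg335 c35Y α₀ U →
      (bg9Y (Matrix (Fin N) (Fin N) ℂ) (specialUnitaryUnits (Fin N)) x).Reg336 c35Y α₀ U → Letters313DZ (𝔬12 x) 1 (H x) ⟨geo9Y_dist_triangle x, geo9Y_dist_comm x, geo9K_dist_nonneg x.toKIdx, geo9Y_len_pos x⟩ (fun y => ((((θ.ℓ₆ + 1 : ℕ) : ℝ) ^ (θ.d₆ + 1)) ^ lvl x.hN x.D x.hk y)⁻¹) (fun y => plateau_pos x.toKIdx y) B12₃ δ12₃ (bH13 x) U ∧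
        Letters313DMZ (𝔬12 x) (𝔭A x) (𝔡A x).Dd 1 (H x) ⟨geo9Y_dist_triangle x, geo9Y_dist_comm x, geo9K_dist_nonneg x.toKIdx, geo9Y_len_pos x⟩ (fun y => ((((θ.ℓ₆ + 1 : ℕ) : ℝ) ^ (θ.d₆ + 1)) ^ lvl x.hN x.D x.hk y)⁻¹) (fun y => plateau_pos x.toKIdx y) B12₃ Bq12 δ12₃ (bH13 x) U)
    {E14₁ E14₂ : ∀ x : MemberY θ.d₆ θ.ℓ₆ θ.hd' θ.hL' θ.b₀ θ.b₁ Mstar, B9.RWExpansion (geo9Y x) (bg9Y (Matrix (Fin N) (Fin N) ℂ) (specialUnitaryUnits (Fin N)) x)} (T14₁ : ∀ x : MemberY θ.d₆ θ.ℓ₆ θ.hd' θ.hL' θ.b₀ θ.b₁ Mstar, (E14₁ x).Walk → BondOpY (Matrix (Fin N) (Fin N) ℂ) x.toKIdx)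
    (T14₂ : ∀ x : MemberY θ.d₆ θ.ℓ₆ θ.hd' θ.hL' θ.b₀ θ.b₁ Mstar, (E14₂ x).Walk → BondOpY (Matrix (Fin N) (Fin N) ℂ) x.toKIdx) (X14₁ : ∀ x : MemberY θ.d₆ θ.ℓ₆ θ.hd' θ.hL' θ.b₀ θ.b₁ Mstar, (E14₁ x).Walk → ℕ → (geo9Y x).Site → Prop)
    (M14₁ : ∀ x : MemberY θ.d₆ θ.ℓ₆ θ.hd' θ.hL' θ.b₀ θ.b₁ Mstar, (E14₁ x).Walk → ℕ → Prop) (X14₂ : ∀ x : MemberY θ.d₆ θ.ℓ₆ θ.hd' θ.hL' θ.b₀ θ.b₁ Mstar, (E14₂ x).Walk → ℕ → (geo9Y x).Site → Prop) (M14₂ : ∀ x : MemberY θ.d₆ θ.ℓ₆ θ.hd' θ.hL' θ.b₀ θ.b₁ Mstar, (E14₂ x).Walk → ℕ → Prop) (diam14 : MemberY θ.d₆ θ.ℓ₆ θ.hd' θ.hL' θ.b₀ θ.b₁ Mstar → ℝ) (r14 : ℝ) (hr14 : ∀ x, diam14 x ≤ r14)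
    (near14₁ : ∀ (x : MemberY θ.d₆ θ.ℓ₆ θ.hd' θ.hL' θ.b₀ θ.b₁ Mstar) ω m p, M14₁ x ω m → X14₁ x ω m p → ∃ q, q ∈ OmegaC x.D x.D' ∧ tdistK (ℓ := θ.ℓ₆) (Mh := x.Mh) (k := x.k) (P := x.P') (kLab x p) q ≤ diam14 x) (first14₁ : ∀ (x : MemberY θ.d₆ θ.ℓ₆ θ.hd' θ.hL' θ.b₀ θ.b₁ Mstar) ω y, (E14₁ x).first ω y → X14₁ x ω 0 y)
    (chain14₁ : ∀ (x : MemberY θ.d₆ θ.ℓ₆ θ.hd' θ.hL' θ.b₀ θ.b₁ Mstar) ω y y', (E14₁ x).first ω y → (E14₁ x).last ω y' → ∃ l : List (geo9Y x).Site, l.length = (E14₁ x).wlen ω ∧ (∀ (m : ℕ) (hm : m < l.length), X14₁ x ω (m + 1) (l[m])) ∧ B9Thm314.chainSum (geo9Y x).dist y l y' ≤ (E14₁ x).wdist ω y y')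
    (near14₂ : ∀ (x : MemberY θ.d₆ θ.ℓ₆ θ.hd' θ.hL' θ.b₀ θ.b₁ Mstar) ω m p, M14₂ x ω m → X14₂ x ω m p → ∃ q, q ∈ OmegaC x.D x.D' ∧ tdistK (ℓ := θ.ℓ₆) (Mh := x.Mh) (k := x.k) (P := x.P') (kLab x p) q ≤ diam14 x) (first14₂ : ∀ (x : MemberY θ.d₆ θ.ℓ₆ θ.hd' θ.hL' θ.b₀ θ.b₁ Mstar) ω y, (E14₂ x).first ω y → X14₂ x ω 0 y)
    (chain14₂ : ∀ (x : MemberY θ.d₆ θ.ℓ₆ θ.hd' θ.hL' θ.b₀ θ.b₁ Mstar) ω y y', (E14₂ x).first ω y → (E14₂ x).last ω y' → ∃ l : List (geo9Y x).Site, l.length = (E14₂ x).wlen ω ∧ (∀ (m : ℕ) (hm : m < l.length), X14₂ x ω (m + 1) (l[m])) ∧ B9Thm314.chainSum (geo9Y x).dist y l y' ≤ (E14₂ x).wdist ω y y')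
    (h14₁ : Thm310AllNormsPrinted c35Y geo9Y (bg9Y (Matrix (Fin N) (Fin N) ℂ) (specialUnitaryUnits (Fin N))) E14₁ (fun x ω => kernelFamilyB x.toKIdx (bg9Y (Matrix (Fin N) (Fin N) ℂ) (specialUnitaryUnits (Fin N)) x) (fun U => U) (T14₁ x ω) (lettersYOfRecordV4P N θ.toStage3Params Mstar 𝔯 x).parB))
    (h14₂ : Thm310AllNormsPrinted c35Y geo9Y (bg9Y (Matrix (Fin N) (Fin N) ℂ) (specialUnitaryUnits (Fin N))) E14₂ (fun x ω => kernelFamilyB x.toKIdx (bg9Y (Matrix (Fin N) (Fin N) ℂ) (specialUnitaryUnits (Fin N)) x) (fun U => U) (T14₂ x ω) (lettersYOfRecordV4P N θ.toStage3Params Mstar 𝔯 x).parB))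
    (W14₁ : ∀ x : MemberY θ.d₆ θ.ℓ₆ θ.hd' θ.hL' θ.b₀ θ.b₁ Mstar, ℕ → (geo9Y x).Site → (geo9Y x).Site → Finset (E14₁ x).Walk) (W14₂ : ∀ x : MemberY θ.d₆ θ.ℓ₆ θ.hd' θ.hL' θ.b₀ θ.b₁ Mstar, ℕ → (geo9Y x).Site → (geo9Y x).Site → Finset (E14₂ x).Walk) (hW14₁ : ∀ x, WalkSetsSpec (E14₁ x) (W14₁ x))
    (hW14₂ : ∀ x, WalkSetsSpec (E14₂ x) (W14₂ x)) (hcnt14₁ : WalkWeightsSummable geo9Y (bg9Y (Matrix (Fin N) (Fin N) ℂ) (specialUnitaryUnits (Fin N))) E14₁ W14₁) (hcnt14₂ : WalkWeightsSummable geo9Y (bg9Y (Matrix (Fin N) (Fin N) ℂ) (specialUnitaryUnits (Fin N))) E14₂ W14₂)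
    (hexp14 : ∀ (x : MemberY θ.d₆ θ.ℓ₆ θ.hd' θ.hL' θ.b₀ θ.b₁ Mstar) (U : (bg9Y (Matrix (Fin N) (Fin N) ℂ) (specialUnitaryUnits (Fin N)) x).Cfg), (E14₁ x).Converges U ∧ (E14₂ x).Converges U → ExpansionReads x.toKIdx (B := bg9Y (Matrix (Fin N) (Fin N) ℂ) (specialUnitaryUnits (Fin N)) x) (fun U => U)
      (lettersYOfRecordV4P N θ.toStage3Params Mstar 𝔯 x).Kdiff (pairOp (locDataY x (E14₁ x) (X14₁ x) (M14₁ x) (diam14 x)).Touches (locData₂ (locDataY x (E14₁ x) (X14₁ x) (M14₁ x) (diam14 x)) (X14₂ x) (M14₂ x)).Touches (T14₁ x) (T14₂ x)) (pairWalkSets (W14₁ x) (W14₂ x) (locDataY x (E14₁ x) (X14₁ x) (M14₁ x) (diam14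
      x)).Touches (locData₂ (locDataY x (E14₁ x) (X14₁ x) (M14₁ x) (diam14 x)) (X14₂ x) (M14₂ x)).Touches) U)
    -- row 26 displays NO binder of its own (edition 18): its decay half from rows 20–21's derived `hmodel12`, its coercivity half from row 17's `hΔA` + n06-i g14's hypothesis-free energy estimate `hP1_of_reg335`
    {a₀E δ₁E B₁E : ℝ} (ha₀E : 0 < a₀E) (hδ₁E : 0 < δ₁E) (hB₁E : 0 < B₁E)
    (hE : ∀ (x : MemberY θ.d₆ θ.ℓ₆ θ.hd' θ.hL' θ.b₀ θ.b₁ Mstar) (α₀ : ℝ), 0 < α₀ → (geo9Y x).M * α₀ ≤ a₀E → ∀ U : (bg9Y (Matrix (Fin N) (Fin N) ℂ) (specialUnitaryUnits (Fin N)) x).Cfg, (bg9Y (Matrix (Fin N) (Fin N) ℂ) (specialUnitaryUnits (Fin N)) x).Reg335 c35Y α₀ U → (bg9Y (Matrix (Fin N) (Fin N) ℂ) (specialUnitaryUnits (Fin N)) x).Reg336 c35Y α₀ U →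
      givenBy3185Y x (lettersYOfRecordV4P N θ.toStage3Params Mstar 𝔯 x) (sectEYOfRecordV6 N θ.toStage3Params Mstar 𝔢₀ x) U ∧ hasRWExpCY (𝔴 x) U δ₁E ∧
        DecayMidOnY x (lettersYOfRecordV4P N θ.toStage3Params Mstar 𝔯 x) (sectEYOfRecordV6 N θ.toStage3Params Mstar 𝔢₀ x) B₁E U δ₁E)
    (P : B12.RunParams) : Dag.B9_main (leavesP w P) := by
  have hL1 : (1 : ℝ) ≤ ((θ.ℓ₆ + 1 : ℕ) : ℝ) := (by exact_mod_cast Nat.succ_le_succ (Nat.zero_le _)); have hmE : (0 : ℝ) < 1 + 4 * (((θ.d₆ + 1) * θ.ℓ₆ : ℕ) : ℝ) := by positivity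
  have hρS : 0 ≤ ρS := by have hαFδ : 0 ≤ q.αF * ((1 - 2 * q.α) * q.δ₀) := mul_nonneg hq.αF_pos.le (mul_nonneg (by linarith only [hq.α_lt]) hq.δ₀_pos.le); linarith only [hσS.le, hσSK, hδKS, hαFδ]
  have t311 := B9Thm311ReadingAtLetters.t311_of_pins_opsYOfLetters θ.toStage3Params Mstar (lettersYOfRecordV4P N θ.toStage3Params Mstar 𝔯) 𝔈 (fun x => B9Thm311PosAtRecordV4.proofLettersGA (lettersYOfRecordV4P N θ.toStage3Params Mstar 𝔯 x)) 0 a311 M311 ha311 hM311 (fun _ => rfl) (fun _ => rfl)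
    (fun x hM α₀ hα₀ hMa U hU => B9Thm311SymmAtRecordV4.inputs311Y_of_five specialUnitaryUnits_le_unitaryUnits x (lettersYOfRecordV4P N θ.toStage3Params Mstar 𝔯 x) _ rfl rfl rfl rfl hU.1.1 (B9Thm311PosAtRecordV4.inputs311Y₅_of_four specialUnitaryUnits_le_unitaryUnits x (lettersYOfRecordV4P N θ.toStage3Params Mstar 𝔯 x) _ rfl hU.1.1
      (B9Thm311PosAtRecordV4.inputs311Y₄_of_posDefTr_deltaAY x (lettersYOfRecordV4P N θ.toStage3Params Mstar 𝔯 x) rfl le_rfl (hM311.le.trans hM) (hΔA x hM α₀ hα₀ hMa U hU)))) hPD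
  have t315 := t315_opsYSectE_of_3185_on N θ.toStage3Params Mstar (opsYS349NuOfLetters N θ.toStage3Params Mstar (lettersYOfRecordV4P N θ.toStage3Params Mstar 𝔯) 𝔈) (lettersYOfRecordV4P N θ.toStage3Params Mstar 𝔯) (sectEYOfRecordV6 N θ.toStage3Params Mstar 𝔢₀) 𝔴
    (r := (θ.ℓ₆ : ℝ) + 2) ha₀E hδ₁E hB₁E hmE hmE fun x α₀ hα hMa U hU hU' => by
    obtain ⟨h85, hRW, hS⟩ := hE x α₀ hα hMa U hU hU'; exact ⟨h85, hRW, localOuterY_sectEYOfRecordV6 N θ.toStage3Params Mstar 𝔢₀ x specialUnitaryUnits_le_unitaryUnits hU.1.1, hS⟩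
  obtain ⟨t314, t314loc⟩ : B9.Thm314Printed c35Y geo9Y (bg9Y (Matrix (Fin N) (Fin N) ℂ) (specialUnitaryUnits (Fin N))) (fun x => ((opsYNuOfRecordV4PE N θ.toStage3Params Mstar 𝔯 (sectEYOfRecordV6 N θ.toStage3Params Mstar 𝔢₀) 𝔴 𝔈) x).Kdiff) dOmegaY ∧
      B9Thm314.Thm314LocalPrinted c35Y geo9Y (bg9Y (Matrix (Fin N) (Fin N) ℂ) (specialUnitaryUnits (Fin N))) (fun x => ((opsYNuOfRecordV4PE N θ.toStage3Params Mstar 𝔯 (sectEYOfRecordV6 N θ.toStage3Params Mstar 𝔢₀) 𝔴 𝔈) x).Kdiff) OmKY dOmegaY :=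
    thm314_pair_layerOfLetters (lettersYOfRecordV4P N θ.toStage3Params Mstar 𝔯) 𝔈 T14₁ T14₂ (fun x => locDataY x (E14₁ x) (X14₁ x) (M14₁ x) (diam14 x)) X14₂ M14₂
      (fun x => locDataY_laws x (E14₁ x) (near14₁ x) (first14₁ x) (chain14₁ x)) (fun x => locDataY_laws x (E14₂ x) (near14₂ x) (first14₂ x) (chain14₂ x)) r14 hr14
      (fun x => modelSignsOn_geo9K x.toKIdx) (fun x y y' => dOmegaY_nonneg x y y') h14₁ h14₂ W14₁ W14₂ hW14₁ hW14₂ hcnt14₁ hcnt14₂ hexp14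
  have hGp := hGp_opsYOfLetters_holds N θ.toStage3Params Mstar (lettersYOfRecordV4P N θ.toStage3Params Mstar 𝔯) 𝔈; have hGA := hGA_opsYOfLetters N θ.toStage3Params Mstar (lettersYOfRecordV4P N θ.toStage3Params Mstar 𝔯) 𝔈
  obtain ⟨t39, hksum⟩ := t39_hksum_oneCube_opsYOfLetters_F θ.toStage3Params Mstar (lettersYOfRecordV4P N θ.toStage3Params Mstar 𝔯) 𝔈 bI α' r39 B39 δ39 a39 M39 hα'0 hα'1 hr39 hrδ39 hB39 ha39 hM39 h348 (fun _ => rfl) hβI hEK39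
  have hsat : ∀ (x : MemberY θ.d₆ θ.ℓ₆ θ.hd' θ.hL' θ.b₀ θ.b₁ Mstar) (n : Fin 4) (B' δ' : ℝ), (∀ a a' b, RelB x.toKIdx a a' → maj342 (geo9Y x) n B' δ' a b = maj342 (geo9Y x) n B' δ' a' b) ∧
      (∀ a b b', RelB x.toKIdx b b' → maj342 (geo9Y x) n B' δ' a b = maj342 (geo9Y x) n B' δ' a b') := fun x n B' δ' => ⟨fun a a' b h => maj342_relB_left x.toKIdx n B' δ' a a' b h, fun a b b' h => maj342_relB_right x.toKIdx n B' δ' a b b' h⟩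
  have hmult : ∀ (x : MemberY θ.d₆ θ.ℓ₆ θ.hd' θ.hL' θ.b₀ θ.b₁ Mstar) (y' : (geo9Y x).Site), (Finset.univ.filter (fun y'' : (geo9Y x).Site => RelB x.toKIdx y'' y')).card ≤ 2 * (θ.d₆ + 1) := fun x y' => by
    refine le_trans (Finset.card_le_card fun c hc => ?_) (card_sameCarrier_le_kIdx x.toKIdx y'); exact Finset.mem_filter.2 ⟨@Finset.mem_univ _ (_) c, (Finset.mem_filter.1 hc).2⟩
  have hRdist : ∀ (x : MemberY θ.d₆ θ.ℓ₆ θ.hd' θ.hL' θ.b₀ θ.b₁ Mstar) (a a' b : (geo9Y x).Site), RelB x.toKIdx a a' → (geo9Y x).dist a b = (geo9Y x).dist a' b := fun x a a' b h => dist_eq_of_relB x.toKIdx h (relB_refl x.toKIdx b)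
  have hRlen : ∀ (x : MemberY θ.d₆ θ.ℓ₆ θ.hd' θ.hL' θ.b₀ θ.b₁ Mstar) (a a' : (geo9Y x).Site), RelB x.toKIdx a a' → (geo9Y x).len a = (geo9Y x).len a' := fun x a a' h => len_eq_of_relB x.toKIdx h
  have hS := fun (x : MemberY θ.d₆ θ.ℓ₆ θ.hd' θ.hL' θ.b₀ θ.b₁ Mstar) (U : (bg9Y (Matrix (Fin N) (Fin N) ℂ) (specialUnitaryUnits (Fin N)) x).Cfg) => site_coReadings4_of_pins x.toKIdx (trBasis N) (bg9Y (Matrix (Fin N) (Fin N) ℂ) (specialUnitaryUnits (Fin N)) x) (fun U => U) (lettersYOfRecordV4P N θ.toStage3Params Mstar 𝔯 x).Gp (lettersYOfRecordV4P N θ.toStage3Params Mstar 𝔯 x).parS U (hβI x) (hlev x) (hblkS x) (hblkYS x) (hGpS x U) (hDS x U) (hDsS x U) (hLapS x U)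
  have hco0 := fun x U => (hS x U).1; have hco1 := fun x U => (hS x U).2.1; have hco2 := fun x U => (hS x U).2.2.1; have hco3 := fun x U => (hS x U).2.2.2.1
  have hgl0 := fun x U => (hS x U).2.2.2.2.1; have hgl1 := fun x U => (hS x U).2.2.2.2.2.1; have hgl2 := fun x U => (hS x U).2.2.2.2.2.2.1; have hgl3 := fun x U => (hS x U).2.2.2.2.2.2.2
  have hA := fun (x : MemberY θ.d₆ θ.ℓ₆ θ.hd' θ.hL' θ.b₀ θ.b₁ Mstar) (U : (bg9Y (Matrix (Fin N) (Fin N) ℂ) (specialUnitaryUnits (Fin N)) x).Cfg) => bond_coReadings3_of_pins x.toKIdx (trBasis N) (bg9Y (Matrix (Fin N) (Fin N) ℂ) (specialUnitaryUnits (Fin N)) x) (fun U => U) (lettersYOfRecordV4P N θ.toStage3Params Mstar 𝔯 x).GA (lettersYOfRecordV4P N θ.toStage3Params Mstar 𝔯 x).parB U (hβI x) (hlev x) (hblkA x) (hblkYA x) (hGcoA x U) (hDcoA x U) (hDscoA x U)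
  have hAL := fun (x : MemberY θ.d₆ θ.ℓ₆ θ.hd' θ.hL' θ.b₀ θ.b₁ Mstar) (U : (bg9Y (Matrix (Fin N) (Fin N) ℂ) (specialUnitaryUnits (Fin N)) x).Cfg) => bond_coReadingsLap_of_pins x.toKIdx (trBasis N) (bg9Y (Matrix (Fin N) (Fin N) ℂ) (specialUnitaryUnits (Fin N)) x) (fun U => U) (lettersYOfRecordV4P N θ.toStage3Params Mstar 𝔯 x).GA (lettersYOfRecordV4P N θ.toStage3Params Mstar 𝔯 x).parB U (hβI x) (hlev x) (hblkA x) (hGcoA x U) (hLcoA x U)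
  have hcoA0 := fun x U => (hA x U).1; have hcoA1 := fun x U => (hA x U).2.1; have hcoA2 := fun x U => (hA x U).2.2.1; have hcoA3 := fun x U => (hAL x U).1
  have hglA0 := fun x U => (hA x U).2.2.2.2.2.2.1; have hglA1 := fun x U => (hA x U).2.2.2.2.2.2.2.1; have hglA2 := fun x U => (hA x U).2.2.2.2.2.2.2.2; have hglA3 := fun x U => (hAL x U).2.2
  letI hF : ∀ x : MemberY θ.d₆ θ.ℓ₆ θ.hd' θ.hL' θ.b₀ θ.b₁ Mstar, Fintype (B9GeoNormsKLevelV1.geo9K x.toKIdx).Site := fun x => (inferInstance : Fintype (geo9Y x).Site)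
  have hsymD : ∀ (x : MemberY θ.d₆ θ.ℓ₆ θ.hd' θ.hL' θ.b₀ θ.b₁ Mstar) (U : (bg9Y (Matrix (Fin N) (Fin N) ℂ) (specialUnitaryUnits (Fin N)) x).Cfg), (∀ μ z, U μ z ∈ specialUnitaryUnits (Fin N)) → IsSymmTr (fun _ => (1 : ℝ)) ((lettersYOfRecordV4P N θ.toStage3Params Mstar 𝔯 x).GD U) ∧ IsSymmTr (fun _ => (1 : ℝ)) ((lettersYOfRecordV4P N θ.toStage3Params Mstar 𝔯 x).G₁ U) ∧ IsSymmTr (fun _ => (1 : ℝ)) ((lettersYOfRecordV4P N θ.toStage3Params Mstar 𝔯 x).GG U) := lettersYOfRecordV4P_symmDG₁GG N θ.toStage3Params Mstar 𝔯 hΔ2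
  have hIR : ∀ x U, InputReadsFam ((opsYNuOfRecordV4PE N θ.toStage3Params Mstar 𝔯 (sectEYOfRecordV6 N θ.toStage3Params Mstar 𝔢₀) 𝔴 𝔈) x).Gp U (bHX x) 2 ((𝔬 x).blk ∘ Prod.fst) ((𝔭 x).blkPX ∘ Prod.fst) (fun β => sliceProbe ((𝔭 x).ΦX U β)) (evSK x.toKIdx) (familyOp fun r : Fin (θ.d₆ + 1) × Fin (θ.d₆ + 1) => (𝔡 x).Dd U r.1 ∘ₗ ((𝔬 x).Gp U ∘ₗ (𝔡 x).Dsd U r.2)) := fun x U =>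
    site_inputReadsFam_of_pinsSA x.toKIdx (trBasis N) (bg9Y (Matrix (Fin N) (Fin N) ℂ) (specialUnitaryUnits (Fin N)) x) (fun U => U) (lettersYOfRecordV4P N θ.toStage3Params Mstar 𝔯 x).Gp (lettersYOfRecordV4P N θ.toStage3Params Mstar 𝔯 x).parS U (hβI x) (hβ1 x) (h𝔭 x) (hbHX x) (hblkS x) (hGpS x U) (h𝔡d x U) (h𝔡s x U)
  have hH1 : ∀ x U, H1ReadsNbr ((opsYNuOfRecordV4PE N θ.toStage3Params Mstar 𝔯 (sectEYOfRecordV6 N θ.toStage3Params Mstar 𝔢₀) 𝔴 𝔈) x).Gp U (𝔭 x) (RelB x.toKIdx) 2 (𝔬 x).blk (𝔬 x).blkY (evSK x.toKIdx) (evSK x.toKIdx) ((𝔬 x).D U ∘ₗ (𝔬 x).Gp U) ((𝔬 x).Gp U ∘ₗ (𝔬 x).Dstar U) := fun x U => by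
    rw [h𝔭 x]; exact site_h1ReadsNbr_of_pinsSA x.toKIdx (trBasis N) (bg9Y (Matrix (Fin N) (Fin N) ℂ) (specialUnitaryUnits (Fin N)) x) (fun U => U) (lettersYOfRecordV4P N θ.toStage3Params Mstar 𝔯 x).Gp (lettersYOfRecordV4P N θ.toStage3Params Mstar 𝔯 x).parS U (hβI x) (hβ1 x) (hblkS x) (hblkYS x) (hGpS x U) (hDS x U) (hDsS x U)
  have hH1A : ∀ x U, H1ReadsNbr ((opsYNuOfRecordV4PE N θ.toStage3Params Mstar 𝔯 (sectEYOfRecordV6 N θ.toStage3Params Mstar 𝔢₀) 𝔴 𝔈) x).GA U (𝔭A x) (RelB x.toKIdx) 2 (𝔬A x).blk (𝔬A x).blkY (evBK x.toKIdx) (evBK x.toKIdx) ((𝔬A x).D U ∘ₗ (𝔬A x).G U) ((𝔬A x).G U ∘ₗ (𝔬A x).Dstar U) := fun x U => by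
    rw [h𝔭A x]; exact bond_h1ReadsNbr_of_pinsA x.toKIdx (trBasis N) (bg9Y (Matrix (Fin N) (Fin N) ℂ) (specialUnitaryUnits (Fin N)) x) (fun U => U) (lettersYOfRecordV4P N θ.toStage3Params Mstar 𝔯 x).GA (lettersYOfRecordV4P N θ.toStage3Params Mstar 𝔯 x).parB U (hβI x) (hβ1 x) (hblkA x) (hblkYA x) (hGcoA x U) (hDcoA x U) (hDscoA x U)
  have hHCN : ∀ (x : MemberY θ.d₆ θ.ℓ₆ θ.hd' θ.hL' θ.b₀ θ.b₁ Mstar) (U : (bg9Y (Matrix (Fin N) (Fin N) ℂ) (specialUnitaryUnits (Fin N)) x).Cfg), CoReadsHHolderNbr ((opsYNuOfRecordV4PE N θ.toStage3Params Mstar 𝔯 (sectEYOfRecordV6 N θ.toStage3Params Mstar 𝔢₀) 𝔴 𝔈) x).H U (θ.d₆ + 1) (𝔭A x) 2 (𝔬12 x).blkZ ((𝔬12 x).D U ∘ₗ (𝔬12 x).Hm U) ∧ CoReadsHHolderNbr ((opsYNuOfRecordV4PE N θ.toStage3Params Mstar 𝔯 (sectEYOfRecordV6 N θ.toStage3Params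 Mstar 𝔢₀) 𝔴 𝔈) x).H₁ U (θ.d₆ + 1) (𝔭A x) 2 (𝔬12 x).blkZ ((𝔬12 x).D U ∘ₗ (𝔬12 x).H1m U) := fun x U =>
    ⟨bond_coReadsHHolderNbr_of_pinsA x.toKIdx (trBasis N) (bg9Y (Matrix (Fin N) (Fin N) ℂ) (specialUnitaryUnits (Fin N)) x) (fun U => U) (lettersYOfRecordV4P N θ.toStage3Params Mstar 𝔯 x).H (lettersYOfRecordV4P N θ.toStage3Params Mstar 𝔯 x).parB U (hβ1 x) (h𝔭A x) (hblkZ12 x) (hHm12 x U) (hDco12 x U),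
      bond_coReadsHHolderNbr_of_pinsA x.toKIdx (trBasis N) (bg9Y (Matrix (Fin N) (Fin N) ℂ) (specialUnitaryUnits (Fin N)) x) (fun U => U) (lettersYOfRecordV4P N θ.toStage3Params Mstar 𝔯 x).H₁ (lettersYOfRecordV4P N θ.toStage3Params Mstar 𝔯 x).parB U (hβ1 x) (h𝔭A x) (hblkZ12 x) (hH1m12 x U) (hDco12 x U)⟩
  have hIRA : ∀ x U, InputReadsFam ((opsYNuOfRecordV4PE N θ.toStage3Params Mstar 𝔯 (sectEYOfRecordV6 N θ.toStage3Params Mstar 𝔢₀) 𝔴 𝔈) x).GA U (bHXA x) 2 ((𝔬A x).blk ∘ Prod.fst) ((𝔭A x).blkPX ∘ Prod.fst) (fun β => sliceProbe ((𝔭A x).ΦX U β)) (evBK x.toKIdx) (familyOp fun r : Fin (θ.d₆ + 1) × Fin (θ.d₆ + 1) => (𝔡A x).Dd U r.1 ∘ₗ ((𝔬A x).G U ∘ₗ (𝔡A x).Dsd U r.2)) := fun x U =>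
    bond_inputReadsFam_of_pinsA x.toKIdx (trBasis N) (bg9Y (Matrix (Fin N) (Fin N) ℂ) (specialUnitaryUnits (Fin N)) x) (fun U => U) (lettersYOfRecordV4P N θ.toStage3Params Mstar 𝔯 x).GA (lettersYOfRecordV4P N θ.toStage3Params Mstar 𝔯 x).parB U (hβI x) (hβ1 x) (h𝔭A x) (hbHXA x) (hblkA x) (hGcoA x U) (h𝔡Ad x U) (h𝔡As x U)
  have hIF : ∀ (x : MemberY θ.d₆ θ.ℓ₆ θ.hd' θ.hL' θ.b₀ θ.b₁ Mstar) (U : (bg9Y (Matrix (Fin N) (Fin N) ℂ) (specialUnitaryUnits (Fin N)) x).Cfg), InputReadsFam ((opsYNuOfRecordV4PE N θ.toStage3Params Mstar 𝔯 (sectEYOfRecordV6 N θ.toStage3Params Mstar 𝔢₀) 𝔴 𝔈) x).GD U (bHXA x) 2 ((𝔬12 x).blk ∘ Prod.fst) ((𝔭A x).blkPX ∘ Prod.fst) (fun β => sliceProbe ((𝔭A x).ΦX U β)) (evBK x.toKIdx) (familyOp fun q : Fin (θ.d₆ + 1) × Fin (θ.d₆ + 1) => (𝔡A x).Dd U q.1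 ∘ₗ ((𝔬12 x).G U ∘ₗ (𝔡A x).Dsd U q.2)) ∧
      InputReadsFam ((opsYNuOfRecordV4PE N θ.toStage3Params Mstar 𝔯 (sectEYOfRecordV6 N θ.toStage3Params Mstar 𝔢₀) 𝔴 𝔈) x).G₁ U (bHXA x) 2 ((𝔬12 x).blk ∘ Prod.fst) ((𝔭A x).blkPX ∘ Prod.fst) (fun β => sliceProbe ((𝔭A x).ΦX U β)) (evBK x.toKIdx) (familyOp fun q : Fin (θ.d₆ + 1) × Fin (θ.d₆ + 1) => (𝔡A x).Dd U q.1 ∘ₗ ((𝔬12 x).G1 U ∘ₗ (𝔡A x).Dsd U q.2)) ∧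
      InputReadsFam ((opsYNuOfRecordV4PE N θ.toStage3Params Mstar 𝔯 (sectEYOfRecordV6 N θ.toStage3Params Mstar 𝔢₀) 𝔴 𝔈) x).GG U (bHXA x) 2 ((𝔬12 x).blk ∘ Prod.fst) ((𝔭A x).blkPX ∘ Prod.fst) (fun β => sliceProbe ((𝔭A x).ΦX U β)) (evBK x.toKIdx) (familyOp fun q : Fin (θ.d₆ + 1) × Fin (θ.d₆ + 1) => (𝔡A x).Dd U q.1 ∘ₗ ((𝔬12 x).GG U ∘ₗ (𝔡A x).Dsd U q.2)) := fun x U =>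
    ⟨bond_inputReadsFam_of_pinsA x.toKIdx (trBasis N) (bg9Y (Matrix (Fin N) (Fin N) ℂ) (specialUnitaryUnits (Fin N)) x) (fun U => U) (lettersYOfRecordV4P N θ.toStage3Params Mstar 𝔯 x).GD (lettersYOfRecordV4P N θ.toStage3Params Mstar 𝔯 x).parB U (hβI x) (hβ1 x) (h𝔭A x) (hbHXA x) (hblk12 x) (hGco12 x U) (h𝔡Ad x U) (h𝔡As x U),
      bond_inputReadsFam_of_pinsA x.toKIdx (trBasis N) (bg9Y (Matrix (Fin N) (Fin N) ℂ) (specialUnitaryUnits (Fin N)) x) (fun U => U) (lettersYOfRecordV4P N θ.toStage3Params Mstar 𝔯 x).G₁ (lettersYOfRecordV4P N θ.toStage3Params Mstar 𝔯 x).parB U (hβI x) (hβ1 x) (h𝔭A x) (hbHXA x) (hblk12 x) (hG1co12 x U) (h𝔡Ad x U) (h𝔡As x U),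
      bond_inputReadsFam_of_pinsA x.toKIdx (trBasis N) (bg9Y (Matrix (Fin N) (Fin N) ℂ) (specialUnitaryUnits (Fin N)) x) (fun U => U) (lettersYOfRecordV4P N θ.toStage3Params Mstar 𝔯 x).GG (lettersYOfRecordV4P N θ.toStage3Params Mstar 𝔯 x).parB U (hβI x) (hβ1 x) (h𝔭A x) (hbHXA x) (hblk12 x) (hGGco12 x U) (h𝔡Ad x U) (h𝔡As x U)⟩
  have hH1N : ∀ (x : MemberY θ.d₆ θ.ℓ₆ θ.hd' θ.hL' θ.b₀ θ.b₁ Mstar) (U : (bg9Y (Matrix (Fin N) (Fin N) ℂ) (specialUnitaryUnits (Fin N)) x).Cfg), H1ReadsNbr ((opsYNuOfRecordV4PE N θ.toStage3Params Mstar 𝔯 (sectEYOfRecordV6 N θ.toStage3Params Mstar 𝔢₀) 𝔴 𝔈) x).GD U (𝔭A x) (RelB x.toKIdx) 2 (𝔬12 x).blk (𝔬12 x).blkY (evBK x.toKIdx) (evBK x.toKIdx) ((𝔬12 x).D U ∘ₗ (𝔬12 x).G U) ((𝔬12 x).G U ∘ₗ (𝔬12 x).Dstar U) ∧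
      H1ReadsNbr ((opsYNuOfRecordV4PE N θ.toStage3Params Mstar 𝔯 (sectEYOfRecordV6 N θ.toStage3Params Mstar 𝔢₀) 𝔴 𝔈) x).G₁ U (𝔭A x) (RelB x.toKIdx) 2 (𝔬12 x).blk (𝔬12 x).blkY (evBK x.toKIdx) (evBK x.toKIdx) ((𝔬12 x).D U ∘ₗ (𝔬12 x).G1 U) ((𝔬12 x).G1 U ∘ₗ (𝔬12 x).Dstar U) ∧
      H1ReadsNbr ((opsYNuOfRecordV4PE N θ.toStage3Params Mstar 𝔯 (sectEYOfRecordV6 N θ.toStage3Params Mstar 𝔢₀) 𝔴 𝔈) x).GG U (𝔭A x) (RelB x.toKIdx) 2 (𝔬12 x).blk (𝔬12 x).blkY (evBK x.toKIdx) (evBK x.toKIdx) ((𝔬12 x).D U ∘ₗ (𝔬12 x).GG U) ((𝔬12 x).GG U ∘ₗ (𝔬12 x).Dstar U) := fun x U => by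
    rw [h𝔭A x]; exact ⟨bond_h1ReadsNbr_of_pinsA x.toKIdx (trBasis N) (bg9Y (Matrix (Fin N) (Fin N) ℂ) (specialUnitaryUnits (Fin N)) x) (fun U => U) (lettersYOfRecordV4P N θ.toStage3Params Mstar 𝔯 x).GD (lettersYOfRecordV4P N θ.toStage3Params Mstar 𝔯 x).parB U (hβI x) (hβ1 x) (hblk12 x) (hblkY12 x) (hGco12 x U) (hDco12 x U) (hDsco12 x U),
      bond_h1ReadsNbr_of_pinsA x.toKIdx (trBasis N) (bg9Y (Matrix (Fin N) (Fin N) ℂ) (specialUnitaryUnits (Fin N)) x) (fun U => U) (lettersYOfRecordV4P N θ.toStage3Params Mstar 𝔯 x).G₁ (lettersYOfRecordV4P N θ.toStage3Params Mstar 𝔯 x).parB U (hβI x) (hβ1 x) (hblk12 x) (hblkY12 x) (hG1co12 x U) (hDco12 x U) (hDsco12 x U),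
      bond_h1ReadsNbr_of_pinsA x.toKIdx (trBasis N) (bg9Y (Matrix (Fin N) (Fin N) ℂ) (specialUnitaryUnits (Fin N)) x) (fun U => U) (lettersYOfRecordV4P N θ.toStage3Params Mstar 𝔯 x).GG (lettersYOfRecordV4P N θ.toStage3Params Mstar 𝔯 x).parB U (hβI x) (hβ1 x) (hblk12 x) (hblkY12 x) (hGGco12 x U) (hDco12 x U) (hDsco12 x U)⟩
  have hLA := fun (x : MemberY θ.d₆ θ.ℓ₆ θ.hd' θ.hL' θ.b₀ θ.b₁ Mstar) (U : (bg9Y (Matrix (Fin N) (Fin N) ℂ) (specialUnitaryUnits (Fin N)) x).Cfg) => bond_l2ReadsNbr3_of_pins x.toKIdx (trBasis N) (bg9Y (Matrix (Fin N) (Fin N) ℂ) (specialUnitaryUnits (Fin N)) x) (fun U => U) (lettersYOfRecordV4P N θ.toStage3Params Mstar 𝔯 x).GA (lettersYOfRecordV4P N θ.toStage3Params Mstar 𝔯 x).parB U (R := (1 : ℝ)) (H := H x) (hβI x) (hβ1 x) (hblkA x) (hblkYA x) (hGcoA x U) (hDcoA x U) (hDscoA x U); have hlA0 := fun x U => (hLA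 x U).1; have hlA1 := fun x U => (hLA x U).2.1; have hlA2 := fun x U => (hLA x U).2.2
  have hLA3 := fun (x : MemberY θ.d₆ θ.ℓ₆ θ.hd' θ.hL' θ.b₀ θ.b₁ Mstar) (U : (bg9Y (Matrix (Fin N) (Fin N) ℂ) (specialUnitaryUnits (Fin N)) x).Cfg) => bond_l2ReadsNbr345_of_pins x.toKIdx (trBasis N) (bg9Y (Matrix (Fin N) (Fin N) ℂ) (specialUnitaryUnits (Fin N)) x) (fun U => U) (lettersYOfRecordV4P N θ.toStage3Params Mstar 𝔯 x).GA (lettersYOfRecordV4P N θ.toStage3Params Mstar 𝔯 x).parB U (R := (1 : ℝ)) (H := H x) (hβI x) (hβ1 x) (hblkA x) (hGcoA x U) (h𝔡Ad x U) (h𝔡As x U); have hlA3 := fun x U => (hLA3 x U).1; have hlA4 := fun x U => (hLA3 x U).2.1; have hlA5 := fun x U => (hLA3 x U).2.2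
  have hLS := fun (x : MemberY θ.d₆ θ.ℓ₆ θ.hd' θ.hL' θ.b₀ θ.b₁ Mstar) (U : (bg9Y (Matrix (Fin N) (Fin N) ℂ) (specialUnitaryUnits (Fin N)) x).Cfg) => site_l2ReadsNbr012_of_pins x.toKIdx (trBasis N) (bg9Y (Matrix (Fin N) (Fin N) ℂ) (specialUnitaryUnits (Fin N)) x) (fun U => U) (lettersYOfRecordV4P N θ.toStage3Params Mstar 𝔯 x).Gp (lettersYOfRecordV4P N θ.toStage3Params Mstar 𝔯 x).parS U (R := (1 : ℝ)) (H := H x) (sIK_faithful x.toKIdx (hβI x)) (sIK_dist_le_one x.toKIdx (hβ1 x)) (hblkS x) (hblkYS x) (hGpS x U) (hDS x U) (hDsS x U); have hl0 := fun x U => (hLS x U).1; have hl1 := fun x U => (hLS x U).2.1; have hl2 := fun x U => (hLS x U).2.2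
  have hLS3 := fun (x : MemberY θ.d₆ θ.ℓ₆ θ.hd' θ.hL' θ.b₀ θ.b₁ Mstar) (U : (bg9Y (Matrix (Fin N) (Fin N) ℂ) (specialUnitaryUnits (Fin N)) x).Cfg) => site_l2ReadsNbr345_of_pins x.toKIdx (trBasis N) (bg9Y (Matrix (Fin N) (Fin N) ℂ) (specialUnitaryUnits (Fin N)) x) (fun U => U) (lettersYOfRecordV4P N θ.toStage3Params Mstar 𝔯 x).Gp (lettersYOfRecordV4P N θ.toStage3Params Mstar 𝔯 x).parS U (R := (1 : ℝ)) (H := H x) (sIK_faithful x.toKIdx (hβI x)) (sIK_dist_le_one x.toKIdx (hβ1 x)) (hblkS x) (hGpS x U) (h𝔡d x U) (h𝔡s x U); have hl3 := fun x U => (hLS3 x U).1; have hl4 := fun x U => (hLS3 x U).2.1; have hl5 := fun x U => (hLS3 x U).2.2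
  have hRd₂ : ∀ (x : MemberY θ.d₆ θ.ℓ₆ θ.hd' θ.hL' θ.b₀ θ.b₁ Mstar) (a b b' : (geo9Y x).Site), RelB x.toKIdx b b' → (geo9Y x).dist a b = (geo9Y x).dist a b' := fun x a b b' h => dist_eq_of_relB x.toKIdx (relB_refl x.toKIdx a) h
  have hsym : ∀ x : MemberY θ.d₆ θ.ℓ₆ θ.hd' θ.hL' θ.b₀ θ.b₁ Mstar, p.M₁ ≤ (geo9Y x).M → ∀ α₀ : ℝ, 0 < α₀ → c35Y * (geo9Y x).M * α₀ ≤ p.a₁ → ∀ U : (bg9Y (Matrix (Fin N) (Fin N) ℂ) (specialUnitaryUnits (Fin N)) x).Cfg, (bg9Y (Matrix (Fin N) (Fin N) ℂ) (specialUnitaryUnits (Fin N)) x).Reg335 c35Y α₀ U → IsTransposePair ((𝔬 x).Gp U) ((𝔬 x).Gp U) := fun x _ α₀ _ _ U hU => by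
    rw [hGpS x U]; exact isTransposePair_GcoS_trBasis x.toKIdx (bg9Y (Matrix (Fin N) (Fin N) ℂ) (specialUnitaryUnits (Fin N)) x) (fun U => U) (lettersYOfRecordV4P N θ.toStage3Params Mstar 𝔯 x).Gp U (GpY_isSymmTr x.toKIdx (parSymY x.toKIdx) U (symm0_parSymY x.toKIdx specialUnitaryUnits_le_unitaryUnits hU.1.1))
  have htr : ∀ x : MemberY θ.d₆ θ.ℓ₆ θ.hd' θ.hL' θ.b₀ θ.b₁ Mstar, p.M₁ ≤ (geo9Y x).M → ∀ α₀ : ℝ, 0 < α₀ → c35Y * (geo9Y x).M * α₀ ≤ p.a₁ → ∀ U : (bg9Y (Matrix (Fin N) (Fin N) ℂ) (specialUnitaryUnits (Fin N)) x).Cfg, (bg9Y (Matrix (Fin N) (Fin N) ℂ) (specialUnitaryUnits (Fin N)) x).Reg335 c35Y α₀ U → IsTransposePair ((𝔬 x).D U ∘ₗ (𝔬 x).Gp U) ((𝔬 x).Gp U ∘ₗ (𝔬 x).Dstar U) := fun x _ α₀ _ _ U hU => by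
    rw [hDS x U, hGpS x U, hDsS x U]; exact isTransposePair_DcoS_GcoS_trBasis x.toKIdx (bg9Y (Matrix (Fin N) (Fin N) ℂ) (specialUnitaryUnits (Fin N)) x) (fun U => U) (lettersYOfRecordV4P N θ.toStage3Params Mstar 𝔯 x).Gp U (GpY_isSymmTr x.toKIdx (parSymY x.toKIdx) U (symm0_parSymY x.toKIdx specialUnitaryUnits_le_unitaryUnits hU.1.1)) (fun μ z => specialUnitaryUnits_le_unitaryUnits (hU.1.1 μ z))
  have hsymA : ∀ x : MemberY θ.d₆ θ.ℓ₆ θ.hd' θ.hL' θ.b₀ θ.b₁ Mstar, q.M₁ ≤ (geo9Y x).M → ∀ α₀ : ℝ, 0 < α₀ → c35Y * (geo9Y x).M * α₀ ≤ q.a₁ → ∀ U : (bg9Y (Matrix (Fin N) (Fin N) ℂ) (specialUnitaryUnits (Fin N)) x).Cfg, (bg9Y (Matrix (Fin N) (Fin N) ℂ) (specialUnitaryUnits (Fin N)) x).Reg335 c35Y α₀ U → IsTransposePair ((𝔬A x).G U) ((𝔬A x).G U) := fun x _ α₀ _ _ U hU => by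
    rw [hGcoA x U]; exact isTransposePair_GcoK_trBasis x.toKIdx (bg9Y (Matrix (Fin N) (Fin N) ℂ) (specialUnitaryUnits (Fin N)) x) (fun U => U) (lettersYOfRecordV4P N θ.toStage3Params Mstar 𝔯 x).GA U (symmG_parSymY x.toKIdx specialUnitaryUnits_le_unitaryUnits hU.1.1)
  have htrA : ∀ x : MemberY θ.d₆ θ.ℓ₆ θ.hd' θ.hL' θ.b₀ θ.b₁ Mstar, q.M₁ ≤ (geo9Y x).M → ∀ α₀ : ℝ, 0 < α₀ → c35Y * (geo9Y x).M * α₀ ≤ q.a₁ → ∀ U : (bg9Y (Matrix (Fin N) (Fin N) ℂ) (specialUnitaryUnits (Fin N)) x).Cfg, (bg9Y (Matrix (Fin N) (Fin N) ℂ) (specialUnitaryUnits (Fin N)) x).Reg335 c35Y α₀ U → IsTransposePair ((𝔬A x).D U ∘ₗ (𝔬A x).G U) ((𝔬A x).G U ∘ₗ (𝔬A x).Dstar U) := fun x _ α₀ _ _ U hU => by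
    rw [hDcoA x U, hGcoA x U, hDscoA x U]; exact isTransposePair_DcoK_GcoK_trBasis x.toKIdx (bg9Y (Matrix (Fin N) (Fin N) ℂ) (specialUnitaryUnits (Fin N)) x) (fun U => U) (lettersYOfRecordV4P N θ.toStage3Params Mstar 𝔯 x).GA U (symmG_parSymY x.toKIdx specialUnitaryUnits_le_unitaryUnits hU.1.1) (fun μ z => specialUnitaryUnits_le_unitaryUnits (hU.1.1 μ z))
  have hgeoOK : ∀ x : MemberY θ.d₆ θ.ℓ₆ θ.hd' θ.hL' θ.b₀ θ.b₁ Mstar, GeoOK (geo9Y x) := fun x => ⟨geo9Y_dist_triangle x, geo9Y_dist_comm x, geo9K_dist_nonneg x.toKIdx, geo9Y_len_pos x⟩; have hN : 0 < N := Nat.pos_of_ne_zero (NeZero.ne N); have hcR : cR39 (trBasis N) ≠ 0 := (cR39_trBasis_pos hN).ne'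
  have hpos12 : ∀ x : MemberY θ.d₆ θ.ℓ₆ θ.hd' θ.hL' θ.b₀ θ.b₁ Mstar, M12 ≤ (geo9Y x).M → ∀ α₀ : ℝ, 0 < α₀ → (geo9Y x).M * α₀ ≤ a12 → ∀ U : (bg9Y (Matrix (Fin N) (Fin N) ℂ) (specialUnitaryUnits (Fin N)) x).Cfg, (bg9Y (Matrix (Fin N) (Fin N) ℂ) (specialUnitaryUnits (Fin N)) x).Reg335 c35Y α₀ U →
      (bg9Y (Matrix (Fin N) (Fin N) ℂ) (specialUnitaryUnits (Fin N)) x).Reg336 c35Y α₀ U → PosDefEnd ((𝔬12 x).S0 U) := fun x hM α₀ hα ha U hU _ => by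
    rw [hS0co12 x U]; exact posDefEnd_S0coK_of_posDefTr_phys x.toKIdx (bg9Y (Matrix (Fin N) (Fin N) ℂ) (specialUnitaryUnits (Fin N)) x) (fun U => U) U hN (by rw [deltaAY_GpPhysY]; exact hΔA x (hM311le.trans hM) α₀ hα (ha.trans ha12le) U hU)
  have hinv12 : ∀ x : MemberY θ.d₆ θ.ℓ₆ θ.hd' θ.hL' θ.b₀ θ.b₁ Mstar, M12 ≤ (geo9Y x).M → ∀ α₀ : ℝ, 0 < α₀ → (geo9Y x).M * α₀ ≤ a12 → ∀ U : (bg9Y (Matrix (Fin N) (Fin N) ℂ) (specialUnitaryUnits (Fin N)) x).Cfg, (bg9Y (Matrix (Fin N) (Fin N) ℂ) (specialUnitaryUnits (Fin N)) x).Reg335 c35Y α₀ U →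
      (bg9Y (Matrix (Fin N) (Fin N) ℂ) (specialUnitaryUnits (Fin N)) x).Reg336 c35Y α₀ U → (𝔬12 x).G0 U * (𝔬12 x).S0 U = 1 := fun x hM α₀ hα ha U hU _ => by
    rw [hG0co12 x U, hS0co12 x U, lettersYOfRecordV4P_GA_phys]; exact GcoK_GAY_mul_S0coK hcR (isUnit_deltaAY_phys_of_posDefTr _ (hΔA x (hM311le.trans hM) α₀ hα (ha.trans ha12le) U hU))
  have hIdOfForm : ∀ x : MemberY θ.d₆ θ.ℓ₆ θ.hd' θ.hL' θ.b₀ θ.b₁ Mstar, M12 ≤ (geo9Y x).M → ∀ α₀ : ℝ, 0 < α₀ → (geo9Y x).M * α₀ ≤ a12 → ∀ U : (bg9Y (Matrix (Fin N) (Fin N) ℂ) (specialUnitaryUnits (Fin N)) x).Cfg, (bg9Y (Matrix (Fin N) (Fin N) ℂ) (specialUnitaryUnits (Fin N)) x).Reg335 c35Y α₀ U →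
      (bg9Y (Matrix (Fin N) (Fin N) ℂ) (specialUnitaryUnits (Fin N)) x).Reg336 c35Y α₀ U → ∀ r : ℝ, r < 1 → FormSmall (𝔬12 x) r U → B9Thm312Whole.Identities (𝔬12 x) U := fun x hM α₀ hα ha U hU hU' r hr hF =>
    identities_of_def_3124 (identitiesDef_of_pins_phys x.toKIdx (bg9Y (Matrix (Fin N) (Fin N) ℂ) (specialUnitaryUnits (Fin N)) x) (fun U => U) (𝔯 x).Δ2 (𝔬12 x) U hN
      specialUnitaryUnits_le_unitaryUnits hU.1.1 (isUnit_of_posDefTr (hΔA x (hM311le.trans hM) α₀ hα (ha.trans ha12le) U hU))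
      (isUnit_deltaPiAY_of_formSmall_phys x.toKIdx (bg9Y (Matrix (Fin N) (Fin N) ℂ) (specialUnitaryUnits (Fin N)) x) (fun U => U) (𝔬12 x) U hN hF hr (hS0co12 x U) (hTpico12 x U))
      (isUnit_deltaOneY_of_formSmall_phys x.toKIdx (bg9Y (Matrix (Fin N) (Fin N) ℂ) (specialUnitaryUnits (Fin N)) x) (fun U => U) (𝔯 x).Δ2 (𝔬12 x) U hN hF hr (hS0co12 x U) (hTpico12 x U) (hT2co12 x U))
      (isUnit_QGQOfY_G1Y_recordP_of_posDefTr x.toKIdx specialUnitaryUnits_le_unitaryUnits hU.1.1 (𝔯 x).Δ2 (posDefTr_deltaOneY_of_formSmall_pins_phys x.toKIdx (bg9Y (Matrix (Fin N) (Fin N) ℂ) (specialUnitaryUnits (Fin N)) x) (fun U => U) (𝔯 x).Δ2 (𝔬12 x) U hN hF hr (hS0co12 x U) (hTpico12 x U) (hT2co12 x U)))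
      (hG0co12 x U) (hS0co12 x U) (hTpico12 x U) (hT2co12 x U) (hGco12 x U) (hG1co12 x U) (hGGco12 x U) (hQco12 x U) (hQsco12 x U) (hCco12 x U) (hC1co12 x U)
      (hHm12 x U) (hH1m12 x U) (hDvco12 x U) (hDvsco12 x U) (hRco12 x U)) (hIds3124 x hM α₀ hα ha U hU hU')
  have hNQ : ∀ x : MemberY θ.d₆ θ.ℓ₆ θ.hd' θ.hL' θ.b₀ θ.b₁ Mstar, (Fintype.card (Fin (θ.d₆ + 1)) : ℝ) ≤ ((θ.d₆ + 1 : ℕ) : ℝ) := (fun _ => by rw [Fintype.card_fin]); have h36H' := h36H_of_dir_pins (R := (1 : ℝ)) (H := H) 𝔬 𝔡 𝔭 (fun x => (lettersYOfRecordV4P N θ.toStage3Params Mstar 𝔯 x).Gp) (fun x => (lettersYOfRecordV4P N θ.toStage3Params Mstar 𝔯 x).parS) h𝔭 hblkS hblkYS hGpS hDS hDsS h𝔡d h𝔡s (h36H_of_mixed h36H (l2MixedLegs37_of_pins θ Mstar H bI hlev hβ1 𝔬 𝔡 hblkS hhS hGsqF h𝔡d h𝔡s p pM hM1mix ha1mix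 hBMmix hδmix)); have h36HA' := h36HA_of_dir_pins (R := (1 : ℝ)) (H := H) 𝔬A 𝔡A 𝔭A (fun x => (lettersYOfRecordV4P N θ.toStage3Params Mstar 𝔯 x).GA) (fun x => (lettersYOfRecordV4P N θ.toStage3Params Mstar 𝔯 x).parB) h𝔭A hblkA hblkYA hGcoA hDcoA hDscoA h𝔡Ad h𝔡As h36HA
  obtain ⟨t37', c38', t310', hsum'⟩ := rows131819_definite_geo9Y_pairM_dir (bg := (bg9Y (Matrix (Fin N) (Fin N) ℂ) (specialUnitaryUnits (Fin N)))) p q hp hq p3 q3 hp3 hq3 pM qM hpM hqM ((θ.d₆ + 1 : ℕ) : ℝ) (Nat.cast_nonneg _) c35Y_pos H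
    (fun x => RelB x.toKIdx) (2 * (θ.d₆ + 1)) (nbrCountY θ.d₆ θ.ℓ₆ θ.hd' θ.hL' θ.b₀ θ.b₁ 2) (Real.sqrt ((θ.d₆ + 1) * Fintype.card (TrIdx N))) (Real.sqrt_nonneg _) hRlen hRdist hRd₂ hmult (hnbr_two_of_le hM₀) 𝔬 rd 𝔭 𝔡 𝔩 bHX (fun x => ((opsYNuOfRecordV4PE N θ.toStage3Params Mstar 𝔯 (sectEYOfRecordV6 N θ.toStage3Params Mstar 𝔢₀) 𝔴 𝔈) x).Gp) (fun x => evSK x.toKIdx) (fun x => evSK x.toKIdx) κ SH S3 SI (fun x => SblkY x (bI x)) hst hκ hrd hloc (h36_of_dirSq_pins (R := (1 : ℝ)) (H := H) 𝔬 𝔡 hblkS hblkYS hDS hDsS h𝔡d h𝔡s (fun x U j => ⟨_, _, hGsqF x U j⟩) h36) h36H'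
    hco0 hco1 hco2 hco3 hgl0 hgl1 hgl2 hgl3 hl0 hl1 hl2 hl3 hl4 hl5 hH1 hIR hsym htr hcntH hcnt3 hNQ hcntI (hcntM_of_walkCnt bI hβ1 (fun x => SblkY x (bI x)) (fun _ => rfl) hMw hNMw) 𝔬A rdA 𝔭A 𝔡A bHXA (fun x => ((opsYNuOfRecordV4PE N θ.toStage3Params Mstar 𝔯 (sectEYOfRecordV6 N θ.toStage3Params Mstar 𝔢₀) 𝔴 𝔈) x).GA) (fun x => evBK x.toKIdx) (fun x => evBK x.toKIdx)
    κA SHA S3A SIA SMA hstA hκA hrdA hlocA h36A h36HA' hcoA0 hcoA1 hcoA2 hcoA3 hglA0 hglA1 hglA2 hglA3 hlA0 hlA1 hlA2 hlA3 hlA4 hlA5 hH1A hIRA hsymA htrA hcntHA hcnt3A hNQ hcntIA hcntMA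
  obtain ⟨M31, a31, hM31, ha31, h31⟩ := thm31GpMaj_of_t37_pairM (trBasis N) (lettersYOfRecordV4P N θ.toStage3Params Mstar 𝔯) 𝔬 rd H hp t37' hbI0 hblkS hblkYS hGpS hDS hDsS
  have hδ39 : 0 < δ39 := hr39.trans_le hrδ39; have hθ49 : 0 < min ((1 - 2 * p.α) * p.δ₀) δ39 / 8 := (by have := lt_min (PinPrims.rate_pos hp) hδ39; positivity); have hrT0 : rT ≤ (1 - 2 * p.α) * p.δ₀ := hrTP.trans (by have h1 := min_le_left ((1 - 2 * p.α) * p.δ₀) δ39; linarith only [h1, hθ49]); obtain ⟨M3r, Cgr, -, hCgr, hthr⟩ := B9Ineq349SiteThresholdRate.exists_threshold_349_rate (d := θ.d₆) (ℓ := θ.ℓ₆) (hd := θ.hd') (hL := θ.hL') (b₀ := θ.b₀) (b₁ := θ.b₁) (PinPrims.rate_pos hp) hδ39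
  obtain ⟨M49, a49, CP, hM49, ha49, hCP, h49⟩ := proj349Maj_of_t37_display348_rate θ.toStage3Params Mstar (lettersYOfRecordV4P N θ.toStage3Params Mstar 𝔯) (fun _ => rfl) (fun _ => rfl) (trBasis N) (cR39_trBasis_pos hN) c35Y_pos hbI0 hlev hβ1 (hnbr_two_of_le hM₀) 𝔬 rd H hp t37' hblkS hblkYS hGpS hDS hB39.le hδ39 ha39 h348 (min ((1 - 2 * p.α) * p.δ₀) δ39 / 8) Cgr M3r hθ49.le hCgr.le (fun i hM parS Gp U B₀ B₁' hB₀ hB₁' => hthr i hM parS Gp U hB₀ hB₁')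
  have hδTr2 : δT12 + 2 * σS + 3 * (q.αF * ((1 - 2 * q.α) * q.δ₀)) ≤ rT := (by linarith only [hδTr, hσS]); set M46c : ℝ := M46 θ.d₆ θ.ℓ₆ θ.hd' θ.hL' θ.b₀ θ.b₁ Mstar N c35Y c35Y_pos with hM46cdef; set a46c : ℝ := a46 θ.d₆ θ.ℓ₆ θ.hd' θ.hL' θ.b₀ θ.b₁ Mstar N c35Y c35Y_pos with ha46cdef; set B₄ : ℝ := B46 θ.d₆ θ.ℓ₆ θ.hd' θ.hL' θ.b₀ θ.b₁ Mstar N c35Y c35Y_pos with hB₄def; set δ₄ : ℝ := δ46 θ.d₆ θ.ℓ₆ θ.hd' θ.hL' θ.b₀ θ.b₁ Mstar N c35Y c35Y_pos with hδ₄def; have hM46c : 0 < M46c := M46_pos θ.d₆ θ.ℓ₆ θ.hd' θ.hL' θ.b₀ θ.b₁ Mstar N c35Y c35Y_pos; have ha46c : 0 < a46c := a46_pos θ.d₆ θ.ℓ₆ θ.hd' θ.hL' θ.b₀ θ.b₁ Mstar N c35Y c35Y_pos; have hB₄ : 0 ≤ B₄ := (B46_pos θ.d₆ θ.ℓ₆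 θ.hd' θ.hL' θ.b₀ θ.b₁ Mstar N c35Y c35Y_pos).le; have h46 : ∀ x : MemberY θ.d₆ θ.ℓ₆ θ.hd' θ.hL' θ.b₀ θ.b₁ Mstar, max M12 M46c ≤ (geo9Y x).M → ∀ α₀ : ℝ, 0 < α₀ → (geo9Y x).M * α₀ ≤ min a12 a46c → ∀ U : (bg9Y (Matrix (Fin N) (Fin N) ℂ) (specialUnitaryUnits (Fin N)) x).Cfg, (bg9Y (Matrix (Fin N) (Fin N) ℂ) (specialUnitaryUnits (Fin N)) x).Reg335 c35Y α₀ U → B9SectDL2Decay.BlockBd (g := toB6 (geo9Y x) 1 (H x)) (𝔬12 x).blk (𝔬12 x).blk (DvcoKH x.toKIdx (trBasis N) (bg9Y (Matrix (Fin N) (Fin N) ℂ) (specialUnitaryUnits (Fin N)) x) (fun U => U) U ∘ₗ GcoS x.toKIdx (trBasis N) (bg9Y (Matrix (Fin N) (Fin N) ℂ) (specialUnitaryUnits (Fin N)) x) (fun U => U) (GpY x.toKIdx (parSymY x.toKIdx)) U ∘ₗ DvscoKH x.toKIdx (trBasis N) (bg9Y (Matrix (Fin N) (Fin N) ℂ)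 (specialUnitaryUnits (Fin N)) x) (fun U => U) U) (fun (y y' : (geo9Y x).Site) => B₄ * Real.exp (-(δ₄ * (geo9Y x).dist y y'))) := fun x hM α₀ hα ha U hU => by rw [hblk12 x]; exact blockBd_DvGcoSDvs_memberY_at θ.d₆ θ.ℓ₆ θ.hd' θ.hL' θ.b₀ θ.b₁ Mstar N c35Y c35Y_pos B7Prop2SpecialUnitary.specialUnitaryUnits_le_unitaryUnits x ((le_max_right _ _).trans hM) α₀ hα (ha.trans (min_le_right _ _)) U hU (hlev x) (hβ1 x) 1 (H x)
  set tT : ℝ := max t12 (2 * const3131 (cR39 (trBasis N))⁻¹ (((θ.d₆ + 1 : ℕ) : ℝ) * p.C (B9RWSums347DefiniteFaces.exp261 (@geo9Y θ.d₆ θ.ℓ₆ θ.hd' θ.hL' θ.b₀ θ.b₁ Mstar) p.δ₀ p.α)) CP (rowConst261 (@geo9Y θ.d₆ θ.ℓ₆ θ.hd' θ.hL' θ.b₀ θ.b₁ Mstar) σS) ((θ.ℓ₆ + 1 : ℕ) : ℝ) * tJ) with htTdef; have ht12c : 2 * const3131 (cR39 (trBasis N))⁻¹ (((θ.d₆ +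 1 : ℕ) : ℝ) * p.C (B9RWSums347DefiniteFaces.exp261 (@geo9Y θ.d₆ θ.ℓ₆ θ.hd' θ.hL' θ.b₀ θ.b₁ Mstar) p.δ₀ p.α)) CP (rowConst261 (@geo9Y θ.d₆ θ.ℓ₆ θ.hd' θ.hL' θ.b₀ θ.b₁ Mstar) σS) ((θ.ℓ₆ + 1 : ℕ) : ℝ) * tJ ≤ tT := le_max_right _ _; have ht12T : 0 ≤ tT := ht12.trans (le_max_left _ _); have ht12le : t12 ≤ tT := le_max_left _ _
  obtain ⟨MLT, hT4⟩ := split_majorants_of_letter_schemas (N := N) q hq H 𝔬12 (((θ.d₆ + 1 : ℕ) : ℝ) * p.C (B9RWSums347DefiniteFaces.exp261 (@geo9Y θ.d₆ θ.ℓ₆ θ.hd' θ.hL' θ.b₀ θ.b₁ Mstar) p.δ₀ p.α)) ((1 - 2 * p.α) * p.δ₀) CP (min ((1 - 2 * p.α) * p.δ₀) δ39 / 8) tJ δB rT δT12 σS tT (max (max (max M12 M46c) M31) M49) (min (min (min a12 a46c) a31) a49)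
    (mul_nonneg (Nat.cast_nonneg _) (PinPrims.C_nonneg hp _)) hCP htJ hσS (lt_max_of_lt_left (lt_max_of_lt_left (lt_max_of_lt_left hM12))) hrT0 hrTP hrTB hδT12 hδTr2 ht12c
    (fun x hM α₀ hα ha U hU _ => by rw [hblkW12 x, hblk12 x]; exact h31 x ((le_max_right _ _).trans ((le_max_left _ _).trans hM)) α₀ hα (ha.trans ((min_le_left _ _).trans (min_le_right _ _))) U hU)
    (fun x hM α₀ hα ha U hU _ => by rw [hblkW12 x, hblk12 x]; exact h49 x ((le_max_right _ _).trans hM) α₀ hα (ha.trans (min_le_right _ _)) U hU) (fun x hM α₀ hα ha U hU hU' => hBJ x ((le_max_left _ _).trans ((le_max_left _ _).trans ((le_max_left _ _).trans hM))) α₀ hα (ha.trans (((min_le_left _ _).trans (min_le_left _ _)).trans (min_le_left _ _))) U hU hU')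
  obtain ⟨ML2, hS2⟩ := stepL2_of_letter_schemas_residual (N := N) q hq H 𝔬12 (fun x => (𝔯 x).Δ2) (((θ.d₆ + 1 : ℕ) : ℝ) * p.C (B9RWSums347DefiniteFaces.exp261 (@geo9Y θ.d₆ θ.ℓ₆ θ.hd' θ.hL' θ.b₀ θ.b₁ Mstar) p.δ₀ p.α)) ((1 - 2 * p.α) * p.δ₀) CP (min ((1 - 2 * p.α) * p.δ₀) δ39 / 8) tJ δB B₄ δ₄ rT δT12 σS (constL2 (cR39 (trBasis N))⁻¹ (((θ.d₆ + 1 : ℕ) : ℝ) * p.C (B9RWSums347DefiniteFaces.exp261 (@geo9Y θ.d₆ θ.ℓ₆ θ.hd' θ.hL' θ.b₀ θ.b₁ Mstar) p.δ₀ p.α)) CP B₄ (rowConst261 (@geo9Y θ.d₆ θ.ℓ₆ θ.hd' θ.hL' θ.b₀ θ.b₁ Mstar) σS) ((θ.ℓ₆ + 1 : ℕ) : ℝ) * tJ) θ₂ δ₂ (θ₂ * constL2Pi (cR39 (trBasis N))⁻¹ (((θ.d₆ + 1 : ℕ) : ℝ) * p.C (B9RWSums347DefiniteFaces.exp261 (@geo9Y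 θ.d₆ θ.ℓ₆ θ.hd' θ.hL' θ.b₀ θ.b₁ Mstar) p.δ₀ p.α)) CP B₄ (rowConst261 (@geo9Y θ.d₆ θ.ℓ₆ θ.hd' θ.hL' θ.b₀ θ.b₁ Mstar) σS) ((θ.ℓ₆ + 1 : ℕ) : ℝ)) (max (max (max M12 M46c) M31) M49) (min (min (min a12 a46c) a31) a49) (mul_nonneg (Nat.cast_nonneg _) (PinPrims.C_nonneg hp _)) hCP htJ hB₄ hθ₂ hσS (lt_max_of_lt_left (lt_max_of_lt_left (lt_max_of_lt_left hM12))) hrT0 hrTP hrTB hrT4 hrT2 hδT12 hδTr le_rfl le_rfl hTpico12 hT2co12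
    (fun x hM α₀ hα ha U hU _ => by rw [hblkW12 x, hblk12 x]; exact h31 x ((le_max_right _ _).trans ((le_max_left _ _).trans hM)) α₀ hα (ha.trans ((min_le_left _ _).trans (min_le_right _ _))) U hU) (fun x hM α₀ hα ha U hU _ => h46 x ((le_max_left _ _).trans ((le_max_left _ _).trans hM)) α₀ hα (ha.trans ((min_le_left _ _).trans (min_le_left _ _))) U hU)
    (fun x hM α₀ hα ha U hU _ => by rw [hblkW12 x, hblk12 x]; exact h49 x ((le_max_right _ _).trans hM) α₀ hα (ha.trans (min_le_right _ _)) U hU) (fun x hM α₀ hα ha U hU hU' => hBJ x ((le_max_left _ _).trans ((le_max_left _ _).trans ((le_max_left _ _).trans hM))) α₀ hα (ha.trans (((min_le_left _ _).trans (min_le_left _ _)).trans (min_le_left _ _))) U hU hU') (fun x hM α₀ hα ha U hU hU' => B9PerturbationL2Delta2.blockBd_d2coK_of_sup_symm x.toKIdx _ _ _ (hgeoOK x) (mul_nonneg hθ₂ (mul_nonneg (B9GeoLemma21KLevelV1.geo9K_M_nonneg x.toKIdx) hα.le)) (hD2sup x ((le_max_left _ _).trans ((le_max_left _ _).trans ((le_max_left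 _ _).trans hM))) α₀ hα (ha.trans (((min_le_left _ _).trans (min_le_left _ _)).trans (min_le_left _ _))) U hU hU') (hΔ2 x U hU.1.1))
  set θ2S : ℝ := constL2 (cR39 (trBasis N))⁻¹ (((θ.d₆ + 1 : ℕ) : ℝ) * p.C (B9RWSums347DefiniteFaces.exp261 (@geo9Y θ.d₆ θ.ℓ₆ θ.hd' θ.hL' θ.b₀ θ.b₁ Mstar) p.δ₀ p.α)) CP B₄ (rowConst261 (@geo9Y θ.d₆ θ.ℓ₆ θ.hd' θ.hL' θ.b₀ θ.b₁ Mstar) σS) ((θ.ℓ₆ + 1 : ℕ) : ℝ) * tJ + θ₂ * constL2Pi (cR39 (trBasis N))⁻¹ (((θ.d₆ + 1 : ℕ) : ℝ) * p.C (B9RWSums347DefiniteFaces.exp261 (@geo9Y θ.d₆ θ.ℓ₆ θ.hd' θ.hL' θ.b₀ θ.b₁ Mstar) p.δ₀ p.α)) CP B₄ (rowConst261 (@geo9Y θ.d₆ θ.ℓ₆ θ.hd' θ.hL' θ.b₀ θ.b₁ Mstar) σS) ((θ.ℓ₆ + 1 : ℕ) : ℝ) with hθ2Sdef; have hθ2S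 : 0 ≤ θ2S := add_nonneg (mul_nonneg (constL2_nonneg (inv_nonneg.2 (cR39_trBasis_pos hN).le) (mul_nonneg (Nat.cast_nonneg _) (PinPrims.C_nonneg hp _)) hCP hB₄ (B9RowSum261DefiniteFaces.rowConst261_nonneg _ _) (Nat.cast_nonneg _)) htJ) (mul_nonneg hθ₂ (constL2Pi_nonneg _ _ _ _ _ _))
  set M12T : ℝ := max (max (max (max (max M12 M46c) M31) M49) ML2) MLT with hM12Tdef; set a12T : ℝ := min (min (min a12 a46c) a31) a49 with ha12Tdef; have hM12T : M12 ≤ M12T := ((((le_max_left M12 M46c).trans (le_max_left _ M31)).trans (le_max_left _ M49)).trans (le_max_left _ ML2)).trans (le_max_left _ MLT); have ha12T : a12T ≤ a12 := ((min_le_left _ _).trans (min_le_left _ _)).trans (min_le_left _ _); have hM12Tpos : 0 < M12T := lt_of_lt_of_le hM12 hM12T; have ha12Tpos : 0 < a12T := lt_min (lt_min (lt_min ha12 ha46c) ha31) ha49; have kle : ∀ x : MemberY θ.d₆ θ.ℓ₆ θ.hd' θ.hL' θ.b₀ θ.b₁ Mstar, M12T ≤ (geo9Y x).M → ∀ α₀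 : ℝ, 0 < α₀ → ∀ a a' : (geo9Y x).Site, t12 * ((geo9Y x).M * α₀) * Real.exp (-(δT12 * (geo9Y x).dist a a')) ≤ tT * ((geo9Y x).M * α₀) * Real.exp (-(δT12 * (geo9Y x).dist a a')) := fun x hM α₀ hα a a' => mul_le_mul_of_nonneg_right (mul_le_mul_of_nonneg_right ht12le (mul_nonneg (hM12Tpos.le.trans hM) hα.le)) (Real.exp_nonneg _)
  have hta := fun (x : MemberY θ.d₆ θ.ℓ₆ θ.hd' θ.hL' θ.b₀ θ.b₁ Mstar) (hM : M12T ≤ (geo9Y x).M) (α₀ : ℝ) (hα : 0 < α₀) (ha : (geo9Y x).M * α₀ ≤ a12T) (U : (bg9Y (Matrix (Fin N) (Fin N) ℂ) (specialUnitaryUnits (Fin N)) x).Cfg) (hU : (bg9Y (Matrix (Fin N) (Fin N) ℂ) (specialUnitaryUnits (Fin N)) x).Reg335 c35Y α₀ U) (hU' : (bg9Y (Matrix (Fin N) (Fin N) ℂ) (specialUnitaryUnits (Fin N)) x).Reg336 c35Y α₀ U) => (hT4 x ((le_max_right (max (max (max (max M12 M46c) M31) M49) ML2) MLT).trans hM)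 ((le_max_left (max (max (max M12 M46c) M31) M49) ML2).trans ((le_max_left (max (max (max (max M12 M46c) M31) M49) ML2) MLT).trans hM)) α₀ hα ha U hU hU').1
  have htb := fun (x : MemberY θ.d₆ θ.ℓ₆ θ.hd' θ.hL' θ.b₀ θ.b₁ Mstar) (hM : M12T ≤ (geo9Y x).M) (α₀ : ℝ) (hα : 0 < α₀) (ha : (geo9Y x).M * α₀ ≤ a12T) (U : (bg9Y (Matrix (Fin N) (Fin N) ℂ) (specialUnitaryUnits (Fin N)) x).Cfg) (hU : (bg9Y (Matrix (Fin N) (Fin N) ℂ) (specialUnitaryUnits (Fin N)) x).Reg335 c35Y α₀ U) (hU' : (bg9Y (Matrix (Fin N) (Fin N) ℂ) (specialUnitaryUnits (Fin N)) x).Reg336 c35Y α₀ U) => (hT4 x ((le_max_right (max (max (max (max M12 M46c) M31) M49) ML2) MLT).trans hM) ((le_max_left (max (max (max M12 M46c) M31) M49) ML2).trans ((le_max_left (max (max (max (max M12 M46c) M31) M49) ML2) MLT).trans hM)) α₀ hα ha U hU hU').2.1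
  have htaR := fun (x : MemberY θ.d₆ θ.ℓ₆ θ.hd' θ.hL' θ.b₀ θ.b₁ Mstar) (hM : M12T ≤ (geo9Y x).M) (α₀ : ℝ) (hα : 0 < α₀) (ha : (geo9Y x).M * α₀ ≤ a12T) (U : (bg9Y (Matrix (Fin N) (Fin N) ℂ) (specialUnitaryUnits (Fin N)) x).Cfg) (hU : (bg9Y (Matrix (Fin N) (Fin N) ℂ) (specialUnitaryUnits (Fin N)) x).Reg335 c35Y α₀ U) (hU' : (bg9Y (Matrix (Fin N) (Fin N) ℂ) (specialUnitaryUnits (Fin N)) x).Reg336 c35Y α₀ U) => (hT4 x ((le_max_right (max (max (max (max M12 M46c) M31) M49) ML2) MLT).trans hM) ((le_max_left (max (max (max M12 M46c) M31) M49) ML2).trans ((le_max_left (max (max (max (max M12 M46c) M31) M49) ML2) MLT).trans hM)) α₀ hα ha U hU hU').2.2.1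
  have htbR := fun (x : MemberY θ.d₆ θ.ℓ₆ θ.hd' θ.hL' θ.b₀ θ.b₁ Mstar) (hM : M12T ≤ (geo9Y x).M) (α₀ : ℝ) (hα : 0 < α₀) (ha : (geo9Y x).M * α₀ ≤ a12T) (U : (bg9Y (Matrix (Fin N) (Fin N) ℂ) (specialUnitaryUnits (Fin N)) x).Cfg) (hU : (bg9Y (Matrix (Fin N) (Fin N) ℂ) (specialUnitaryUnits (Fin N)) x).Reg335 c35Y α₀ U) (hU' : (bg9Y (Matrix (Fin N) (Fin N) ℂ) (specialUnitaryUnits (Fin N)) x).Reg336 c35Y α₀ U) => (hT4 x ((le_max_right (max (max (max (max M12 M46c) M31) M49) ML2) MLT).trans hM) ((le_max_left (max (max (max M12 M46c) M31) M49) ML2).trans ((le_max_left (max (max (max (max M12 M46c) M31) M49) ML2) MLT).trans hM)) α₀ hα ha U hU hU').2.2.2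
  have hL3131H' : ∀ x : MemberY θ.d₆ θ.ℓ₆ θ.hd' θ.hL' θ.b₀ θ.b₁ Mstar, M12T ≤ (geo9Y x).M → ∀ α₀ : ℝ, 0 < α₀ → (geo9Y x).M * α₀ ≤ a12T → ∀ U : (bg9Y (Matrix (Fin N) (Fin N) ℂ) (specialUnitaryUnits (Fin N)) x).Cfg, (bg9Y (Matrix (Fin N) (Fin N) ℂ) (specialUnitaryUnits (Fin N)) x).Reg335 c35Y α₀ U → (bg9Y (Matrix (Fin N) (Fin N) ℂ) (specialUnitaryUnits (Fin N)) x).Reg336 c35Y α₀ U → Letters3131H (𝔬12 x) (TbLcoKH x.toKIdx (trBasis N) (bg9Y (Matrix (Fin N) (Fin N) ℂ) (specialUnitaryUnits (Fin N)) x) (fun U => U) (parSymY x.toKIdx) (GpPhysY x.toKIdx (parSymY x.toKIdx))) (Tb2LcoKH x.toKIdx (trBasis N) (bg9Y (Matrix (Fin N) (Fin N) ℂ) (specialUnitaryUnits (Fin N)) x) (fun U => U) (parSymY x.toKIdx) (GpPhysY x.toKIdx (parSymY x.toKIdx)) (𝔯 x).Δ2) 1 (H x) (fun y => (geo9Y_len_pos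 x y).le) (bH13 x) (tT * ((geo9Y x).M * α₀)) δT12 U := fun x hM α₀ hα ha U hU hU' => ⟨(hL3131H x (hM12T.trans hM) α₀ hα (ha.trans ha12T) U hU hU').tbH.mono (kle x hM α₀ hα), (hL3131H x (hM12T.trans hM) α₀ hα (ha.trans ha12T) U hU hU').tb₂H.mono (kle x hM α₀ hα)⟩
  have hKT : δK12 ≤ δT12 := (by have hτ : 0 ≤ q.αF * ((1 - 2 * q.α) * q.δ₀) := mul_nonneg hq.αF_pos.le (mul_nonneg (by linarith only [hq.α_lt]) hq.δ₀_pos.le); linarith only [hδKS, hρST, hτ]); have hstepL2 : ∀ x : MemberY θ.d₆ θ.ℓ₆ θ.hd' θ.hL' θ.b₀ θ.b₁ Mstar, M12T ≤ (geo9Y x).M → ∀ α₀ : ℝ, 0 < α₀ → (geo9Y x).M * α₀ ≤ a12T → ∀ U : (bg9Y (Matrix (Fin N) (Fin N) ℂ) (specialUnitaryUnits (Fin N)) x).Cfg, (bg9Y (Matrix (Fin N) (Fin N) ℂ) (specialUnitaryUnits (Fin N)) x).Reg335 c35Y α₀ U → (bg9Y (Matrix (Fin N) (Fin N) ℂ)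 (specialUnitaryUnits (Fin N)) x).Reg336 c35Y α₀ U → StepL2 (𝔬12 x) 1 (H x) (θ2S * ((geo9Y x).M * α₀)) δK12 U := fun x hM α₀ hα ha U hU hU' =>
    (fun (h : StepL2 (𝔬12 x) 1 (H x) (θ2S * ((geo9Y x).M * α₀)) δT12 U) (hk : ∀ y y' : (geo9Y x).Site, θ2S * ((geo9Y x).M * α₀) * ((geo9Y x).len y)⁻¹ * ((geo9Y x).len y')⁻¹ * Real.exp (-(δT12 * (geo9Y x).dist y y')) ≤ θ2S * ((geo9Y x).M * α₀) * ((geo9Y x).len y)⁻¹ * ((geo9Y x).len y')⁻¹ * Real.exp (-(δK12 * (geo9Y x).dist y y'))) => (⟨h.t.mono hk, h.t1.mono hk⟩ : StepL2 (𝔬12 x) 1 (H x) (θ2S * ((geo9Y x).M * α₀)) δK12 U)) (hS2 x ((le_max_right (max (max (max M12 M46c) M31) M49) ML2).trans ((le_max_left (max (max (max (max M12 M46c) M31) M49) ML2) MLT).trans hM)) ((le_max_left (max (max (max M12 M46c) M31) M49) ML2).trans ((le_max_left (max (max (max (max M12 M46c) M31) M49) ML2) MLT).trans hM)) α₀ hα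 ha U hU hU') (fun y y' => mul_le_mul_of_nonneg_left (Real.exp_le_exp.2 (neg_le_neg (mul_le_mul_of_nonneg_right hKT (geo9K_dist_nonneg x.toKIdx y y')))) (mul_nonneg (mul_nonneg (mul_nonneg hθ2S (mul_nonneg (hM12Tpos.le.trans hM) hα.le)) (inv_nonneg.2 (geo9Y_len_pos x y).le)) (inv_nonneg.2 (geo9Y_len_pos x y').le)))
  let TaL : ∀ x : MemberY θ.d₆ θ.ℓ₆ θ.hd' θ.hL' θ.b₀ θ.b₁ Mstar, (bg9Y (Matrix (Fin N) (Fin N) ℂ) (specialUnitaryUnits (Fin N)) x).Cfg → Module.End ℝ (XBK (TrIdx N) x.toKIdx → ℝ) := fun x => TaLcoK x.toKIdx (trBasis N) (bg9Y (Matrix (Fin N) (Fin N) ℂ) (specialUnitaryUnits (Fin N)) x) (fun U => U) (parSymY x.toKIdx) (GpPhysY x.toKIdx (parSymY x.toKIdx)); let Ta2L : ∀ x : MemberY θ.d₆ θ.ℓ₆ θ.hd' θ.hL' θ.b₀ θ.b₁ Mstar, (bg9Y (Matrix (Fin N) (Fin N) ℂ) (specialUnitaryUnits (Fin N)) x).Cfg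 → Module.End ℝ (XBK (TrIdx N) x.toKIdx → ℝ) := fun x => Ta2LcoK x.toKIdx (trBasis N) (bg9Y (Matrix (Fin N) (Fin N) ℂ) (specialUnitaryUnits (Fin N)) x) (fun U => U) (parSymY x.toKIdx) (GpPhysY x.toKIdx (parSymY x.toKIdx)) (𝔯 x).Δ2
  let TbL : ∀ x : MemberY θ.d₆ θ.ℓ₆ θ.hd' θ.hL' θ.b₀ θ.b₁ Mstar, (bg9Y (Matrix (Fin N) (Fin N) ℂ) (specialUnitaryUnits (Fin N)) x).Cfg → (XBK (TrIdx N) x.toKIdx → ℝ) →ₗ[ℝ] (XSK (TrIdx N) x.toKIdx → ℝ) := fun x => TbLcoKH x.toKIdx (trBasis N) (bg9Y (Matrix (Fin N) (Fin N) ℂ) (specialUnitaryUnits (Fin N)) x) (fun U => U) (parSymY x.toKIdx) (GpPhysY x.toKIdx (parSymY x.toKIdx)); let Tb2L : ∀ x : MemberY θ.d₆ θ.ℓ₆ θ.hd' θ.hL' θ.b₀ θ.b₁ Mstar, (bg9Y (Matrix (Fin N) (Fin N) ℂ) (specialUnitaryUnits (Fin N)) x).Cfg → (XBK (TrIdx N)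 x.toKIdx → ℝ) →ₗ[ℝ] (XSK (TrIdx N) x.toKIdx → ℝ) := fun x => Tb2LcoKH x.toKIdx (trBasis N) (bg9Y (Matrix (Fin N) (Fin N) ℂ) (specialUnitaryUnits (Fin N)) x) (fun U => U) (parSymY x.toKIdx) (GpPhysY x.toKIdx (parSymY x.toKIdx)) (𝔯 x).Δ2
  let TaR : ∀ x : MemberY θ.d₆ θ.ℓ₆ θ.hd' θ.hL' θ.b₀ θ.b₁ Mstar, (bg9Y (Matrix (Fin N) (Fin N) ℂ) (specialUnitaryUnits (Fin N)) x).Cfg → Module.End ℝ (XBK (TrIdx N) x.toKIdx → ℝ) := fun x => TaRcoK x.toKIdx (trBasis N) (bg9Y (Matrix (Fin N) (Fin N) ℂ) (specialUnitaryUnits (Fin N)) x) (fun U => U) (parSymY x.toKIdx) (GpPhysY x.toKIdx (parSymY x.toKIdx)); let Ta2R : ∀ x : MemberY θ.d₆ θ.ℓ₆ θ.hd' θ.hL' θ.b₀ θ.b₁ Mstar, (bg9Y (Matrix (Fin N) (Fin N) ℂ) (specialUnitaryUnits (Fin N)) x).Cfg → Module.End ℝ (XBK (TrIdx N) x.toKIdx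 → ℝ) := fun x => Ta2RcoK x.toKIdx (trBasis N) (bg9Y (Matrix (Fin N) (Fin N) ℂ) (specialUnitaryUnits (Fin N)) x) (fun U => U) (parSymY x.toKIdx) (GpPhysY x.toKIdx (parSymY x.toKIdx)) (𝔯 x).Δ2
  let TbR : ∀ x : MemberY θ.d₆ θ.ℓ₆ θ.hd' θ.hL' θ.b₀ θ.b₁ Mstar, (bg9Y (Matrix (Fin N) (Fin N) ℂ) (specialUnitaryUnits (Fin N)) x).Cfg → (XSK (TrIdx N) x.toKIdx → ℝ) →ₗ[ℝ] (XBK (TrIdx N) x.toKIdx → ℝ) := fun x => TbRcoKH x.toKIdx (trBasis N) (bg9Y (Matrix (Fin N) (Fin N) ℂ) (specialUnitaryUnits (Fin N)) x) (fun U => U) (parSymY x.toKIdx) (GpPhysY x.toKIdx (parSymY x.toKIdx)); let Tb2R : ∀ x : MemberY θ.d₆ θ.ℓ₆ θ.hd' θ.hL' θ.b₀ θ.b₁ Mstar, (bg9Y (Matrix (Fin N) (Fin N) ℂ) (specialUnitaryUnits (Fin N)) x).Cfg → (XSK (TrIdx N) x.toKIdx → ℝ) →ₗ[ℝ] (XBK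 (TrIdx N) x.toKIdx → ℝ) := fun x => Tb2RcoKH x.toKIdx (trBasis N) (bg9Y (Matrix (Fin N) (Fin N) ℂ) (specialUnitaryUnits (Fin N)) x) (fun U => U) (parSymY x.toKIdx) (GpPhysY x.toKIdx (parSymY x.toKIdx)) (𝔯 x).Δ2
  have hL3131 : ∀ x : MemberY θ.d₆ θ.ℓ₆ θ.hd' θ.hL' θ.b₀ θ.b₁ Mstar, M12T ≤ (geo9Y x).M → ∀ α₀ : ℝ, 0 < α₀ → (geo9Y x).M * α₀ ≤ a12T → ∀ U : (bg9Y (Matrix (Fin N) (Fin N) ℂ) (specialUnitaryUnits (Fin N)) x).Cfg, (bg9Y (Matrix (Fin N) (Fin N) ℂ) (specialUnitaryUnits (Fin N)) x).Reg335 c35Y α₀ U → (bg9Y (Matrix (Fin N) (Fin N) ℂ) (specialUnitaryUnits (Fin N)) x).Reg336 c35Y α₀ U → Letters3131 (𝔬12 x) (TaL x) (Ta2L x) (TbL x) (Tb2L x) 1 (H x) (fun y => (geo9Y_len_pos x y).le) (tT * ((geo9Y x).M * α₀)) δT12 U := fun x hM α₀ hα ha U hU hU' =>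
    letters3131_of_pins_of_maj x.toKIdx (trBasis N) (bg9Y (Matrix (Fin N) (Fin N) ℂ) (specialUnitaryUnits (Fin N)) x) (fun U => U) (parSymY x.toKIdx) (GpPhysY x.toKIdx (parSymY x.toKIdx)) (𝔯 x).Δ2 (𝔬12 x) U (hTpico12 x U) (hT2co12 x U) (hDvco12 x U) (hta x hM α₀ hα ha U hU hU') (htb x hM α₀ hα ha U hU hU') ((hta₂ x (hM12T.trans hM) α₀ hα (ha.trans ha12T) U hU hU').mono (kle x hM α₀ hα)) ((htb₂ x (hM12T.trans hM) α₀ hα (ha.trans ha12T) U hU hU').mono (kle x hM α₀ hα))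
  have hR3131 : ∀ x : MemberY θ.d₆ θ.ℓ₆ θ.hd' θ.hL' θ.b₀ θ.b₁ Mstar, M12T ≤ (geo9Y x).M → ∀ α₀ : ℝ, 0 < α₀ → (geo9Y x).M * α₀ ≤ a12T → ∀ U : (bg9Y (Matrix (Fin N) (Fin N) ℂ) (specialUnitaryUnits (Fin N)) x).Cfg, (bg9Y (Matrix (Fin N) (Fin N) ℂ) (specialUnitaryUnits (Fin N)) x).Reg335 c35Y α₀ U → (bg9Y (Matrix (Fin N) (Fin N) ℂ) (specialUnitaryUnits (Fin N)) x).Reg336 c35Y α₀ U → Letters3131R (𝔬12 x) (TaR x) (Ta2R x) (TbR x) (Tb2R x) 1 (H x) (fun y => (geo9Y_len_pos x y).le) (tT * ((geo9Y x).M * α₀)) δT12 U := fun x hM α₀ hα ha U hU hU' =>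
    letters3131R_of_pins_of_maj x.toKIdx (trBasis N) (bg9Y (Matrix (Fin N) (Fin N) ℂ) (specialUnitaryUnits (Fin N)) x) (fun U => U) (parSymY x.toKIdx) (GpPhysY x.toKIdx (parSymY x.toKIdx)) (𝔯 x).Δ2 (𝔬12 x) U (hTpico12 x U) (hT2co12 x U) (hDvsco12 x U) (htaR x hM α₀ hα ha U hU hU') ((hta₂R x (hM12T.trans hM) α₀ hα (ha.trans ha12T) U hU hU').mono (kle x hM α₀ hα)) (htbR x hM α₀ hα ha U hU hU') ((htb₂R x (hM12T.trans hM) α₀ hα (ha.trans ha12T) U hU hU').mono (kle x hM α₀ hα))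
  obtain ⟨B12₀, Bh12, Bi12, Bi2₁₂, B12₂, θ12, θD, r12, M₀, a₀, hB12₀, hBh12, hBi12, hBi2₁₂, hB12₂, hθ12, hθD, hr12, hM₀g, ha₀g, hMM, haa, hmodel12, hleft12, hG0C⟩ :=
    g0_layer_of_thm310_coreB (bg := (bg9Y (Matrix (Fin N) (Fin N) ℂ) (specialUnitaryUnits (Fin N)))) c35Y_pos q hq q3 hq3 qM hqM H 𝔬A 𝔭A 𝔡A bHXA κA SHA S3A SIA SMA S2A hstA hκA h36A h36HA' h36A2
      hcntHA hcnt3A hcntIA hcntMA hcnt2A hsymA htrA 𝔬12 (fun x => (hblk12 x).trans (hblkA x).symm) (fun x => (hblkY12 x).trans (hblkYA x).symm) (fun x U => (hG0co12 x U).trans (hGcoA x U).symm)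
      (fun x U => (hDco12 x U).trans (hDcoA x U).symm) (fun x U => (hDsco12 x U).trans (hDscoA x U).symm) θ2S δ12₀ δK12 a12T M12T B12₃ δ12₃ tT δT12 ρS σS κ13 ha12Tpos hM12Tpos hθ2S hδ12₀ hB12₃ ht12T
      bH13 hκ13 hσS hρS hρST hρS₀ hρS₃ hδKS hσSK (fun x hM α₀ hα ha U hU hU' => hpos12 x (hM12T.trans hM) α₀ hα (ha.trans ha12T) U hU hU') (fun x hM α₀ hα ha U hU hU' => hinv12 x (hM12T.trans hM) α₀ hα (ha.trans ha12T) U hU hU') (fun x hM α₀ hα ha U hU hU' => hIdOfForm x (hM12T.trans hM) α₀ hα (ha.trans ha12T) U hU hU')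
      (fun x hM α₀ hα ha U hU hU' => (hletters13 x (hM12T.trans hM) α₀ hα (ha.trans ha12T) U hU hU').gD2) TaL Ta2L TbL Tb2L hL3131 hL3131H'
      (fun x hM α₀ hα ha U hU hU' => (hlettersD13 x (hM12T.trans hM) α₀ hα (ha.trans ha12T) U hU hU').1.dgDH) hstepL2
  have hδ12₀0 : 0 ≤ δ12₀ := (by linarith only [hρS, hσS, hρS₀]); have hLIM' : ∀ x : MemberY θ.d₆ θ.ℓ₆ θ.hd' θ.hL' θ.b₀ θ.b₁ Mstar, M12 ≤ (geo9Y x).M → ∀ α₀ : ℝ, 0 < α₀ → (geo9Y x).M * α₀ ≤ a12 → ∀ U : (bg9Y (Matrix (Fin N) (Fin N) ℂ) (specialUnitaryUnits (Fin N)) x).Cfg, (bg9Y (Matrix (Fin N) (Fin N) ℂ) (specialUnitaryUnits (Fin N)) x).Reg335 c35Y α₀ U → (bg9Y (Matrix (Fin N) (Fin N) ℂ) (specialUnitaryUnits (Fin N)) x).Reg336 c35Y α₀ U → Letters313IMBC (𝔬12 x) (𝔭A x) (𝔡A x).Dd (𝔡A x).Dsd 1 (H x) (fun y => (geo9Y_len_pos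 x y).le) (bHXA x) (bHX x) Br13 (fun ε => θV13 ε * ((geo9Y x).M * α₀)) Bd13 Bd2₁₃ δ12₃ δK12 (RelB x.toKIdx) U := fun x hM α₀ hα ha U hU hU' => by
    letI : Fintype (B9GeoNormsKLevelV1.geo9K x.toKIdx).Site := (inferInstance : Fintype (geo9Y x).Site); exact letters313IMBC_of_IML (hLIM x hM α₀ hα ha U hU hU') (fun ε hε y' μ hμ y'' hy => by rw [hblk12 x]; rw [hbHXA x] at hμ; exact vanishX_bHK_pins x.toKIdx (bI x) ε hε y' μ hμ y'' hy) (fun ε hε y' μ hμ y'' hy => by rw [hblk12 x]; rw [hbHXA x] at hμ ⊢; exact leX_bHK_pins x.toKIdx (bI x) ε hε y' μ hμ y'' hy)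
  obtain ⟨θD', θH, θI, M₀', hθD', hθH, hθI, hM0le, hleft12', hstepC'⟩ := stepDirB_layer_of_lettersCZX (bg := (bg9Y (Matrix (Fin N) (Fin N) ℂ) (specialUnitaryUnits (Fin N)))) q hq H 𝔭A (fun x => (𝔡A x).Dd)
    (fun x => (𝔡A x).Dsd) bHXA 𝔬12 bH13 (max κ13 1) (fun x => (hκ13 x).trans (le_max_left κ13 1)) bHX hgeoOK B12₀ δ12₀ δK12 B12₃ δ12₃ tT δT12 ρS σS θD θ2S M₀ a₀ M12T a12T Bh12 Bi12 Bq12 BhD13 Bx13 (fun _ => (coordBound39 (trBasis N) * ((θ.d₆ : ℝ) + 1) * basisBound39 (trBasis N) * B12₀ * ((θ.ℓ₆ : ℝ) + 1) * Real.exp (δ12₀ * (((θ.d₆ : ℝ) + 1) * (((θ.ℓ₆ : ℝ) + 1) + 1) + 2)) + B12₀ + coordBound39 (trBasis N) * basisBound39 (trBasis N) * B12₀)) BdX BiD BdD Bi2₁₂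
    hB12₀ hB12₃ ht12T hθD hM₀g hMM haa hBh12 hBhD13 hBx13 (fun _ _ _ => cX0_nonneg θ.d₆ θ.ℓ₆ hB12₀ δ12₀) hBdX hBiD hσS hρST hρS₀ hρS₃ (le_of_lt (lt_of_lt_of_le (add_pos hρ12 hσ12) hρδ12)) hδKS hleft12
    (fun x hM α₀ hα ha U hU hU' => (hG0C x hM α₀ hα ha U hU hU').1) (fun x hM α₀ hα ha U hU hU' => (hG0C x hM α₀ hα ha U hU hU').2.1) (fun x => (fun y => ((((θ.ℓ₆ + 1 : ℕ) : ℝ) ^ (θ.d₆ + 1)) ^ lvl x.hN x.D x.hk y)⁻¹)) (fun x y => plateau_pos x.toKIdx y) (fun x hM α₀ hα ha U hU hU' => hLH3 x (hM12T.trans hM) α₀ hα (ha.trans ha12T) U hU hU') (fun x hM α₀ hα ha U hU hU' => (hlettersD13 x (hM12T.trans hM) α₀ hα (ha.trans ha12T) U hU hU').2) (hX0_of_pins θ Mstar 𝔯 H bI hlev hβ1 𝔬A 𝔭A h𝔭A 𝔡A h𝔡Ad 𝔬12 hblk12 hB12₀ hδ12₀0 (fun x hM α₀ hα ha U hU hU'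 => (hmodel12 x hM α₀ hα ha U hU hU').1.e0) (fun x hM α₀ hα ha U hU hU' => (hG0C x hM α₀ hα ha U hU hU').1.e1d)) (fun x hM α₀ hα ha U hU hU' => hXd x (hM12T.trans hM) α₀ hα (ha.trans ha12T) U hU hU') (fun x hM α₀ hα ha U hU hU' => hdiv x (hM12T.trans hM) α₀ hα (ha.trans ha12T) U hU hU')
    (fun x => RelB x.toKIdx) (((2 * (θ.d₆ + 1) : ℕ) : ℝ)) (Nat.cast_nonneg _) (fun x y' => Nat.cast_le.mpr (hmult x y')) (fun x a b b' h => hRd₂ x a b' b h)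
    (fun x hM α₀ hα ha U hU hU' => (hLIM' x (hM12T.trans hM) α₀ hα (ha.trans ha12T) U hU hU').vanishX) (fun x hM α₀ hα ha U hU hU' => (hLIM' x (hM12T.trans hM) α₀ hα (ha.trans ha12T) U hU hU').leX) TaL Ta2L TaR Ta2R TbL Tb2L TbR Tb2R hL3131 hL3131H' hR3131 hstepL2
  have hMM' : M12 ≤ M₀' := hM12T.trans (hMM.trans hM0le); have haa12 : a₀ ≤ a12 := haa.trans ha12T; obtain ⟨t312, t313⟩ := t312_t313_of_pins_pairMBCZ_phys θ.toStage3Params Mstar 𝔯 (sectEYOfRecordV6 N θ.toStage3Params Mstar 𝔢₀) 𝔴 𝔈 bI hβI hlev hβ1 hM₀ 𝔭A (fun x => (𝔡A x).Dd) (fun x => (𝔡A x).Dsd) h𝔡Ad h𝔡As 𝔬12 H bH13 θ12 θD' r12 B12₀ δ12₀ δK12 σ12 ρ12 a₀ M₀' B12₃ δ12₃ ρ13 α12 (max κ13 1)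
    hθ12 hθD' hr12 θ2S B12₂ ρf12 θH θI Bh12 Bi12 Bq12 Bi2₁₂ hθH hθI hθ2S hB12₂ hρf12 hρf1 hρf2 hBh12 hBi12 hBi2₁₂ hBq12 bHXA hB12₀ hB12₃ hσ12 hρ12 hρS12 hρδ12 hρ₃12 ha₀g (lt_of_lt_of_le hM₀g hM0le) hα12 hα12' (fun x => (hκ13 x).trans (le_max_left κ13 1)) hρ13 hρ13ρ hσρ13 B13₄ θV13 Br13 BhD13 Bx13 Bd13 Bd2₁₃ hθV13 hB13₄ hBr13 hBhD13 hBx13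
    hBd13 hBd2₁₃ bHX (fun x ε => by rw [hbHX x]; exact le_max_right κ13 1) (fun x hM α₀ hα ha => hmodel12 x (hM0le.trans hM) α₀ hα ha) hleft12' (fun x => (fun y => ((((θ.ℓ₆ + 1 : ℕ) : ℝ) ^ (θ.d₆ + 1)) ^ lvl x.hN x.D x.hk y)⁻¹)) (fun x y => plateau_pos x.toKIdx y) (fun x hM α₀ hα ha => hlettersH12 x (hMM'.trans hM) α₀ hα (ha.trans haa12)) hpinE hpinH hpinK hblk12 hblkY12 hGco12 hG1co12 hGGco12 hDco12 hDsco12 hblkZ12 hHm12 hH1m12 hH1N hIF hHCN hsymD (fun x hM α₀ hα ha => hG0C x (hM0le.trans hM) α₀ hα ha)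
    hstepC' (fun x hM α₀ hα ha => hLHH x (hMM'.trans hM) α₀ hα (ha.trans haa12)) (fun x hM α₀ hα ha => hLH3 x (hMM'.trans hM) α₀ hα (ha.trans haa12)) (fun x => (fun y => Real.sqrt ((((θ.ℓ₆ + 1 : ℕ) : ℝ) ^ (θ.d₆ + 1)) ^ lvl x.hN x.D x.hk y)⁻¹)) (fun x y => Real.sqrt_pos.2 (plateau_pos x.toKIdx y)) (fun x hM α₀ hα ha => hLL2 x (hMM'.trans hM) α₀ hα (ha.trans haa12))
    (fun x hM α₀ hα ha => hLIM' x (hMM'.trans hM) α₀ hα (ha.trans haa12)) (fun x hM α₀ hα ha => hletters13 x (hMM'.trans hM) α₀ hα (ha.trans haa12)) (fun x hM α₀ hα ha => hlettersD13 x (hMM'.trans hM) α₀ hα (ha.trans haa12))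
  have s3132 := s3132Nu_opsYSectE_of_step12 (θ := θ.toStage3Params) (Mstar := Mstar) (𝔯 := 𝔯) (bK := trBasis N) (𝔬 := 𝔬12) (H₀ := H) (T := fun x => (lettersYOfRecordV4P N θ.toStage3Params Mstar 𝔯 x).GD) (T₁ := fun x => (lettersYOfRecordV4P N θ.toStage3Params Mstar 𝔯 x).G₁)
    (T₀ := fun x => (lettersYOfRecordV4P N θ.toStage3Params Mstar 𝔯 x).GA) (hT₀ := fun _ _ => rfl) (hblk := hblk12) (hGco := hGco12) (hG1co := hG1co12) (hG0co := hG0co12) (hlev := hlev) (hβ1 := hβ1) (hnbr := B9GeoNbrCountKLevelV1.hnbr_of_le hM₀') (θ₁ := θ12) (r₁ := r12) (B₀ := B12₀)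
    (δ₀ := δ12₀) (δK := δK12) (σ := σ12) (ρ := ρ12) (a₁ := a₀) (M₁ := M₀) (hθ₁ := hθ12) (hB₀ := hB12₀) (hσ := hσ12) (hρ := hρ12) (hρS := hρS12) (hρδ := hρδ12) (ha₁ := ha₀g) (hM₁ := hM₀g) (hgeo := hgeoOK) (hmodel := hmodel12) (a311 := a311) (M311 := M311) (ha311 := ha311) (hM311 := hM311)
    (hΔA := hΔA) (𝔏 := lettersYOfRecordV4P N θ.toStage3Params Mstar 𝔯) (𝔈 := 𝔈) (𝔢 := sectEYOfRecordV6 N θ.toStage3Params Mstar 𝔢₀) (𝔴 := 𝔴) (hQ := fun _ => rfl) (hQ₁ := fun _ => rfl)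
  have s349 : B9.Stmt349Printed (θ.d₆ + 1) c35Y geo9Y (bg9Y (Matrix (Fin N) (Fin N) ℂ) (specialUnitaryUnits (Fin N))) (fun x => ((opsYNuOfRecordV4PE N θ.toStage3Params Mstar 𝔯 (sectEYOfRecordV6 N θ.toStage3Params Mstar 𝔢₀) 𝔴 𝔈) x).P349) :=
    B9Ineq349SiteFacesAtLetters.s349_site_of_t37_display348_of θ.toStage3Params Mstar (lettersYOfRecordV4P N θ.toStage3Params Mstar 𝔯) (fun _ => rfl) (fun _ => rfl) (trBasis N) hlev hβ1 (hnbr_two_of_le hM₀) 𝔬 rd H hp t37' hblkS hblkYS hGpS hDS c35Y_pos hB39.le (hr39.trans_le hrδ39) ha39 hM39 h348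
  have h37f : (fun x => ((opsYNuOfRecordV4PE N θ.toStage3Params Mstar 𝔯 (sectEYOfRecordV6 N θ.toStage3Params Mstar 𝔢₀) 𝔴 𝔈) x).E37) = fun x => E37YPairMDir (bg := bg9Y (Matrix (Fin N) (Fin N) ℂ) (specialUnitaryUnits (Fin N))) (2 * (θ.d₆ + 1)) (nbrCountY θ.d₆ θ.ℓ₆ θ.hd' θ.hL' θ.b₀ θ.b₁ 2) (Real.sqrt ((θ.d₆ + 1) * Fintype.card (TrIdx N))) ((θ.d₆ + 1 : ℕ) : ℝ) p q p3 q3 pM qM (𝔬 x) (𝔡 x) (𝔩 x) (rd x) (H x)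
      ((opsYNuOfRecordV4PE N θ.toStage3Params Mstar 𝔯 (sectEYOfRecordV6 N θ.toStage3Params Mstar 𝔢₀) 𝔴 𝔈) x).Gp := funext hE37
  have h310f : (fun x => ((opsYNuOfRecordV4PE N θ.toStage3Params Mstar 𝔯 (sectEYOfRecordV6 N θ.toStage3Params Mstar 𝔢₀) 𝔴 𝔈) x).E310) = fun x => E310YPairM (bg := bg9Y (Matrix (Fin N) (Fin N) ℂ) (specialUnitaryUnits (Fin N))) (2 * (θ.d₆ + 1)) (nbrCountY θ.d₆ θ.ℓ₆ θ.hd' θ.hL' θ.b₀ θ.b₁ 2) (Real.sqrt ((θ.d₆ + 1) * Fintype.card (TrIdx N))) ((θ.d₆ + 1 : ℕ) : ℝ) p q p3 q3 pM qM (𝔬A x) (rdA x) (H x)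
      ((opsYNuOfRecordV4PE N θ.toStage3Params Mstar 𝔯 (sectEYOfRecordV6 N θ.toStage3Params Mstar 𝔢₀) 𝔴 𝔈) x).GA := funext hE310
  have t37 : B9.Thm37Printed c35Y geo9Y (bg9Y (Matrix (Fin N) (Fin N) ℂ) (specialUnitaryUnits (Fin N))) (fun x => ((opsYNuOfRecordV4PE N θ.toStage3Params Mstar 𝔯 (sectEYOfRecordV6 N θ.toStage3Params Mstar 𝔢₀) 𝔴 𝔈) x).E37) := h37f ▸ t37'
  have c38 : B9.Cor38Printed c35Y geo9Y (bg9Y (Matrix (Fin N) (Fin N) ℂ) (specialUnitaryUnits (Fin N))) (fun x => ((opsYNuOfRecordV4PE N θ.toStage3Params Mstar 𝔯 (sectEYOfRecordV6 N θ.toStage3Params Mstar 𝔢₀) 𝔴 𝔈) x).E37) := h37f ▸ c38'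
  have t310 : B9.Thm310Printed c35Y geo9Y (bg9Y (Matrix (Fin N) (Fin N) ℂ) (specialUnitaryUnits (Fin N))) (fun x => ((opsYNuOfRecordV4PE N θ.toStage3Params Mstar 𝔯 (sectEYOfRecordV6 N θ.toStage3Params Mstar 𝔢₀) 𝔴 𝔈) x).E310) := h310f ▸ t310'
  have hsum : B9.RWSumsYieldIneqs geo9Y (bg9Y (Matrix (Fin N) (Fin N) ℂ) (specialUnitaryUnits (Fin N))) (fun x => ((opsYNuOfRecordV4PE N θ.toStage3Params Mstar 𝔯 (sectEYOfRecordV6 N θ.toStage3Params Mstar 𝔢₀) 𝔴 𝔈) x).E37) (fun x => ((opsYNuOfRecordV4PE N θ.toStage3Params Mstar 𝔯 (sectEYOfRecordV6 N θ.toStage3Params Mstar 𝔢₀) 𝔴 𝔈) x).E310)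
      (fun x => ((opsYNuOfRecordV4PE N θ.toStage3Params Mstar 𝔯 (sectEYOfRecordV6 N θ.toStage3Params Mstar 𝔢₀) 𝔴 𝔈) x).Gp) (fun x => ((opsYNuOfRecordV4PE N θ.toStage3Params Mstar 𝔯 (sectEYOfRecordV6 N θ.toStage3Params Mstar 𝔢₀) 𝔴 𝔈) x).GA) := by
    rw [h37f, h310f]; exact hsum'
  have hE4 := hE4_of_hGA_e4 (opsYNuOfRecordV4PE N θ.toStage3Params Mstar 𝔯 (sectEYOfRecordV6 N θ.toStage3Params Mstar 𝔢₀) 𝔴 𝔈) (hGA_e4_opsYOfLetters N θ.toStage3Params Mstar (lettersYOfRecordV4P N θ.toStage3Params Mstar 𝔯) 𝔈)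
  have hH2 := hH2_of_hGA_h2 (opsYNuOfRecordV4PE N θ.toStage3Params Mstar 𝔯 (sectEYOfRecordV6 N θ.toStage3Params Mstar 𝔢₀) 𝔴 𝔈) (hGA_h2_opsYOfLetters N θ.toStage3Params Mstar (lettersYOfRecordV4P N θ.toStage3Params Mstar 𝔯) 𝔈)
  have hg := hg_obligation_vacuous θ.toStage3Params Mstar (opsYNuOfRecordV4PE N θ.toStage3Params Mstar 𝔯 (sectEYOfRecordV6 N θ.toStage3Params Mstar 𝔢₀) 𝔴 𝔈)
  exact b9_main_of_up_view₁₁B10YZW_of_obligations θ hθ Mstar (opsYNuOfRecordV4PE N θ.toStage3Params Mstar 𝔯 (sectEYOfRecordV6 N θ.toStage3Params Mstar 𝔢₀) 𝔴 𝔈) ζ lamW w hup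
    (hGp_e_opsYOfLetters N θ.toStage3Params Mstar (lettersYOfRecordV4P N θ.toStage3Params Mstar 𝔯) 𝔈) (hGp_h1_opsYOfLetters N θ.toStage3Params Mstar (lettersYOfRecordV4P N θ.toStage3Params Mstar 𝔯) 𝔈)
    (hC_opsYOfLetters N θ.toStage3Params Mstar (lettersYOfRecordV4P N θ.toStage3Params Mstar 𝔯) 𝔈) (hGA_e_opsYOfLetters N θ.toStage3Params Mstar (lettersYOfRecordV4P N θ.toStage3Params Mstar 𝔯) 𝔈)
    (hGA_h1_opsYOfLetters N θ.toStage3Params Mstar (lettersYOfRecordV4P N θ.toStage3Params Mstar 𝔯) 𝔈) (hGA_e4_opsYOfLetters N θ.toStage3Params Mstar (lettersYOfRecordV4P N θ.toStage3Params Mstar 𝔯) 𝔈)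
    (hGA_h2_opsYOfLetters N θ.toStage3Params Mstar (lettersYOfRecordV4P N θ.toStage3Params Mstar 𝔯) 𝔈) (hGA_l2_opsYOfLetters N θ.toStage3Params Mstar (lettersYOfRecordV4P N θ.toStage3Params Mstar 𝔯) 𝔈)
    hE4 hH2 hGp hGA hB hg t37 c38 t39 t310 hsum hksum t311 t312 t313 t314 t315 s349 s3132 t314loc P

end Pointed

end Summit.QuantumFields.YangMills.BalabanUVNodes.N06AtOpsYNuOfRecordV6EPairNN
end
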